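import Literature.RepresentationTheory.FiniteGroups.KLRGradedCellularBasisPsiBraidProofs
import Literature.RepresentationTheory.FiniteGroups.SymmetricGroupCoxeterPresentation
import Mathlib.Algebra.RingQuot
import Mathlib.Algebra.FreeAlgebra
import Mathlib.Algebra.CharP.Basic
import Mathlib.Data.ZMod.Basic
import HarnessLib

/-!
# Towards `KLRGradedCellularBasis_holds`, IV: the cyclotomic KLR algebra `R^{Λ₀}_n` and
Brundan–Kleshchev's homomorphism `R^{Λ₀}_n → k[S_n]`

Topic `Literature/RepresentationTheory/FiniteGroups`; fourth "Proofs" sibling of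
`KLRGradedCellularBasis.lean` (Hu–Mathas 2010, Main Theorem, level one and degenerate).

We define Brundan–Kleshchev's (sign-modified) cyclotomic Khovanov–Lauda–Rouquier algebra of type
`A^{(1)}_{p-1}` and level one, `R^{Λ₀}_n` (arXiv:0808.2032, Main Theorem and §2.2; Hu–Mathas 2010,
Def 3.1 / Thm 24), as a presented `k`-algebra `KLRAlgebra k p n := RingQuot (KLRRel k)` of the free
algebra on the **idempotented** generators `e(𝐢)` (`𝐢 ∈ (ℤ/p)^n`), `y_r` and `ψ_r e(𝐢)` — we use
`ψ_r e(𝐢)` rather than `ψ_r = ∑_𝐢 ψ_r e(𝐢)` as generators so that every generator and every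
relation is homogeneous for the KLR grading `deg e(𝐢) = 0`, `deg y_r = 2`,
`deg ψ_r e(𝐢) = -a_{i_r i_{r+1}}` (the evident isomorphism with the presentation on `e(𝐢), y_r, ψ_r`
sends `ψ_r ↦ ∑_𝐢 ψ_r e(𝐢)`); and we construct **Brundan–Kleshchev's homomorphism
`klrToGroupAlgebra : R^{Λ₀}_n →ₐ[k] k[S_n]`** (`e(𝐢) ↦ e(𝐢)`, `y_r ↦ y_r`, `ψ_r e(𝐢) ↦ ψ_r e(𝐢)` of the
three earlier siblings), well defined because every defining relation holds in `k[S_n]` — the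
content of BK Theorem 3.2 (level one, degenerate case), assembled from the earlier siblings.

Further contents: **the `ℤ`-grading of `R^{Λ₀}_n`** (`klrDegPart`, `iSup_klrDegPart_eq_top`,
`mul_mem_klrDegPart`, `iSupIndep_klrDegPart` — realised through the algebra map
`klrGrading : R → R[t, t⁻¹]`, `g ↦ g t^{deg g}`, which exists because all relations are homogeneous);
the relations as identities in `R^{Λ₀}_n` (`klrIdemR`, `klrYR`, `klrPsiR` and their calculus);
**Brundan–Kleshchev Lemma 2.1** (`isNilpotent_klrYR`: the `y_r` are nilpotent in `R^{Λ₀}_n`);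
Brundan–Kleshchev's Hecke generators `x_r`, `s_r ∈ R^{Λ₀}_n` ((3.41)–(3.42): `klrXR`, `klrSR` with
`klrPR`, `klrQR` = `p_r(𝐢)`, `q_r(𝐢)`), and the first relations of BK Thm 3.3: `commute_klrXR`,
the mixed relations `klrSR_mul_klrXR_succ_sub` (`s_r x_{r+1} - x_r s_r = 1`), `klrSR_mul_klrXR_of_ne`,
and the exchange rules `klrPR_swap_mul_klrPsiR`, `klrQR_swap_mul_klrPsiR` through `ψ_r e(𝐢)`.

Batch 2 adds: the commutative double commutant `klrYAlg` of the `ȳ`'s (home of the scalar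
identities, transferred by `exact_mod_cast` + `linear_combination`), **the quadratic relation
`s_r² = 1`** (`klrSR_mul_self`; BK Thm 3.3 (3.9), via `klrQuadratic_scalar` =
`Q_{i_ri_{r+1}}(ȳ)·{}^{s_r}q_r(s_r𝐢)·q_r(𝐢) + p_r(𝐢)² = 1`) and **the commuting braid relation
`s_r s_t = s_t s_r`** (`klrSR_comm_of_far`; BK Thm 3.3 (3.10), second part).

Batch 3 adds **BK §3.5 conditional on the length-three braid relation** (`hbraid`, spelled out as
a hypothesis in each statement): the images `σ(s_r) = s_r`, `σ(x_r) = L_r`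
(`klrToGroupAlgebra_klrSR`, `klrToGroupAlgebra_klrXR`); the Coxeter data `isCoxeterDataA_klrSRseq`
and **BK's inverse map `ρ = klrRho : k[S_n] → R^{Λ₀}_n`** through the Coxeter presentation of `S_n`
(`permFinLift`); `σ ∘ ρ = id` (`klrToGroupAlgebra_comp_klrRho`); `ρ(L_r) = x_r`
(`klrRho_jucysMurphy`), **`ρ(e(𝐢)) = ē(𝐢)`** (`klrRho_klrIdempotent`, the weight argument of BK
Lemma 3.4), `ρ(y_r) = ȳ_r`, `ρ(ψ_r e(𝐢)) = ψ_r e(𝐢)`; `ρ ∘ σ = id` (`klrRho_comp_klrToGroupAlgebra`),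
hence `σ` is bijective and **`klrAlgEquivOfBraid : R^{Λ₀}_n ≃ₐ[k] k[S_n]`** — Brundan–Kleshchev's
Main Theorem at level one in the degenerate case, *given* the braid relation of Thm 3.3.

Batch 4 adds: the **unconditional surjectivity of `σ`** (`klrToGroupAlgebra_surjective'`); the
exchange calculus through `ψ_r e(𝐢)` (BK (2.9) for the scalars that occur: `klrDelta`, the rules for
`ȳ_t`, difference units and their inverses, `p`, and `q` in each quiver branch, plus the rule
combinators); and the **braid relation of BK Thm 3.3 on `ē(𝐢)` in two of the five cases**: three
distinct residues (`klrSR_braid_mul_klrIdemR_of_distinct`, via the `ψ`-word normal forms of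
`s_rs_{r+1}s_rē(𝐢)` and `s_{r+1}s_rs_{r+1}ē(𝐢)`, the quadratic identity and the partial-fraction
identity `p_{r,r+1}p_{r+1,r+2} = p_{r,r+2}(p_{r,r+1} + p_{r+1,r+2})`), and all residues equal
(`klrSR_braid_mul_klrIdemR_of_eq_eq`).

Still missing towards `KLRGradedCellularBasis_holds`: the braid relation in the three mixed cases
`i_r = i_{r+1} ≠ i_{r+2}`, `i_r ≠ i_{r+1} = i_{r+2}`, `i_r = i_{r+2} ≠ i_{r+1}` (then `hbraid` is
discharged and the isomorphism is unconditional), and Hu–Mathas §3.3–§5 (Murphy basis, seminormal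
forms, the `ψ_{𝔰𝔱}`, degrees).

## References

* J. Hu, A. Mathas, *Graded cellular bases for the cyclotomic Khovanov–Lauda–Rouquier algebras of
  type A*, Adv. Math. 225 (2010), arXiv:0907.2985, §3.1 and Thm 24. [HuMathas2010]
* J. Brundan, A. Kleshchev, *Blocks of cyclotomic Hecke algebras and Khovanov–Lauda algebras*,
  Invent. Math. 178 (2009), arXiv:0808.2032, Main Theorem, §2.2, Thm 3.2 — cited through
  [HuMathas2010, Thm 24].
-/

noncomputable section

open scoped BigOperators

namespace Literature.RepresentationTheory.FiniteGroups

open Equiv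

/-- Idempotented generators of `R^{Λ₀}_n`: `e(𝐢)` (`𝐢 ∈ (ℤ/p)^n`), `y_r` (`r < n`) and `ψ_r e(𝐢)`
(`r < n`; `ψ_{n-1} e(𝐢)` is set to `0` by a relation). [cite: HuMathas2010, Def 3.1] -/
inductive KLRGen (p n : ℕ) : Type
  | idem : (Fin n → ZMod p) → KLRGen p n
  | y : Fin n → KLRGen p n
  | psi : Fin n → (Fin n → ZMod p) → KLRGen p n

section Defs

variable (k : Type*) [Field k] (p n : ℕ) [Fact p.Prime]

/-- The free `k`-algebra on the idempotented KLR generators. [folklore] -/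
abbrev KLRFree := FreeAlgebra k (KLRGen p n)

variable {p n}

/-- The generator `e(𝐢)` in the free algebra. [folklore] -/
def klrE (i : Fin n → ZMod p) : KLRFree k p n := FreeAlgebra.ι k (KLRGen.idem i)

/-- The generator `y_r` in the free algebra. [folklore] -/
def klrY (r : Fin n) : KLRFree k p n := FreeAlgebra.ι k (KLRGen.y r)

/-- The generator `ψ_r e(𝐢)` in the free algebra. [folklore] -/
def klrP (r : Fin n) (i : Fin n → ZMod p) : KLRFree k p n := FreeAlgebra.ι k (KLRGen.psi r i)

/-- The right-hand side `Q_{i_r i_{r+1}}(y_r, y_{r+1})` of relation (R4) for the quiver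
`i → j ⟺ j = i + 1` on `ℤ/p`. [cite: HuMathas2010, Def 3.1] -/
def klrQTerm (r r' : Fin n) (i : Fin n → ZMod p) : KLRFree k p n :=
  if i r = i r' then 0
  else if i r' = i r + 1 then
    (if i r = i r' + 1 then (klrY k r' - klrY k r) * (klrY k r - klrY k r') else klrY k r' - klrY k r)
  else (if i r = i r' + 1 then klrY k r - klrY k r' else 1)

/-- The correction term of the braid relation (R7). [cite: HuMathas2010, Def 3.1] -/
def klrBraidTerm (r r' r'' : Fin n) (i : Fin n → ZMod p) : KLRFree k p n :=
  if i r = i r'' ∧ i r ≠ i r' then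
    (if i r' = i r + 1 then
        (if i r = i r' + 1 then klrY k r - 2 * klrY k r' + klrY k r'' else 1)
      else (if i r = i r' + 1 then -1 else 0))
  else 0

/-- **The defining relations of `R^{Λ₀}_n`**, idempotented form of Brundan–Kleshchev's presentation
at level one (with `P_r(𝐢) := ψ_r e(𝐢)`, `s_r𝐢 := 𝐢 ∘ s_r`): idempotent relations
`e(𝐢)e(𝐣) = δe(𝐢)`, `∑ e(𝐢) = 1`, `P_r(𝐢)e(𝐣) = δ_{𝐢𝐣}P_r(𝐢)`, `e(𝐣)P_r(𝐢) = δ_{𝐣,s_r𝐢}P_r(𝐢)`; the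
cyclotomic relation `y_1^{δ_{i_1,0}} e(𝐢) = 0`; `y`'s central w.r.t. `e`'s and commuting;
`P_r(𝐢) y_t = y_t P_r(𝐢)` (`t ≠ r, r+1`); far commutation `P_r(s_t𝐢)P_t(𝐢) = P_t(s_r𝐢)P_r(𝐢)`;
`P_r(𝐢) y_{r+1} = y_r P_r(𝐢) + δ e(𝐢)`, `y_{r+1} P_r(𝐢) = P_r(𝐢) y_r + δ e(𝐢)`; (R4)
`P_r(s_r𝐢)P_r(𝐢) = Q(𝐢) e(𝐢)`; (R7); and `P_{n-1}(𝐢) = 0`.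
[cite: HuMathas2010, Def 3.1 and Thm 24] -/
inductive KLRRel : KLRFree k p n → KLRFree k p n → Prop
  | idem_mul (i j : Fin n → ZMod p) :
      KLRRel (klrE k i * klrE k j) (if i = j then klrE k i else 0)
  | idem_sum : KLRRel (∑ i : Fin n → ZMod p, klrE k i) 1
  | psi_idem (r : Fin n) (i j : Fin n → ZMod p) :
      KLRRel (klrP k r i * klrE k j) (if i = j then klrP k r i else 0)
  | idem_psi (r r' : Fin n) (h : (r' : ℕ) = r + 1) (i j : Fin n → ZMod p) :
      KLRRel (klrE k j * klrP k r i) (if j = i ∘ swap r r' then klrP k r i else 0)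
  | cyc (i : Fin n → ZMod p) (r : Fin n) (hr : (r : ℕ) = 0) :
      KLRRel (klrY k r ^ (if i r = 0 then 1 else 0) * klrE k i) 0
  | y_idem (r : Fin n) (i : Fin n → ZMod p) : KLRRel (klrY k r * klrE k i) (klrE k i * klrY k r)
  | y_comm (r s : Fin n) : KLRRel (klrY k r * klrY k s) (klrY k s * klrY k r)
  | psi_y (r r' t : Fin n) (h : (r' : ℕ) = r + 1) (htr : t ≠ r) (htr' : t ≠ r')
      (i : Fin n → ZMod p) : KLRRel (klrP k r i * klrY k t) (klrY k t * klrP k r i)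
  | psi_comm (r r' t t' : Fin n) (hr : (r' : ℕ) = r + 1) (ht : (t' : ℕ) = t + 1)
      (h1 : t ≠ r) (h2 : t ≠ r') (h3 : t' ≠ r) (h4 : t' ≠ r') (i : Fin n → ZMod p) :
      KLRRel (klrP k r (i ∘ swap t t') * klrP k t i) (klrP k t (i ∘ swap r r') * klrP k r i)
  | psi_y_succ (r r' : Fin n) (h : (r' : ℕ) = r + 1) (i : Fin n → ZMod p) :
      KLRRel (klrP k r i * klrY k r')
        (klrY k r * klrP k r i + if i r = i r' then klrE k i else 0)
  | y_succ_psi (r r' : Fin n) (h : (r' : ℕ) = r + 1) (i : Fin n → ZMod p) :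
      KLRRel (klrY k r' * klrP k r i)
        (klrP k r i * klrY k r + if i r = i r' then klrE k i else 0)
  | psi_sq (r r' : Fin n) (h : (r' : ℕ) = r + 1) (i : Fin n → ZMod p) :
      KLRRel (klrP k r (i ∘ swap r r') * klrP k r i) (klrQTerm k r r' i * klrE k i)
  | braid (r r' r'' : Fin n) (h : (r' : ℕ) = r + 1) (h' : (r'' : ℕ) = r' + 1) (i : Fin n → ZMod p) :
      KLRRel (klrP k r ((i ∘ swap r r') ∘ swap r' r'') * klrP k r' (i ∘ swap r r') * klrP k r i)
        (klrP k r' ((i ∘ swap r' r'') ∘ swap r r') * klrP k r (i ∘ swap r' r'') * klrP k r' i +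
          klrBraidTerm k r r' r'' i * klrE k i)
  | psi_last (r : Fin n) (h : n ≤ (r : ℕ) + 1) (i : Fin n → ZMod p) : KLRRel (klrP k r i) 0

variable (p n)

/-- **Brundan–Kleshchev's cyclotomic KLR algebra `R^{Λ₀}_n` of type `A^{(1)}_{p-1}`, level one**
(sign-modified, as in arXiv:0808.2032 §2.2 / Hu–Mathas Def 3.1), as a presented `k`-algebra
(idempotented presentation). [cite: HuMathas2010, Def 3.1] -/
abbrev KLRAlgebra := RingQuot (KLRRel k (p := p) (n := n))

/-- The quotient map from the free algebra. [folklore] -/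
def klrMk : KLRFree k p n →ₐ[k] KLRAlgebra k p n := RingQuot.mkAlgHom k (KLRRel k)

end Defs

/-! ### The homomorphism to `k[S_n]` -/

section ToGroupAlgebra

variable (k : Type*) [Field k] [DecidableEq k] (p n : ℕ) [Fact p.Prime] [CharP k p]

/-- Residues in `ℤ/p` viewed in `k` (`char k = p`). [folklore] -/
def resCast (i : Fin n → ZMod p) : Fin n → k := (ZMod.castHom (dvd_refl p) k) ∘ i

variable {p n}

omit [DecidableEq k] in
/-- `resCast` is injective in each coordinate. [folklore] -/
theorem resCast_apply_eq_iff (i : Fin n → ZMod p) (r s : Fin n) :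
    resCast k p n i r = resCast k p n i s ↔ i r = i s :=
  (ZMod.castHom (dvd_refl p) k).injective.eq_iff

omit [DecidableEq k] in
/-- `i_s = i_r + 1` transfers along `resCast`. [folklore] -/
theorem resCast_succ_iff (i : Fin n → ZMod p) (r s : Fin n) :
    resCast k p n i s = resCast k p n i r + 1 ↔ i s = i r + 1 := by
  rw [resCast, Function.comp_apply, Function.comp_apply, ← map_one (ZMod.castHom (dvd_refl p) k),
    ← map_add]
  exact (ZMod.castHom (dvd_refl p) k).injective.eq_iff

omit [DecidableEq k] in
/-- `i_r = 0` transfers along `resCast`. [folklore] -/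
theorem resCast_eq_zero_iff (i : Fin n → ZMod p) (r : Fin n) : resCast k p n i r = 0 ↔ i r = 0 := by
  rw [resCast, Function.comp_apply, ← map_zero (ZMod.castHom (dvd_refl p) k)]
  exact (ZMod.castHom (dvd_refl p) k).injective.eq_iff

omit [DecidableEq k] in
/-- `resCast` is injective. [folklore] -/
theorem resCast_injective : Function.Injective (resCast k p n) :=
  fun _ _ h => funext fun r => (ZMod.castHom (dvd_refl p) k).injective (congrFun h r)

omit [DecidableEq k] [Fact p.Prime] in
/-- `resCast` commutes with `s_r`. [folklore] -/
theorem resCast_comp_swap (i : Fin n → ZMod p) (r r' : Fin n) :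
    resCast k p n (i ∘ swap r r') = resCast k p n i ∘ swap r r' := rfl

/-- `ψ_r` of `k[S_n]` indexed by its left position only (`0` for `r = n - 1`). [folklore] -/
def bkPsi' (r : Fin n) : MonoidAlgebra k (Perm (Fin n)) :=
  if h : (r : ℕ) + 1 < n then bkPsi k r ⟨(r : ℕ) + 1, h⟩ else 0

/-- `bkPsi' r = ψ_r`. [folklore] -/
theorem bkPsi'_eq {r r' : Fin n} (h : (r' : ℕ) = r + 1) : bkPsi' k r = bkPsi k r r' := by
  have hlt : (r : ℕ) + 1 < n := h ▸ r'.2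
  have hr' : r' = ⟨(r : ℕ) + 1, hlt⟩ := Fin.ext h
  rw [bkPsi', dif_pos hlt, hr']

/-- `bkPsi' (n-1) = 0`. [folklore] -/
theorem bkPsi'_eq_zero {r : Fin n} (h : n ≤ (r : ℕ) + 1) : bkPsi' k r = 0 := by
  rw [bkPsi', dif_neg (not_lt.2 h)]

/-- The images of the generators in `k[S_n]`: `e(𝐢) ↦ e(𝐢)`, `y_r ↦ y_r`, `ψ_r e(𝐢) ↦ ψ_r e(𝐢)`.
[folklore] -/
def klrGenImage : KLRGen p n → MonoidAlgebra k (Perm (Fin n))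
  | KLRGen.idem i => klrIdempotent k (resCast k p n i)
  | KLRGen.y r => bkNilpotent k r
  | KLRGen.psi r i => bkPsi' k r * klrIdempotent k (resCast k p n i)

/-- The lift `σ₀` of the generator images to the free algebra. [folklore] -/
def klrFreeLift : KLRFree k p n →ₐ[k] MonoidAlgebra k (Perm (Fin n)) :=
  FreeAlgebra.lift k (klrGenImage k (p := p) (n := n))

omit [Fact p.Prime] in
/-- `σ₀(e(𝐢)) = e(𝐢)`. [folklore] -/
@[simp] theorem klrFreeLift_E (i : Fin n → ZMod p) :
    klrFreeLift k (klrE k i) = klrIdempotent k (resCast k p n i) := by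
  simp [klrFreeLift, klrE, klrGenImage]

omit [Fact p.Prime] in
/-- `σ₀(y_r) = y_r`. [folklore] -/
@[simp] theorem klrFreeLift_Y (r : Fin n) : klrFreeLift k (p := p) (klrY k r) = bkNilpotent k r := by
  simp [klrFreeLift, klrY, klrGenImage]

omit [Fact p.Prime] in
/-- `σ₀(ψ_r e(𝐢)) = ψ_r e(𝐢)`. [folklore] -/
theorem klrFreeLift_P {r r' : Fin n} (h : (r' : ℕ) = r + 1) (i : Fin n → ZMod p) :
    klrFreeLift k (klrP k r i) = bkPsi k r r' * klrIdempotent k (resCast k p n i) := by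
  simp [klrFreeLift, klrP, klrGenImage, bkPsi'_eq k h]

omit [Fact p.Prime] in
/-- `σ₀(ψ_{n-1} e(𝐢)) = 0`. [folklore] -/
theorem klrFreeLift_P_last {r : Fin n} (h : n ≤ (r : ℕ) + 1) (i : Fin n → ZMod p) :
    klrFreeLift k (klrP k r i) = 0 := by
  simp [klrFreeLift, klrP, klrGenImage, bkPsi'_eq_zero k h]

omit [Fact p.Prime] in
/-- `σ₀(ψ_r e(𝐢)) = ψ'_r e(𝐢)` in general. [folklore] -/
theorem klrFreeLift_P' (r : Fin n) (i : Fin n → ZMod p) :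
    klrFreeLift k (klrP k r i) = bkPsi' k r * klrIdempotent k (resCast k p n i) := by
  simp [klrFreeLift, klrP, klrGenImage]

/-- `∑_{𝐢 ∈ (ℤ/p)^n} e(𝐢) = 1` in `k[S_n]` (`char k = p`). [folklore] -/
theorem sum_klrIdempotent_resCast :
    ∑ i : Fin n → ZMod p, klrIdempotent k (resCast k p n i) = 1 := by
  classical
  have hS : ∀ χ : Fin n → k, jointEigenspace k χ ≠ ⊥ →
      χ ∈ (Finset.univ : Finset (Fin n → ZMod p)).image (resCast k p n) := by
    intro χ hχ
    have hmem := mem_residueSeqs_of_ne_bot k hχ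
    rw [residueSeqs, Fintype.mem_piFinset] at hmem
    refine Finset.mem_image.2 ⟨fun r => ((Classical.choose (Finset.mem_image.1 (hmem r)) : ℤ) : ZMod p),
      Finset.mem_univ _, ?_⟩
    funext r
    have hc := Classical.choose_spec (Finset.mem_image.1 (hmem r))
    rw [resCast, Function.comp_apply, map_intCast]
    exact hc.2
  rw [← sum_klrIdempotent k _ hS, Finset.sum_image fun x _ y _ hxy => resCast_injective k hxy]

/-- `ψ_r M_𝐢 ⊆ M_{s_r𝐢}`. [folklore] -/
theorem bkPsi_mul_mem {r r' : Fin n} (h : (r' : ℕ) = r + 1) {χ : Fin n → k}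
    {w : MonoidAlgebra k (Perm (Fin n))} (hw : w ∈ jointEigenspace k χ) :
    bkPsi k r r' * w ∈ jointEigenspace k (χ ∘ swap r r') := by
  rw [← klrIdempotent_mul_of_mem k hw, ← mul_assoc, bkPsi_mul_klrIdempotent_eq k h, mul_assoc]
  exact mul_mem_jointEigenspace k (klrIdempotent_mem k _) _

/-- **Every defining relation of `R^{Λ₀}_n` holds in `k[S_n]`** (Brundan–Kleshchev Thm 3.2 at
level one, degenerate case — the content of the three earlier siblings). [folklore] -/
theorem klrFreeLift_rel {a b : KLRFree k p n} (hab : KLRRel k a b) :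
    klrFreeLift k a = klrFreeLift k b := by
  induction hab with
  | idem_mul i j =>
    rw [map_mul, klrFreeLift_E, klrFreeLift_E]
    by_cases hij : i = j
    · subst hij; rw [if_pos rfl, klrFreeLift_E, klrIdempotent_mul_self]
    · rw [if_neg hij, map_zero, klrIdempotent_mul_klrIdempotent_of_ne k
        (fun e => hij (resCast_injective k e))]
  | idem_sum => rw [map_sum, map_one]; simp only [klrFreeLift_E]; exact sum_klrIdempotent_resCast k
  | psi_idem r i j =>
    rw [map_mul, klrFreeLift_P', klrFreeLift_E, apply_ite (klrFreeLift k (p := p) (n := n)),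
      klrFreeLift_P', map_zero, mul_assoc]
    by_cases hij : i = j
    · subst hij; rw [if_pos rfl, klrIdempotent_mul_self]
    · rw [if_neg hij, klrIdempotent_mul_klrIdempotent_of_ne k (fun e => hij (resCast_injective k e)),
        mul_zero]
  | idem_psi r r' h i j =>
    rw [map_mul, klrFreeLift_P k h, klrFreeLift_E, apply_ite (klrFreeLift k (p := p) (n := n)),
      klrFreeLift_P k h, map_zero]
    by_cases hj : j = i ∘ swap r r'
    · rw [if_pos hj, hj, resCast_comp_swap,
        klrIdempotent_mul_of_mem k (bkPsi_mul_mem k h (klrIdempotent_mem k _))]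
    · rw [if_neg hj]
      refine klrIdempotent_mul_of_mem_ne k (fun e => hj ?_) (bkPsi_mul_mem k h (klrIdempotent_mem k _))
      rw [← resCast_comp_swap] at e
      exact (resCast_injective k e).symm
  | cyc i r hr =>
    rw [map_mul, map_pow, klrFreeLift_Y, klrFreeLift_E, map_zero]
    have := bkNilpotent_pow_mul_klrIdempotent_eq_zero k hr (resCast k p n i)
    simp only [resCast_eq_zero_iff] at this
    exact this
  | y_idem r i =>
    rw [map_mul, map_mul, klrFreeLift_Y, klrFreeLift_E]
    exact (commute_klrIdempotent_bkNilpotent k _ r).symm.eq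
  | y_comm r s => rw [map_mul, map_mul, klrFreeLift_Y, klrFreeLift_Y]; exact (commute_bkNilpotent k r s).eq
  | psi_y r r' t h htr htr' i =>
    rw [map_mul, map_mul, klrFreeLift_P k h, klrFreeLift_Y, mul_assoc,
      (commute_klrIdempotent_bkNilpotent k _ t).eq, ← mul_assoc, bkPsi_mul_bkNilpotent_of_ne k h htr htr',
      mul_assoc]
  | psi_comm r r' t t' hr ht h1 h2 h3 h4 i =>
    rw [map_mul, map_mul, klrFreeLift_P k hr, klrFreeLift_P k ht, klrFreeLift_P k hr, klrFreeLift_P k ht,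
      resCast_comp_swap, resCast_comp_swap, mul_assoc,
      klrIdempotent_mul_of_mem k (bkPsi_mul_mem k ht (klrIdempotent_mem k _)), mul_assoc,
      klrIdempotent_mul_of_mem k (bkPsi_mul_mem k hr (klrIdempotent_mem k _)), ← mul_assoc,
      ← mul_assoc, bkPsi_comm_of_far k hr ht h1 h2 h3 h4]
  | psi_y_succ r r' h i =>
    rw [map_mul, map_add, map_mul, klrFreeLift_P k h, klrFreeLift_Y, klrFreeLift_Y,
      apply_ite (klrFreeLift k (p := p) (n := n)), klrFreeLift_E, map_zero, mul_assoc,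
      (commute_klrIdempotent_bkNilpotent k _ r').eq, ← mul_assoc,
      bkPsi_mul_bkNilpotent_succ_mul_klrIdempotent k h (resCast k p n i), add_mul, mul_assoc, ite_mul,
      one_mul, zero_mul]
    simp only [resCast_apply_eq_iff]
  | y_succ_psi r r' h i =>
    rw [map_mul, map_add, map_mul, klrFreeLift_P k h, klrFreeLift_Y, klrFreeLift_Y,
      apply_ite (klrFreeLift k (p := p) (n := n)), klrFreeLift_E, map_zero, ← mul_assoc,
      bkNilpotent_succ_mul_bkPsi_mul_klrIdempotent k h (resCast k p n i), add_mul, ite_mul, one_mul,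
      zero_mul, mul_assoc, ← (commute_klrIdempotent_bkNilpotent k _ r).eq, ← mul_assoc]
    simp only [resCast_apply_eq_iff]
  | psi_sq r r' h i =>
    rw [map_mul, map_mul, klrFreeLift_P k h, klrFreeLift_P k h, klrFreeLift_E, resCast_comp_swap,
      mul_assoc, klrIdempotent_mul_of_mem k (bkPsi_mul_mem k h (klrIdempotent_mem k _)), ← mul_assoc]
    have := bkPsi_sq_mul_klrIdempotent k h (resCast k p n i)
    simp only [resCast_apply_eq_iff, resCast_succ_iff] at this
    rw [this, klrQTerm]
    simp only [apply_ite (klrFreeLift k (p := p) (n := n)), map_zero, map_one, map_mul, map_sub,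
      klrFreeLift_Y]
  | braid r r' r'' h h' i =>
    rw [map_add]
    simp only [map_mul, klrFreeLift_P k h, klrFreeLift_P k h', klrFreeLift_E, resCast_comp_swap]
    -- unscramble `ψ e ψ e ψ e = ψψψ e`
    have hL : bkPsi k r r' * klrIdempotent k ((resCast k p n i ∘ swap r r') ∘ swap r' r'') *
        (bkPsi k r' r'' * klrIdempotent k (resCast k p n i ∘ swap r r')) *
        (bkPsi k r r' * klrIdempotent k (resCast k p n i)) =
        bkPsi k r r' * bkPsi k r' r'' * bkPsi k r r' * klrIdempotent k (resCast k p n i) := by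
      simp only [mul_assoc]
      rw [klrIdempotent_mul_of_mem k (bkPsi_mul_mem k h (klrIdempotent_mem k _)),
        klrIdempotent_mul_of_mem k (bkPsi_mul_mem k h' (bkPsi_mul_mem k h (klrIdempotent_mem k _)))]
    have hR : bkPsi k r' r'' * klrIdempotent k ((resCast k p n i ∘ swap r' r'') ∘ swap r r') *
        (bkPsi k r r' * klrIdempotent k (resCast k p n i ∘ swap r' r'')) *
        (bkPsi k r' r'' * klrIdempotent k (resCast k p n i)) =
        bkPsi k r' r'' * bkPsi k r r' * bkPsi k r' r'' * klrIdempotent k (resCast k p n i) := by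
      simp only [mul_assoc]
      rw [klrIdempotent_mul_of_mem k (bkPsi_mul_mem k h' (klrIdempotent_mem k _)),
        klrIdempotent_mul_of_mem k (bkPsi_mul_mem k h (bkPsi_mul_mem k h' (klrIdempotent_mem k _)))]
    rw [hL, hR]
    have := bkPsi_braid k h h' (resCast k p n i)
    simp only [resCast_apply_eq_iff, resCast_succ_iff] at this
    rw [this, klrBraidTerm]
    simp only [apply_ite (klrFreeLift k (p := p) (n := n)), map_zero, map_one, map_mul, map_sub,
      map_add, map_neg, map_ofNat, klrFreeLift_Y, ne_eq, resCast_apply_eq_iff]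
  | psi_last r h i => rw [klrFreeLift_P_last k h, map_zero]

variable (p n)

/-- **Brundan–Kleshchev's homomorphism `σ : R^{Λ₀}_n → k[S_n]`**, `e(𝐢) ↦ e(𝐢)`, `y_r ↦ y_r`,
`ψ_r e(𝐢) ↦ ψ_r e(𝐢)` (arXiv:0808.2032 §3.5, well defined by Thm 3.2; cited through
[HuMathas2010, Thm 24]). [folklore] -/
def klrToGroupAlgebra : KLRAlgebra k p n →ₐ[k] MonoidAlgebra k (Perm (Fin n)) :=
  RingQuot.liftAlgHom k ⟨klrFreeLift k, fun _ _ h => klrFreeLift_rel k h⟩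

variable {p n}

/-- `σ ∘ mk = σ₀`. [folklore] -/
theorem klrToGroupAlgebra_mk (a : KLRFree k p n) :
    klrToGroupAlgebra k p n (klrMk k p n a) = klrFreeLift k a := by
  rw [klrToGroupAlgebra, klrMk]
  exact RingQuot.liftAlgHom_mkAlgHom_apply _ _ _ _

end ToGroupAlgebra


/-! ### The KLR grading

`deg e(𝐢) = 0`, `deg y_r = 2`, `deg ψ_r e(𝐢) = -a_{i_r i_{r+1}}` (Cartan matrix of type `A^{(1)}_{p-1}`;
Hu–Mathas 2010 §3.1, Brundan–Kleshchev (grading) after Cor 2.2). Every relation is homogeneous, so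
`R^{Λ₀}_n` is `ℤ`-graded. We realise the grading without quotient-of-graded-ring infrastructure by
the standard device: the algebra map `θ : R^{Λ₀}_n → R^{Λ₀}_n[t, t⁻¹]` with `θ(g) = g t^{deg g}` on
generators exists (relations homogeneous), and reading off `t`-coefficients separates degrees. -/

section Grading

variable (k : Type*) [Field k] {p n : ℕ}

/-- The Cartan integer `a_{ab}` of the quiver `a → b ⟺ b = a + 1` on `ℤ/p` (type `A^{(1)}_{p-1}`;
for `p = 2`: `a_{01} = -2`). [cite: HuMathas2010, §3.1] -/
def klrCartan (a b : ZMod p) : ℤ :=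
  if a = b then 2 else -((if b = a + 1 then 1 else 0) + (if a = b + 1 then 1 else 0))

/-- The Cartan matrix is symmetric. [folklore] -/
theorem klrCartan_symm (a b : ZMod p) : klrCartan a b = klrCartan b a := by
  unfold klrCartan
  by_cases h : a = b
  · rw [if_pos h, if_pos h.symm]
  · rw [if_neg h, if_neg (Ne.symm h), add_comm]

/-- **The KLR degrees of the generators**: `deg e(𝐢) = 0`, `deg y_r = 2`,
`deg ψ_r e(𝐢) = -a_{i_r, i_{r+1}}`. [cite: HuMathas2010, §3.1] -/
def klrDeg : KLRGen p n → ℤ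
  | KLRGen.idem _ => 0
  | KLRGen.y _ => 2
  | KLRGen.psi r i => if h : (r : ℕ) + 1 < n then -klrCartan (i r) (i ⟨(r : ℕ) + 1, h⟩) else 0

/-- `deg ψ_r e(𝐢) = -a_{i_r i_{r+1}}`. [folklore] -/
theorem klrDeg_psi {r r' : Fin n} (h : (r' : ℕ) = r + 1) (i : Fin n → ZMod p) :
    klrDeg (KLRGen.psi r i) = -klrCartan (i r) (i r') := by
  have hlt : (r : ℕ) + 1 < n := h ▸ r'.2
  have hr' : r' = ⟨(r : ℕ) + 1, hlt⟩ := Fin.ext h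
  simp only [klrDeg, dif_pos hlt, hr']

/-- The monomial of a word in the generators. [folklore] -/
def klrMonomial : FreeMonoid (KLRGen p n) →* KLRFree k p n := FreeMonoid.lift (FreeAlgebra.ι k)

/-- The degree of a word. [folklore] -/
def klrWordDeg : FreeMonoid (KLRGen p n) →* Multiplicative ℤ :=
  FreeMonoid.lift fun x => Multiplicative.ofAdd (klrDeg x)

/-- **The degree-`e` part `F_e` of the free algebra**: the span of the words of degree `e`.
[folklore] -/
def klrFreeDeg (e : ℤ) : Submodule k (KLRFree k p n) :=
  Submodule.span k ((klrMonomial k) '' {w | klrWordDeg w = Multiplicative.ofAdd e})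

/-- Words of degree `e` lie in `F_e`. [folklore] -/
theorem klrMonomial_mem {w : FreeMonoid (KLRGen p n)} {e : ℤ}
    (hw : klrWordDeg w = Multiplicative.ofAdd e) : klrMonomial k w ∈ klrFreeDeg k e :=
  Submodule.subset_span ⟨w, hw, rfl⟩

/-- A generator lies in `F_{deg}`. [folklore] -/
theorem ι_mem_klrFreeDeg (x : KLRGen p n) : FreeAlgebra.ι k x ∈ klrFreeDeg k (klrDeg x) := by
  have h1 : klrMonomial k (FreeMonoid.of x) = FreeAlgebra.ι k x := FreeMonoid.lift_eval_of _ _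
  have h2 : klrWordDeg (FreeMonoid.of x) = Multiplicative.ofAdd (klrDeg x) := FreeMonoid.lift_eval_of _ _
  rw [← h1]
  exact klrMonomial_mem k h2

/-- `1 ∈ F_0`. [folklore] -/
theorem one_mem_klrFreeDeg : (1 : KLRFree k p n) ∈ klrFreeDeg k 0 := by
  have : klrMonomial k (1 : FreeMonoid (KLRGen p n)) = 1 := map_one _
  rw [← this]
  exact klrMonomial_mem k (map_one _)

/-- **`F_d F_e ⊆ F_{d+e}`.** [folklore] -/
theorem mul_mem_klrFreeDeg {d e : ℤ} {a b : KLRFree k p n} (ha : a ∈ klrFreeDeg k d)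
    (hb : b ∈ klrFreeDeg k e) : a * b ∈ klrFreeDeg k (d + e) := by
  have hle : klrFreeDeg k d * klrFreeDeg k e ≤ klrFreeDeg k (p := p) (n := n) (d + e) := by
    rw [klrFreeDeg, klrFreeDeg, Submodule.span_mul_span]
    refine Submodule.span_le.2 ?_
    rintro _ ⟨_, ⟨w, hw, rfl⟩, _, ⟨w', hw', rfl⟩, rfl⟩
    show klrMonomial k w * klrMonomial k w' ∈ klrFreeDeg k (d + e)
    rw [← map_mul]
    refine klrMonomial_mem k ?_
    rw [map_mul, (hw : klrWordDeg w = Multiplicative.ofAdd d),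
      (hw' : klrWordDeg w' = Multiplicative.ofAdd e), ← ofAdd_add]
  exact hle (Submodule.mul_mem_mul ha hb)

/-- `if`-splitting for membership. [folklore] -/
theorem ite_mem_klrFreeDeg {e : ℤ} {c : Prop} [Decidable c] {a b : KLRFree k p n}
    (ha : a ∈ klrFreeDeg k e) (hb : b ∈ klrFreeDeg k e) : (if c then a else b) ∈ klrFreeDeg k e := by
  split_ifs
  exacts [ha, hb]

/-- `e(𝐢) ∈ F_0`. [folklore] -/
theorem klrE_mem (i : Fin n → ZMod p) : klrE k i ∈ klrFreeDeg k 0 := ι_mem_klrFreeDeg k (KLRGen.idem i)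

/-- `y_r ∈ F_2`. [folklore] -/
theorem klrY_mem (r : Fin n) : klrY k (p := p) r ∈ klrFreeDeg k 2 := ι_mem_klrFreeDeg k (KLRGen.y r)

/-- `ψ_r e(𝐢) ∈ F_{-a}`. [folklore] -/
theorem klrP_mem {r r' : Fin n} (h : (r' : ℕ) = r + 1) (i : Fin n → ZMod p) :
    klrP k r i ∈ klrFreeDeg k (-klrCartan (i r) (i r')) := by
  rw [← klrDeg_psi h]; exact ι_mem_klrFreeDeg k (KLRGen.psi r i)

variable (p n) [Fact p.Prime]

/-- The Laurent-coefficient algebra `R^{Λ₀}_n[t, t⁻¹]`. [folklore] -/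
abbrev KLRLaurent := AddMonoidAlgebra (KLRAlgebra k p n) ℤ

/-- `θ₀ : F → R[t,t⁻¹]`, `g ↦ ḡ t^{deg g}` on generators. [folklore] -/
def klrGradingLift : KLRFree k p n →ₐ[k] KLRLaurent k p n :=
  FreeAlgebra.lift k fun x => AddMonoidAlgebra.single (klrDeg x) (klrMk k p n (FreeAlgebra.ι k x))

variable {p n}

/-- `θ₀` on a generator. [folklore] -/
theorem klrGradingLift_ι (x : KLRGen p n) :
    klrGradingLift k p n (FreeAlgebra.ι k x) =
      AddMonoidAlgebra.single (klrDeg x) (klrMk k p n (FreeAlgebra.ι k x)) :=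
  FreeAlgebra.lift_ι_apply _ _

/-- `θ₀` on a word. [folklore] -/
theorem klrGradingLift_monomial (w : FreeMonoid (KLRGen p n)) :
    klrGradingLift k p n (klrMonomial k w) =
      AddMonoidAlgebra.single (Multiplicative.toAdd (klrWordDeg w)) (klrMk k p n (klrMonomial k w)) := by
  induction w using FreeMonoid.inductionOn' with
  | one =>
    simp only [map_one, toAdd_one]
    rw [AddMonoidAlgebra.one_def]
  | mul_of x w ih =>
    have h1 : klrMonomial k (FreeMonoid.of x) = FreeAlgebra.ι k x := FreeMonoid.lift_eval_of _ _
    have h2 : klrWordDeg (FreeMonoid.of x) = Multiplicative.ofAdd (klrDeg x) :=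
      FreeMonoid.lift_eval_of _ _
    rw [map_mul, map_mul, ih, h1, klrGradingLift_ι, AddMonoidAlgebra.single_mul_single, map_mul, h2,
      toAdd_mul, toAdd_ofAdd, map_mul]

/-- **`θ₀ x = x̄ t^e` for `x ∈ F_e`.** [folklore] -/
theorem klrGradingLift_of_mem {e : ℤ} {x : KLRFree k p n} (hx : x ∈ klrFreeDeg k e) :
    klrGradingLift k p n x = AddMonoidAlgebra.single e (klrMk k p n x) := by
  induction hx using Submodule.span_induction with
  | mem x hx =>
    obtain ⟨w, hw, rfl⟩ := hx
    rw [klrGradingLift_monomial, (hw : klrWordDeg w = Multiplicative.ofAdd e), toAdd_ofAdd]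
  | zero => rw [map_zero, map_zero, AddMonoidAlgebra.single_zero]
  | add x y _ _ hx hy => rw [map_add, hx, hy, map_add, AddMonoidAlgebra.single_add]
  | smul c x _ hx => rw [map_smul, hx, map_smul, AddMonoidAlgebra.smul_single]

end Grading


section GradingRel

variable (k : Type*) [Field k] {p n : ℕ}

/-- Transport of membership along a degree identity. [folklore] -/
theorem mem_klrFreeDeg_of_eq {d e : ℤ} (h : d = e) {x : KLRFree k p n} (hx : x ∈ klrFreeDeg k d) :
    x ∈ klrFreeDeg k e := h ▸ hx

/-- Scalars lie in `F_0`. [folklore] -/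
theorem algebraMap_mem_klrFreeDeg (c : k) : algebraMap k (KLRFree k p n) c ∈ klrFreeDeg k 0 := by
  rw [Algebra.algebraMap_eq_smul_one]
  exact Submodule.smul_mem _ c (one_mem_klrFreeDeg k)

variable [Fact p.Prime]

/-- `Q_{i_r i_{r+1}}(y_r, y_{r+1}) ∈ F_{-2a_{i_r i_{r+1}}}`. [folklore] -/
theorem klrQTerm_mem (r r' : Fin n) (i : Fin n → ZMod p) :
    klrQTerm k r r' i ∈ klrFreeDeg k (-klrCartan (i r) (i r') + -klrCartan (i r) (i r')) := by
  have hY : ∀ a b : Fin n, klrY k (p := p) a - klrY k b ∈ klrFreeDeg k 2 :=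
    fun a b => sub_mem (klrY_mem k a) (klrY_mem k b)
  by_cases h0 : i r = i r'
  · have hq : klrQTerm k r r' i = 0 := by simp only [klrQTerm, if_pos h0]
    rw [hq]; exact Submodule.zero_mem _
  by_cases h1 : i r' = i r + 1
  · by_cases h2 : i r = i r' + 1
    · have hq : klrQTerm k r r' i = (klrY k r' - klrY k r) * (klrY k r - klrY k r') := by
        simp only [klrQTerm, if_neg h0, if_pos h1, if_pos h2]
      have hc : klrCartan (i r) (i r') = -2 := by simp only [klrCartan, if_neg h0, if_pos h1, if_pos h2]; rfl
      rw [hq, hc]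
      exact mem_klrFreeDeg_of_eq k (by norm_num) (mul_mem_klrFreeDeg k (hY r' r) (hY r r'))
    · have hq : klrQTerm k r r' i = klrY k r' - klrY k r := by
        simp only [klrQTerm, if_neg h0, if_pos h1, if_neg h2]
      have hc : klrCartan (i r) (i r') = -1 := by simp only [klrCartan, if_neg h0, if_pos h1, if_neg h2]; rfl
      rw [hq, hc]
      exact mem_klrFreeDeg_of_eq k (by norm_num) (hY r' r)
  · by_cases h2 : i r = i r' + 1
    · have hq : klrQTerm k r r' i = klrY k r - klrY k r' := by
        simp only [klrQTerm, if_neg h0, if_neg h1, if_pos h2]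
      have hc : klrCartan (i r) (i r') = -1 := by simp only [klrCartan, if_neg h0, if_neg h1, if_pos h2]; rfl
      rw [hq, hc]
      exact mem_klrFreeDeg_of_eq k (by norm_num) (hY r r')
    · have hq : klrQTerm k r r' i = 1 := by simp only [klrQTerm, if_neg h0, if_neg h1, if_neg h2]
      have hc : klrCartan (i r) (i r') = 0 := by simp only [klrCartan, if_neg h0, if_neg h1, if_neg h2]; rfl
      rw [hq, hc]
      exact mem_klrFreeDeg_of_eq k (by norm_num) (one_mem_klrFreeDeg k)

omit [Fact p.Prime] in
/-- `2 y ∈ F_2`-type helper: numerals are in `F_0`. [folklore] -/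
theorem ofNat_mem_klrFreeDeg (m : ℕ) [m.AtLeastTwo] :
    (OfNat.ofNat m : KLRFree k p n) ∈ klrFreeDeg k 0 := by
  have : (OfNat.ofNat m : KLRFree k p n) = algebraMap k (KLRFree k p n) (OfNat.ofNat m) := by
    rw [map_ofNat]
  rw [this]; exact algebraMap_mem_klrFreeDeg k _

/-- The braid correction lies in the degree of `ψ_rψ_{r+1}ψ_r e(𝐢)`. [folklore] -/
theorem klrBraidTerm_mem (r r' r'' : Fin n) (i : Fin n → ZMod p) :
    klrBraidTerm k r r' r'' i ∈ klrFreeDeg k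
      (-klrCartan (i r') (i r'') + -klrCartan (i r) (i r'') + -klrCartan (i r) (i r')) := by
  by_cases H : i r = i r'' ∧ i r ≠ i r'
  · obtain ⟨h13, h12⟩ := H
    have e2 : klrCartan (i r) (i r'') = 2 := by rw [klrCartan, if_pos h13]
    have e3 : klrCartan (i r') (i r'') = klrCartan (i r) (i r') := by rw [← h13, klrCartan_symm]
    rw [e2, e3]
    by_cases h1 : i r' = i r + 1
    · by_cases h2 : i r = i r' + 1
      · have hq : klrBraidTerm k r r' r'' i = klrY k r - 2 * klrY k r' + klrY k r'' := by
          simp only [klrBraidTerm, if_pos (And.intro h13 h12), if_pos h1, if_pos h2]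
        have hc : klrCartan (i r) (i r') = -2 := by
          simp only [klrCartan, if_neg h12, if_pos h1, if_pos h2]; rfl
        rw [hq, hc]
        exact mem_klrFreeDeg_of_eq k (by norm_num) (add_mem (sub_mem (klrY_mem k r)
          (mem_klrFreeDeg_of_eq k (zero_add _) (mul_mem_klrFreeDeg k (ofNat_mem_klrFreeDeg k 2)
            (klrY_mem k r')))) (klrY_mem k r''))
      · have hq : klrBraidTerm k r r' r'' i = 1 := by
          simp only [klrBraidTerm, if_pos (And.intro h13 h12), if_pos h1, if_neg h2]
        have hc : klrCartan (i r) (i r') = -1 := by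
          simp only [klrCartan, if_neg h12, if_pos h1, if_neg h2]; rfl
        rw [hq, hc]
        exact mem_klrFreeDeg_of_eq k (by norm_num) (one_mem_klrFreeDeg k)
    · by_cases h2 : i r = i r' + 1
      · have hq : klrBraidTerm k r r' r'' i = -1 := by
          simp only [klrBraidTerm, if_pos (And.intro h13 h12), if_neg h1, if_pos h2]
        have hc : klrCartan (i r) (i r') = -1 := by
          simp only [klrCartan, if_neg h12, if_neg h1, if_pos h2]; rfl
        rw [hq, hc]
        exact mem_klrFreeDeg_of_eq k (by norm_num) (neg_mem (one_mem_klrFreeDeg k))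
      · have hq : klrBraidTerm k r r' r'' i = 0 := by
          simp only [klrBraidTerm, if_pos (And.intro h13 h12), if_neg h1, if_neg h2]
        rw [hq]; exact Submodule.zero_mem _
  · have hq : klrBraidTerm k r r' r'' i = 0 := by simp only [klrBraidTerm, if_neg H]
    rw [hq]; exact Submodule.zero_mem _

/-- **Every defining relation is homogeneous**: both sides lie in a common `F_d`. [folklore] -/
theorem KLRRel.exists_mem_klrFreeDeg {a b : KLRFree k p n} (hab : KLRRel k a b) :
    ∃ d : ℤ, a ∈ klrFreeDeg k d ∧ b ∈ klrFreeDeg k d := by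
  induction hab with
  | idem_mul i j =>
    exact ⟨0, mem_klrFreeDeg_of_eq k (by norm_num) (mul_mem_klrFreeDeg k (klrE_mem k i) (klrE_mem k j)),
      ite_mem_klrFreeDeg k (klrE_mem k i) (Submodule.zero_mem _)⟩
  | idem_sum =>
    exact ⟨0, Submodule.sum_mem _ fun i _ => klrE_mem k i, one_mem_klrFreeDeg k⟩
  | psi_idem r i j =>
    exact ⟨klrDeg (KLRGen.psi r i), mem_klrFreeDeg_of_eq k (add_zero _)
      (mul_mem_klrFreeDeg k (ι_mem_klrFreeDeg k _) (klrE_mem k j)),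
      ite_mem_klrFreeDeg k (ι_mem_klrFreeDeg k _) (Submodule.zero_mem _)⟩
  | idem_psi r r' h i j =>
    exact ⟨klrDeg (KLRGen.psi r i), mem_klrFreeDeg_of_eq k (zero_add _)
      (mul_mem_klrFreeDeg k (klrE_mem k j) (ι_mem_klrFreeDeg k _)),
      ite_mem_klrFreeDeg k (ι_mem_klrFreeDeg k _) (Submodule.zero_mem _)⟩
  | cyc i r hr =>
    by_cases h0 : i r = 0
    · refine ⟨2, ?_, Submodule.zero_mem _⟩
      rw [if_pos h0, pow_one]
      exact mem_klrFreeDeg_of_eq k (add_zero _) (mul_mem_klrFreeDeg k (klrY_mem k r) (klrE_mem k i))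
    · refine ⟨0, ?_, Submodule.zero_mem _⟩
      rw [if_neg h0, pow_zero, one_mul]
      exact klrE_mem k i
  | y_idem r i =>
    exact ⟨2, mem_klrFreeDeg_of_eq k (add_zero _) (mul_mem_klrFreeDeg k (klrY_mem k r) (klrE_mem k i)),
      mem_klrFreeDeg_of_eq k (zero_add _) (mul_mem_klrFreeDeg k (klrE_mem k i) (klrY_mem k r))⟩
  | y_comm r t =>
    exact ⟨2 + 2, mul_mem_klrFreeDeg k (klrY_mem k r) (klrY_mem k t),
      mul_mem_klrFreeDeg k (klrY_mem k t) (klrY_mem k r)⟩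
  | psi_y r r' t h htr htr' i =>
    exact ⟨klrDeg (KLRGen.psi r i) + 2, mul_mem_klrFreeDeg k (ι_mem_klrFreeDeg k _) (klrY_mem k t),
      mem_klrFreeDeg_of_eq k (add_comm _ _) (mul_mem_klrFreeDeg k (klrY_mem k t) (ι_mem_klrFreeDeg k _))⟩
  | psi_comm r r' t t' hr ht h1 h2 h3 h4 i =>
    refine ⟨-klrCartan (i r) (i r') + -klrCartan (i t) (i t'), ?_, ?_⟩
    · have := mul_mem_klrFreeDeg k (klrP_mem k hr (i ∘ swap t t')) (klrP_mem k ht i)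
      simp only [Function.comp_apply, swap_apply_of_ne_of_ne h1.symm h3.symm,
        swap_apply_of_ne_of_ne h2.symm h4.symm] at this
      exact this
    · have := mul_mem_klrFreeDeg k (klrP_mem k ht (i ∘ swap r r')) (klrP_mem k hr i)
      simp only [Function.comp_apply, swap_apply_of_ne_of_ne h1 h2, swap_apply_of_ne_of_ne h3 h4] at this
      exact mem_klrFreeDeg_of_eq k (add_comm _ _) this
  | psi_y_succ r r' h i =>
    refine ⟨-klrCartan (i r) (i r') + 2, mul_mem_klrFreeDeg k (klrP_mem k h i) (klrY_mem k r'),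
      add_mem (mem_klrFreeDeg_of_eq k (add_comm _ _) (mul_mem_klrFreeDeg k (klrY_mem k r) (klrP_mem k h i)))
        ?_⟩
    by_cases h0 : i r = i r'
    · rw [if_pos h0]
      exact mem_klrFreeDeg_of_eq k (by rw [klrCartan, if_pos h0]; norm_num) (klrE_mem k i)
    · rw [if_neg h0]; exact Submodule.zero_mem _
  | y_succ_psi r r' h i =>
    refine ⟨-klrCartan (i r) (i r') + 2,
      mem_klrFreeDeg_of_eq k (add_comm _ _) (mul_mem_klrFreeDeg k (klrY_mem k r') (klrP_mem k h i)),
      add_mem (mul_mem_klrFreeDeg k (klrP_mem k h i) (klrY_mem k r)) ?_⟩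
    by_cases h0 : i r = i r'
    · rw [if_pos h0]
      exact mem_klrFreeDeg_of_eq k (by rw [klrCartan, if_pos h0]; norm_num) (klrE_mem k i)
    · rw [if_neg h0]; exact Submodule.zero_mem _
  | psi_sq r r' h i =>
    refine ⟨-klrCartan (i r) (i r') + -klrCartan (i r) (i r'), ?_,
      mem_klrFreeDeg_of_eq k (add_zero _) (mul_mem_klrFreeDeg k (klrQTerm_mem k r r' i) (klrE_mem k i))⟩
    have := mul_mem_klrFreeDeg k (klrP_mem k h (i ∘ swap r r')) (klrP_mem k h i)
    simp only [Function.comp_apply, swap_apply_left, swap_apply_right] at this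
    rw [klrCartan_symm (i r') (i r)] at this
    exact this
  | braid r r' r'' h h' i =>
    have hrr' : r ≠ r' := by intro e; rw [Fin.ext_iff] at e; omega
    have hr'r'' : r' ≠ r'' := by intro e; rw [Fin.ext_iff] at e; omega
    have hrr'' : r ≠ r'' := by intro e; rw [Fin.ext_iff] at e; omega
    refine ⟨-klrCartan (i r') (i r'') + -klrCartan (i r) (i r'') + -klrCartan (i r) (i r'), ?_,
      add_mem ?_ (mem_klrFreeDeg_of_eq k (add_zero _)
        (mul_mem_klrFreeDeg k (klrBraidTerm_mem k r r' r'' i) (klrE_mem k i)))⟩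
    · have := mul_mem_klrFreeDeg k (mul_mem_klrFreeDeg k
        (klrP_mem k h ((i ∘ swap r r') ∘ swap r' r'')) (klrP_mem k h' (i ∘ swap r r'))) (klrP_mem k h i)
      simp only [Function.comp_apply, swap_apply_left, swap_apply_right,
        swap_apply_of_ne_of_ne hrr' hrr'', swap_apply_of_ne_of_ne hrr''.symm hr'r''.symm] at this
      exact this
    · have := mul_mem_klrFreeDeg k (mul_mem_klrFreeDeg k
        (klrP_mem k h' ((i ∘ swap r' r'') ∘ swap r r')) (klrP_mem k h (i ∘ swap r' r''))) (klrP_mem k h' i)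
      simp only [Function.comp_apply, swap_apply_left, swap_apply_right,
        swap_apply_of_ne_of_ne hrr' hrr'', swap_apply_of_ne_of_ne hrr''.symm hr'r''.symm] at this
      exact mem_klrFreeDeg_of_eq k (by omega) this
  | psi_last r h i => exact ⟨_, ι_mem_klrFreeDeg k _, Submodule.zero_mem _⟩

end GradingRel


section GradedPieces

variable (k : Type*) [Field k] (p n : ℕ) [Fact p.Prime]

variable {p n}

/-- `mk` identifies related elements. [folklore] -/
theorem klrMk_rel {a b : KLRFree k p n} (hab : KLRRel k a b) : klrMk k p n a = klrMk k p n b := by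
  unfold klrMk
  exact RingQuot.mkAlgHom_rel k hab

/-- `θ₀` respects the relations (they are homogeneous). [folklore] -/
theorem klrGradingLift_rel {a b : KLRFree k p n} (hab : KLRRel k a b) :
    klrGradingLift k p n a = klrGradingLift k p n b := by
  obtain ⟨d, ha, hb⟩ := hab.exists_mem_klrFreeDeg
  rw [klrGradingLift_of_mem k ha, klrGradingLift_of_mem k hb, klrMk_rel k hab]

variable (p n)

/-- **The grading homomorphism `θ : R^{Λ₀}_n → R^{Λ₀}_n[t, t⁻¹]`**, `x ↦ ∑_e x_e t^e`. [folklore] -/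
def klrGrading : KLRAlgebra k p n →ₐ[k] KLRLaurent k p n :=
  RingQuot.liftAlgHom k ⟨klrGradingLift k p n, fun _ _ h => klrGradingLift_rel k h⟩

/-- **The degree-`e` part `R_e` of `R^{Λ₀}_n`**: the image of `F_e`. [cite: HuMathas2010, §3.1] -/
def klrDegPart (e : ℤ) : Submodule k (KLRAlgebra k p n) :=
  (klrFreeDeg k e).map (klrMk k p n).toLinearMap

variable {p n}

/-- `θ ∘ mk = θ₀`. [folklore] -/
theorem klrGrading_mk (a : KLRFree k p n) : klrGrading k p n (klrMk k p n a) = klrGradingLift k p n a := by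
  rw [klrGrading, klrMk]
  exact RingQuot.liftAlgHom_mkAlgHom_apply _ _ _ _

/-- **`θ x = x t^e` for `x ∈ R_e`.** [folklore] -/
theorem klrGrading_of_mem {e : ℤ} {x : KLRAlgebra k p n} (hx : x ∈ klrDegPart k p n e) :
    klrGrading k p n x = AddMonoidAlgebra.single e x := by
  obtain ⟨a, ha, rfl⟩ := Submodule.mem_map.1 hx
  rw [AlgHom.toLinearMap_apply, klrGrading_mk, klrGradingLift_of_mem k ha]

/-- `mk(F_e) = R_e`. [folklore] -/
theorem klrMk_mem_klrDegPart {e : ℤ} {a : KLRFree k p n} (ha : a ∈ klrFreeDeg k e) :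
    klrMk k p n a ∈ klrDegPart k p n e :=
  Submodule.mem_map_of_mem ha

/-- **`R_d R_e ⊆ R_{d+e}`.** [cite: HuMathas2010, §3.1] -/
theorem mul_mem_klrDegPart {d e : ℤ} {x y : KLRAlgebra k p n} (hx : x ∈ klrDegPart k p n d)
    (hy : y ∈ klrDegPart k p n e) : x * y ∈ klrDegPart k p n (d + e) := by
  obtain ⟨a, ha, rfl⟩ := Submodule.mem_map.1 hx
  obtain ⟨b, hb, rfl⟩ := Submodule.mem_map.1 hy
  rw [AlgHom.toLinearMap_apply, AlgHom.toLinearMap_apply, ← map_mul]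
  exact klrMk_mem_klrDegPart k (mul_mem_klrFreeDeg k ha hb)

/-- `1 ∈ R_0`. [folklore] -/
theorem one_mem_klrDegPart : (1 : KLRAlgebra k p n) ∈ klrDegPart k p n 0 := by
  rw [← map_one (klrMk k p n)]; exact klrMk_mem_klrDegPart k (one_mem_klrFreeDeg k)

omit [Fact p.Prime] in
/-- Every element of the free algebra is a sum of homogeneous elements. [folklore] -/
theorem mem_iSup_klrFreeDeg (a : KLRFree k p n) : a ∈ ⨆ e : ℤ, klrFreeDeg k (p := p) (n := n) e := by
  have hS : (⨆ e : ℤ, klrFreeDeg k (p := p) (n := n) e) =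
      Submodule.span k (Set.range (klrMonomial k (p := p) (n := n))) := by
    apply le_antisymm
    · refine iSup_le fun e => Submodule.span_mono ?_
      rintro _ ⟨w, _, rfl⟩
      exact ⟨w, rfl⟩
    · refine Submodule.span_le.2 ?_
      rintro _ ⟨w, rfl⟩
      exact Submodule.mem_iSup_of_mem (Multiplicative.toAdd (klrWordDeg w))
        (klrMonomial_mem k (by simp))
  rw [hS]
  induction a using FreeAlgebra.induction with
  | grade0 c =>
    rw [Algebra.algebraMap_eq_smul_one]
    refine Submodule.smul_mem _ c (Submodule.subset_span ⟨1, map_one _⟩)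
  | grade1 x => exact Submodule.subset_span ⟨FreeMonoid.of x, FreeMonoid.lift_eval_of _ _⟩
  | mul a b ha hb =>
    have hmul : Submodule.span k (Set.range (klrMonomial k (p := p) (n := n))) *
        Submodule.span k (Set.range (klrMonomial k (p := p) (n := n))) ≤
        Submodule.span k (Set.range (klrMonomial k (p := p) (n := n))) := by
      rw [Submodule.span_mul_span]
      refine Submodule.span_mono ?_
      rintro _ ⟨_, ⟨w, rfl⟩, _, ⟨w', rfl⟩, rfl⟩
      exact ⟨w * w', map_mul _ _ _⟩
    exact hmul (Submodule.mul_mem_mul ha hb)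
  | add a b ha hb => exact add_mem ha hb

/-- **`R^{Λ₀}_n = ∑_e R_e`.** [cite: HuMathas2010, §3.1] -/
theorem iSup_klrDegPart_eq_top : (⨆ e : ℤ, klrDegPart k p n e) = ⊤ := by
  rw [eq_top_iff]
  rintro x -
  obtain ⟨a, rfl⟩ := RingQuot.mkAlgHom_surjective k (KLRRel k (p := p) (n := n)) x
  have ha := mem_iSup_klrFreeDeg k a
  simp only [klrDegPart, ← Submodule.map_iSup]
  exact Submodule.mem_map_of_mem ha

/-- The `t^e`-coefficient of `θ x` vanishes at `e` for `x ∈ ∑_{e' ≠ e} R_{e'}`. [folklore] -/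
theorem klrGrading_coeff_eq_zero_of_mem {e : ℤ} {x : KLRAlgebra k p n}
    (hx : x ∈ ⨆ e' : {e' : ℤ // e' ≠ e}, klrDegPart k p n e') : (klrGrading k p n x).coeff e = 0 := by
  induction hx using Submodule.iSup_induction' with
  | mem e' x hx =>
    rw [klrGrading_of_mem k hx, AddMonoidAlgebra.coeff_single, Finsupp.single_eq_of_ne e'.2.symm]
  | zero => rw [map_zero, AddMonoidAlgebra.coeff_zero, Finsupp.zero_apply]
  | add x y _ _ hx hy => rw [map_add, AddMonoidAlgebra.coeff_add, Finsupp.add_apply, hx, hy, add_zero]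

/-- **The homogeneous components are independent: `R^{Λ₀}_n = ⨁_e R_e` is a `ℤ`-graded algebra**
(Brundan–Kleshchev, the grading on `R^Λ_α`; Hu–Mathas §3.1). [cite: HuMathas2010, §3.1] -/
theorem iSupIndep_klrDegPart : iSupIndep (klrDegPart k p n) := by
  intro e
  rw [disjoint_iff, eq_bot_iff]
  rintro x ⟨hx1, hx2⟩
  have h1 := klrGrading_of_mem k (SetLike.mem_coe.1 hx1)
  have h2 : (klrGrading k p n x).coeff e = 0 := by
    refine klrGrading_coeff_eq_zero_of_mem k ?_
    have : (⨆ (j : ℤ) (_ : j ≠ e), klrDegPart k p n j) = ⨆ e' : {e' : ℤ // e' ≠ e}, klrDegPart k p n e' := by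
      rw [iSup_subtype']
    rw [← this]
    exact hx2
  rw [h1, AddMonoidAlgebra.coeff_single, Finsupp.single_eq_same] at h2
  rw [Submodule.mem_bot, h2]

/-- Finite-sum form of independence: homogeneous components of `0` vanish. [folklore] -/
theorem eq_zero_of_sum_eq_zero_klrDegPart (s : Finset ℤ) (x : ℤ → KLRAlgebra k p n)
    (hx : ∀ e ∈ s, x e ∈ klrDegPart k p n e) (h0 : ∑ e ∈ s, x e = 0) : ∀ e ∈ s, x e = 0 := by
  intro e he
  have h := congrArg (fun z => (klrGrading k p n z).coeff e) h0
  simp only [map_sum, AddMonoidAlgebra.coeff_sum, Finset.sum_apply', map_zero,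
    AddMonoidAlgebra.coeff_zero, Finsupp.zero_apply] at h
  rw [Finset.sum_eq_single_of_mem e he] at h
  · rwa [klrGrading_of_mem k (hx e he), AddMonoidAlgebra.coeff_single, Finsupp.single_eq_same] at h
  · intro e' he' hne
    rw [klrGrading_of_mem k (hx e' he'), AddMonoidAlgebra.coeff_single, Finsupp.single_eq_of_ne hne.symm]

end GradedPieces


/-! ### Calculus in `R^{Λ₀}_n`: the relations as identities -/

section Calculus

variable (k : Type*) [Field k] (p n : ℕ) [Fact p.Prime]

variable {p n}

/-- `ē(𝐢) ∈ R^{Λ₀}_n`. [folklore] -/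
abbrev klrIdemR (i : Fin n → ZMod p) : KLRAlgebra k p n := klrMk k p n (klrE k i)

/-- `ȳ_r ∈ R^{Λ₀}_n`. [folklore] -/
abbrev klrYR (r : Fin n) : KLRAlgebra k p n := klrMk k p n (klrY k r)

/-- `ψ_r e(𝐢) ∈ R^{Λ₀}_n`. [folklore] -/
abbrev klrPsiR (r : Fin n) (i : Fin n → ZMod p) : KLRAlgebra k p n := klrMk k p n (klrP k r i)

/-- `ē(𝐢)ē(𝐣) = δ ē(𝐢)`. [folklore] -/
theorem klrIdemR_mul_klrIdemR (i j : Fin n → ZMod p) :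
    klrIdemR k i * klrIdemR k j = if i = j then klrIdemR k i else 0 := by
  have := klrMk_rel k (KLRRel.idem_mul (k := k) i j)
  rw [map_mul, apply_ite (klrMk k p n), map_zero] at this
  exact this

/-- `ē(𝐢)² = ē(𝐢)`. [folklore] -/
theorem klrIdemR_mul_self (i : Fin n → ZMod p) : klrIdemR k i * klrIdemR k i = klrIdemR k i := by
  rw [klrIdemR_mul_klrIdemR, if_pos rfl]

/-- `∑ ē(𝐢) = 1`. [folklore] -/
theorem sum_klrIdemR : ∑ i : Fin n → ZMod p, klrIdemR k i = (1 : KLRAlgebra k p n) := by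
  have := klrMk_rel k (KLRRel.idem_sum (k := k) (p := p) (n := n))
  rw [map_sum, map_one] at this
  exact this

/-- `P_r(𝐢) ē(𝐣) = δ P_r(𝐢)`. [folklore] -/
theorem klrPsiR_mul_klrIdemR (r : Fin n) (i j : Fin n → ZMod p) :
    klrPsiR k r i * klrIdemR k j = if i = j then klrPsiR k r i else 0 := by
  have := klrMk_rel k (KLRRel.psi_idem (k := k) r i j)
  rw [map_mul, apply_ite (klrMk k p n), map_zero] at this
  exact this

/-- `ē(𝐣) P_r(𝐢) = δ_{𝐣, s_r𝐢} P_r(𝐢)`. [folklore] -/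
theorem klrIdemR_mul_klrPsiR {r r' : Fin n} (h : (r' : ℕ) = r + 1) (i j : Fin n → ZMod p) :
    klrIdemR k j * klrPsiR k r i = if j = i ∘ swap r r' then klrPsiR k r i else 0 := by
  have := klrMk_rel k (KLRRel.idem_psi (k := k) r r' h i j)
  rw [map_mul, apply_ite (klrMk k p n), map_zero] at this
  exact this

/-- The cyclotomic relation: `ȳ_0 ē(𝐢) = 0` if `i_0 = 0`. [folklore] -/
theorem klrYR_mul_klrIdemR_eq_zero {r : Fin n} (hr : (r : ℕ) = 0) {i : Fin n → ZMod p}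
    (h0 : i r = 0) : klrYR k r * klrIdemR k i = 0 := by
  have := klrMk_rel k (KLRRel.cyc (k := k) i r hr)
  rw [if_pos h0, pow_one, map_mul, map_zero] at this
  exact this

/-- The cyclotomic relation: `ē(𝐢) = 0` if `i_0 ≠ 0`. [folklore] -/
theorem klrIdemR_eq_zero {r : Fin n} (hr : (r : ℕ) = 0) {i : Fin n → ZMod p} (h0 : i r ≠ 0) :
    klrIdemR k i = 0 := by
  have := klrMk_rel k (KLRRel.cyc (k := k) i r hr)
  rw [if_neg h0, pow_zero, one_mul, map_zero] at this
  exact this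

/-- `ȳ_r ē(𝐢) = ē(𝐢) ȳ_r`. [folklore] -/
theorem commute_klrYR_klrIdemR (r : Fin n) (i : Fin n → ZMod p) : Commute (klrYR k r) (klrIdemR k (p := p) i) := by
  have := klrMk_rel k (KLRRel.y_idem (k := k) r i)
  rw [map_mul, map_mul] at this
  exact this

/-- `ȳ_r ȳ_s = ȳ_s ȳ_r`. [folklore] -/
theorem commute_klrYR (r s : Fin n) : Commute (klrYR k (p := p) r) (klrYR k s) := by
  have := klrMk_rel k (KLRRel.y_comm (k := k) (p := p) r s)
  rw [map_mul, map_mul] at this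
  exact this

/-- `P_r(𝐢) ȳ_t = ȳ_t P_r(𝐢)` (`t ≠ r, r+1`). [folklore] -/
theorem klrPsiR_mul_klrYR_of_ne {r r' t : Fin n} (h : (r' : ℕ) = r + 1) (htr : t ≠ r) (htr' : t ≠ r')
    (i : Fin n → ZMod p) : klrPsiR k r i * klrYR k t = klrYR k t * klrPsiR k r i := by
  have := klrMk_rel k (KLRRel.psi_y (k := k) r r' t h htr htr' i)
  rw [map_mul, map_mul] at this
  exact this

/-- Far commutation `P_r(s_t𝐢)P_t(𝐢) = P_t(s_r𝐢)P_r(𝐢)`. [folklore] -/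
theorem klrPsiR_comm_of_far {r r' t t' : Fin n} (hr : (r' : ℕ) = r + 1) (ht : (t' : ℕ) = t + 1)
    (h1 : t ≠ r) (h2 : t ≠ r') (h3 : t' ≠ r) (h4 : t' ≠ r') (i : Fin n → ZMod p) :
    klrPsiR k r (i ∘ swap t t') * klrPsiR k t i = klrPsiR k t (i ∘ swap r r') * klrPsiR k r i := by
  have := klrMk_rel k (KLRRel.psi_comm (k := k) r r' t t' hr ht h1 h2 h3 h4 i)
  rw [map_mul, map_mul] at this
  exact this

/-- `P_r(𝐢) ȳ_{r+1} = ȳ_r P_r(𝐢) + δ ē(𝐢)`. [folklore] -/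
theorem klrPsiR_mul_klrYR_succ {r r' : Fin n} (h : (r' : ℕ) = r + 1) (i : Fin n → ZMod p) :
    klrPsiR k r i * klrYR k r' = klrYR k r * klrPsiR k r i + if i r = i r' then klrIdemR k i else 0 := by
  have := klrMk_rel k (KLRRel.psi_y_succ (k := k) r r' h i)
  rw [map_mul, map_add, map_mul, apply_ite (klrMk k p n), map_zero] at this
  exact this

/-- `ȳ_{r+1} P_r(𝐢) = P_r(𝐢) ȳ_r + δ ē(𝐢)`. [folklore] -/
theorem klrYR_succ_mul_klrPsiR {r r' : Fin n} (h : (r' : ℕ) = r + 1) (i : Fin n → ZMod p) :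
    klrYR k r' * klrPsiR k r i = klrPsiR k r i * klrYR k r + if i r = i r' then klrIdemR k i else 0 := by
  have := klrMk_rel k (KLRRel.y_succ_psi (k := k) r r' h i)
  rw [map_mul, map_add, map_mul, apply_ite (klrMk k p n), map_zero] at this
  exact this

/-- (R4) `P_r(s_r𝐢)P_r(𝐢) = Q(𝐢)ē(𝐢)` with `Q` spelled out in `ȳ`'s. [folklore] -/
theorem klrPsiR_sq {r r' : Fin n} (h : (r' : ℕ) = r + 1) (i : Fin n → ZMod p) :
    klrPsiR k r (i ∘ swap r r') * klrPsiR k r i =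
      (if i r = i r' then 0
        else if i r' = i r + 1 then
          (if i r = i r' + 1 then (klrYR k r' - klrYR k r) * (klrYR k r - klrYR k r')
            else klrYR k r' - klrYR k r)
        else (if i r = i r' + 1 then klrYR k r - klrYR k r' else 1)) * klrIdemR k i := by
  have := klrMk_rel k (KLRRel.psi_sq (k := k) r r' h i)
  rw [map_mul, map_mul, klrQTerm] at this
  simp only [apply_ite (klrMk k p n), map_zero, map_one, map_mul, map_sub] at this
  exact this

/-- (R7) the braid relation with correction, in `R^{Λ₀}_n`. [folklore] -/
theorem klrPsiR_braid {r r' r'' : Fin n} (h : (r' : ℕ) = r + 1) (h' : (r'' : ℕ) = r' + 1)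
    (i : Fin n → ZMod p) :
    klrPsiR k r ((i ∘ swap r r') ∘ swap r' r'') * klrPsiR k r' (i ∘ swap r r') * klrPsiR k r i =
      klrPsiR k r' ((i ∘ swap r' r'') ∘ swap r r') * klrPsiR k r (i ∘ swap r' r'') * klrPsiR k r' i +
        (if i r = i r'' ∧ i r ≠ i r' then
            (if i r' = i r + 1 then
                (if i r = i r' + 1 then klrYR k r - 2 * klrYR k r' + klrYR k r'' else 1)
              else (if i r = i r' + 1 then -1 else 0))
          else 0) * klrIdemR k i := by
  have := klrMk_rel k (KLRRel.braid (k := k) r r' r'' h h' i)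
  rw [map_mul, map_mul, map_add, map_mul, map_mul, map_mul, klrBraidTerm] at this
  simp only [apply_ite (klrMk k p n), map_zero, map_one, map_mul, map_sub, map_add, map_neg,
    map_ofNat] at this
  exact this

/-- `P_{n-1}(𝐢) = 0`. [folklore] -/
theorem klrPsiR_last {r : Fin n} (h : n ≤ (r : ℕ) + 1) (i : Fin n → ZMod p) : klrPsiR k r i = 0 := by
  have := klrMk_rel k (KLRRel.psi_last (k := k) r h i)
  rw [map_zero] at this
  exact this

/-- `P_r(𝐢) = P_r(𝐢) ē(𝐢)`. [folklore] -/
theorem klrPsiR_mul_klrIdemR_self (r : Fin n) (i : Fin n → ZMod p) :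
    klrPsiR k r i * klrIdemR k i = klrPsiR k r i := by
  rw [klrPsiR_mul_klrIdemR, if_pos rfl]

/-- `ē(s_r𝐢) P_r(𝐢) = P_r(𝐢)`. [folklore] -/
theorem klrIdemR_swap_mul_klrPsiR {r r' : Fin n} (h : (r' : ℕ) = r + 1) (i : Fin n → ZMod p) :
    klrIdemR k (i ∘ swap r r') * klrPsiR k r i = klrPsiR k r i := by
  rw [klrIdemR_mul_klrPsiR k h, if_pos rfl]

end Calculus


/-! ### Brundan–Kleshchev Lemma 2.1: the `y_r` are nilpotent in `R^{Λ₀}_n` -/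

section Nilpotent

variable (k : Type*) [Field k] (p n : ℕ) [Fact p.Prime]

variable {p n}

/-- **`ȳ_0 = 0` in `R^{Λ₀}_n`** (level one). [folklore] -/
theorem klrYR_eq_zero_of_val_eq_zero {r : Fin n} (hr : (r : ℕ) = 0) : klrYR k (p := p) r = 0 := by
  rw [← mul_one (klrYR k r), ← sum_klrIdemR k, Finset.mul_sum]
  refine Finset.sum_eq_zero fun i _ => ?_
  by_cases h0 : i r = 0
  · exact klrYR_mul_klrIdemR_eq_zero k hr h0
  · rw [klrIdemR_eq_zero k hr h0, mul_zero]

omit [Fact p.Prime] in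
/-- `s_r𝐢 = 𝐢` when `i_r = i_{r+1}`. [folklore] -/
theorem comp_swap_eq_self_of_eq {r r' : Fin n} {i : Fin n → ZMod p} (hc : i r = i r') :
    i ∘ swap r r' = i := by
  funext x
  simp only [Function.comp_apply]
  rcases eq_or_ne x r with rfl | hxr
  · rw [swap_apply_left, hc]
  rcases eq_or_ne x r' with rfl | hxr'
  · rw [swap_apply_right, hc]
  rw [swap_apply_of_ne_of_ne hxr hxr']

/-- `(ȳ_r ē)^m = ȳ_r^m ē` for `m ≥ 1`. [folklore] -/
theorem klrYR_mul_klrIdemR_pow (r : Fin n) (i : Fin n → ZMod p) (m : ℕ) :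
    (klrYR k r * klrIdemR k i) ^ (m + 1) = klrYR k r ^ (m + 1) * klrIdemR k i := by
  induction m with
  | zero => rw [pow_one, pow_one]
  | succ m ih =>
    rw [pow_succ, ih, mul_assoc, ← mul_assoc (klrIdemR k i), ← (commute_klrYR_klrIdemR k r i).eq,
      mul_assoc, klrIdemR_mul_self, ← mul_assoc, ← pow_succ]

/-- Nilpotency of `ȳ_r ē(𝐢)` from that of `ȳ_r`. [folklore] -/
theorem isNilpotent_klrYR_mul_klrIdemR {r : Fin n} (hN : IsNilpotent (klrYR k (p := p) r))
    (i : Fin n → ZMod p) : IsNilpotent (klrYR k r * klrIdemR k i) :=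
  (commute_klrYR_klrIdemR k r i).isNilpotent_mul_right hN

/-- **BK Lemma 2.1, induction step, case `i_r = i_{r+1}`**: with `τ = ψ_r(y_r - y_{r+1}) + 1` one has
`τ² e(𝐢) = e(𝐢)` and `τ y_r τ e(𝐢) = y_{r+1} e(𝐢)`, so `y_{r+1} e(𝐢)` is nilpotent if `y_r` is.
[folklore] -/
theorem isNilpotent_klrYR_succ_mul_of_eq {r r' : Fin n} (h : (r' : ℕ) = r + 1) {i : Fin n → ZMod p}
    (hc : i r = i r') (hN : IsNilpotent (klrYR k (p := p) r)) :
    IsNilpotent (klrYR k r' * klrIdemR k i) := by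
  -- the players
  set e := klrIdemR k (p := p) i with he_def
  set P := klrPsiR k r i with hP_def
  set a := klrYR k r * e with ha_def
  set b := klrYR k r' * e with hb_def
  have hsw : i ∘ swap r r' = i := comp_swap_eq_self_of_eq hc
  -- basic relations
  have hee : e * e = e := klrIdemR_mul_self k i
  have hPe : P * e = P := klrPsiR_mul_klrIdemR_self k r i
  have heP : e * P = P := by have := klrIdemR_swap_mul_klrPsiR k h i; rwa [hsw] at this
  have hPP : P * P = 0 := by
    have := klrPsiR_sq k h i; rwa [hsw, if_pos hc, zero_mul] at this
  have cye : klrYR k r * e = e * klrYR k r := (commute_klrYR_klrIdemR k r i).eq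
  have cy'e : klrYR k r' * e = e * klrYR k r' := (commute_klrYR_klrIdemR k r' i).eq
  have hPb : P * b = a * P + e := by
    rw [hb_def, ← mul_assoc, klrPsiR_mul_klrYR_succ k h, if_pos hc, add_mul, hee, mul_assoc, hPe, ha_def,
      mul_assoc (klrYR k r) e P, heP]
  have hbP : b * P = P * a + e := by
    rw [hb_def, mul_assoc, heP, klrYR_succ_mul_klrPsiR k h, if_pos hc, ha_def, cye, ← mul_assoc, hPe]
  have hea : e * a = a := by rw [ha_def, cye, ← mul_assoc, hee]
  have hae : a * e = a := by rw [ha_def, mul_assoc, hee]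
  have heb : e * b = b := by rw [hb_def, cy'e, ← mul_assoc, hee]
  have hbe : b * e = b := by rw [hb_def, mul_assoc, hee]
  have hab : b * a = a * b := by
    have e1 : b * a = klrYR k r * klrYR k r' * e := by
      rw [hb_def, ha_def, mul_assoc, ← mul_assoc e (klrYR k r) e, ← cye, mul_assoc (klrYR k r) e e, hee,
        ← mul_assoc, (commute_klrYR k r' r).eq]
    have e2 : a * b = klrYR k r * klrYR k r' * e := by
      rw [hb_def, ha_def, mul_assoc, ← mul_assoc e (klrYR k r') e, ← cy'e, mul_assoc (klrYR k r') e e,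
        hee, ← mul_assoc]
    rw [e1, e2]
  have haP : a * P = P * b - e := by rw [hPb]; abel
  have hPa : P * a = b * P - e := by rw [hbP]; abel
  -- continuation forms of the rewrite rules (right-associated words)
  have hee' : ∀ w, e * (e * w) = e * w := fun w => by rw [← mul_assoc, hee]
  have hea' : ∀ w, e * (a * w) = a * w := fun w => by rw [← mul_assoc, hea]
  have hae' : ∀ w, a * (e * w) = a * w := fun w => by rw [← mul_assoc, hae]
  have heb' : ∀ w, e * (b * w) = b * w := fun w => by rw [← mul_assoc, heb]
  have hbe' : ∀ w, b * (e * w) = b * w := fun w => by rw [← mul_assoc, hbe]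
  have heP' : ∀ w, e * (P * w) = P * w := fun w => by rw [← mul_assoc, heP]
  have hPe' : ∀ w, P * (e * w) = P * w := fun w => by rw [← mul_assoc, hPe]
  have hPP' : ∀ w, P * (P * w) = 0 := fun w => by rw [← mul_assoc, hPP, zero_mul]
  have haP' : ∀ w, a * (P * w) = P * (b * w) - e * w := fun w => by
    rw [← mul_assoc, haP, sub_mul, mul_assoc]
  have hbP' : ∀ w, b * (P * w) = P * (a * w) + e * w := fun w => by
    rw [← mul_assoc, hbP, add_mul, mul_assoc]
  have hab' : ∀ w, b * (a * w) = a * (b * w) := fun w => by rw [← mul_assoc, hab, mul_assoc]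
  -- `τ`
  set τ := P * (a - b) + e with hτ
  have hτe : τ * e = τ := by
    rw [hτ, add_mul, hee, mul_assoc, sub_mul, hae, hbe]
  have hττ : τ * τ = e := by
    rw [hτ]
    simp only [mul_add, add_mul, mul_sub, sub_mul, mul_assoc, hee, hea, hae, heb, hbe, heP', hPP', haP',
      hbP']
    abel
  have hτaτ : τ * a * τ = b := by
    rw [hτ]
    simp only [mul_add, add_mul, mul_sub, sub_mul, mul_assoc, hea, hae, heb, heb', hPP', haP', hbP']
    try rw [hab]
    try abel
  -- `b^{m+1} = τ a^{m+1} τ`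
  have hpow : ∀ m : ℕ, b ^ (m + 1) = τ * a ^ (m + 1) * τ := by
    intro m
    induction m with
    | zero => rw [pow_one, pow_one, hτaτ]
    | succ m ih =>
      rw [pow_succ, ih, ← hτaτ, show τ * a ^ (m + 1) * τ * (τ * a * τ) =
        τ * a ^ (m + 1) * (τ * τ) * a * τ by simp only [mul_assoc], hττ, mul_assoc _ e a, hea,
        mul_assoc _ (a ^ (m + 1)) a, ← pow_succ]
  obtain ⟨N, hN⟩ := hN
  refine ⟨N + 1, ?_⟩
  rw [hpow, ha_def, klrYR_mul_klrIdemR_pow, pow_succ, hN, zero_mul, zero_mul, mul_zero, zero_mul]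

/-- **BK Lemma 2.1, induction step, case `i_r ≠ i_{r+1}`**: with `X = ψ_r y_r ψ_r e(𝐢)`
(`= Q_{i_ri_{r+1}}(y_r,y_{r+1}) y_{r+1} e(𝐢)` by (R4)), `X` is nilpotent if `y_r` is, commutes with
`y_r e(𝐢)`, `y_{r+1} e(𝐢)`, and `y_{r+1}^{k+1} e(𝐢) = y_r f e(𝐢) ± X`; hence `y_{r+1} e(𝐢)` is nilpotent.
[folklore] -/
theorem isNilpotent_klrYR_succ_mul_of_ne {r r' : Fin n} (h : (r' : ℕ) = r + 1) {i : Fin n → ZMod p}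
    (hc : i r ≠ i r') (hN : IsNilpotent (klrYR k (p := p) r)) :
    IsNilpotent (klrYR k r' * klrIdemR k i) := by
  have hrr' : r ≠ r' := by intro e; rw [Fin.ext_iff] at e; omega
  -- the players
  set e := klrIdemR k (p := p) i with he_def
  set e' := klrIdemR k (p := p) (i ∘ swap r r') with he'_def
  set P := klrPsiR k r i with hP_def
  set P' := klrPsiR k r (i ∘ swap r r') with hP'_def
  set Y := klrYR k (p := p) (n := n) r with hY_def
  set Y' := klrYR k (p := p) (n := n) r' with hY'_def
  have hi'r : (i ∘ swap r r') r = i r' := by simp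
  have hi'r' : (i ∘ swap r r') r' = i r := by simp
  have hc' : (i ∘ swap r r') r ≠ (i ∘ swap r r') r' := by rw [hi'r, hi'r']; exact Ne.symm hc
  have hsw : (i ∘ swap r r') ∘ swap r r' = i := by
    funext x; simp only [Function.comp_apply, swap_apply_self]
  -- basic relations
  have hee : e * e = e := klrIdemR_mul_self k i
  have hPe : P * e = P := klrPsiR_mul_klrIdemR_self k r i
  have he'P : e' * P = P := klrIdemR_swap_mul_klrPsiR k h i
  have heP' : e * P' = P' := by
    have := klrIdemR_swap_mul_klrPsiR k h (i ∘ swap r r'); rwa [hsw] at this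
  have cYe : Y * e = e * Y := (commute_klrYR_klrIdemR k r i).eq
  have cY'e : Y' * e = e * Y' := (commute_klrYR_klrIdemR k r' i).eq
  have cYe' : Y * e' = e' * Y := (commute_klrYR_klrIdemR k r _).eq
  have cYY' : Y * Y' = Y' * Y := (commute_klrYR k r r').eq
  have hPY' : P * Y' = Y * P := by
    have := klrPsiR_mul_klrYR_succ k h i; rwa [if_neg hc, add_zero] at this
  have hY'P : Y' * P = P * Y := by
    have := klrYR_succ_mul_klrPsiR k h i; rwa [if_neg hc, add_zero] at this
  have hP'Y' : P' * Y' = Y * P' := by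
    have := klrPsiR_mul_klrYR_succ k h (i ∘ swap r r'); rwa [if_neg hc', add_zero] at this
  have hY'P' : Y' * P' = P' * Y := by
    have := klrYR_succ_mul_klrPsiR k h (i ∘ swap r r'); rwa [if_neg hc', add_zero] at this
  -- (R4) at `s_r𝐢`: `P P' = q' e'` with `q'` a polynomial in `Y, Y'` commuting with `Y`
  obtain ⟨q', hq'Y, hPP'⟩ : ∃ q' : KLRAlgebra k p n, Commute q' Y ∧ P * P' = q' * e' := by
    have hsq := klrPsiR_sq k h (i ∘ swap r r')
    rw [hsw] at hsq
    refine ⟨_, ?_, hsq⟩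
    have c1 : Commute (Y' - Y) Y := (commute_klrYR k r' r).sub_left (Commute.refl Y)
    have c2 : Commute (Y - Y') Y := (Commute.refl Y).sub_left (commute_klrYR k r' r)
    split_ifs
    · exact Commute.zero_left Y
    · exact c1.mul_left c2
    · exact c1
    · exact c2
    · exact Commute.one_left Y
  -- `X := P' Y P`
  set X := P' * Y * P with hX_def
  have hXpow : ∀ m : ℕ, X ^ (m + 1) = P' * (Y ^ (m + 1) * q' ^ m) * P := by
    intro m
    induction m with
    | zero => rw [pow_one, pow_one, pow_zero, mul_one]
    | succ m ih =>
      rw [pow_succ, ih, hX_def]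
      -- `P' (Y^{m+1} q'^m) P · P' Y P = P' Y^{m+1} q'^m (q' e') Y P = P' Y^{m+2} q'^{m+1} P`
      have step : P * (P' * Y * P) = q' * (Y * P) := by
        rw [← mul_assoc, ← mul_assoc, hPP', mul_assoc q' e' Y, ← cYe', mul_assoc, mul_assoc, he'P]
      rw [mul_assoc (P' * (Y ^ (m + 1) * q' ^ m)) P, step, mul_assoc P', ← mul_assoc (Y ^ (m + 1) * q' ^ m),
        mul_assoc (Y ^ (m + 1)), ← pow_succ, ← mul_assoc (Y ^ (m + 1) * q' ^ (m + 1)),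
        mul_assoc (Y ^ (m + 1)), (hq'Y.pow_left (m + 1)).eq, ← mul_assoc (Y ^ (m + 1)), ← pow_succ,
        ← mul_assoc P']
  have hXnil : IsNilpotent X := by
    obtain ⟨N, hN'⟩ := hN
    refine ⟨N + 1, ?_⟩
    rw [hXpow, pow_succ, hN', zero_mul, zero_mul, mul_zero, zero_mul]
  -- `a = Y e`, `b = Y' e`
  set a := Y * e with ha_def
  set b := Y' * e with hb_def
  have hee' : ∀ w, e * (e * w) = e * w := fun w => by rw [← mul_assoc, hee]
  have hXa : Commute X a := by
    have e1 : X * a = P' * Y * Y' * P := by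
      rw [hX_def, ha_def]
      calc P' * Y * P * (Y * e) = P' * Y * (P * Y) * e := by simp only [mul_assoc]
        _ = P' * Y * (Y' * P) * e := by rw [← hY'P]
        _ = P' * Y * Y' * (P * e) := by simp only [mul_assoc]
        _ = P' * Y * Y' * P := by rw [hPe]
    have e2 : a * X = P' * Y * Y' * P := by
      rw [hX_def, ha_def]
      calc Y * e * (P' * Y * P) = Y * (e * P') * Y * P := by simp only [mul_assoc]
        _ = Y * P' * Y * P := by rw [heP']
        _ = P' * Y' * Y * P := by rw [← hP'Y']
        _ = P' * (Y' * Y) * P := by simp only [mul_assoc]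
        _ = P' * (Y * Y') * P := by rw [← cYY']
        _ = P' * Y * Y' * P := by simp only [mul_assoc]
    exact e1.trans e2.symm
  have hXb : Commute X b := by
    have e1 : X * b = P' * Y * Y * P := by
      rw [hX_def, hb_def]
      calc P' * Y * P * (Y' * e) = P' * Y * (P * Y') * e := by simp only [mul_assoc]
        _ = P' * Y * (Y * P) * e := by rw [hPY']
        _ = P' * Y * Y * (P * e) := by simp only [mul_assoc]
        _ = P' * Y * Y * P := by rw [hPe]
    have e2 : b * X = P' * Y * Y * P := by
      rw [hX_def, hb_def]
      calc Y' * e * (P' * Y * P) = Y' * (e * P') * Y * P := by simp only [mul_assoc]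
        _ = Y' * P' * Y * P := by rw [heP']
        _ = P' * Y * Y * P := by rw [hY'P']
    exact e1.trans e2.symm
  -- `X = Q(𝐢) y_{r+1} e(𝐢)` by (R4) at `𝐢`
  have hsq := klrPsiR_sq k h i
  rw [if_neg hc, ← hP'_def, ← hP_def, ← hY_def, ← hY'_def, ← he_def] at hsq
  have hXq : X = (if i r' = i r + 1 then (if i r = i r' + 1 then (Y' - Y) * (Y - Y') else Y' - Y)
      else (if i r = i r' + 1 then Y - Y' else 1)) * b := by
    rw [hX_def, hb_def, mul_assoc P' Y P, ← hPY', ← mul_assoc, hsq, mul_assoc,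
      (commute_klrYR_klrIdemR k r' i).eq]
  -- normal forms of the commutative monomials
  have hba : Commute a b := by
    change a * b = b * a
    rw [ha_def, hb_def, mul_assoc, ← mul_assoc e Y' e, ← cY'e, mul_assoc Y' e e, hee, ← mul_assoc,
      mul_assoc Y' e (Y * e), ← mul_assoc e Y e, ← cYe, mul_assoc Y e e, hee, ← mul_assoc, cYY']
  have nab : a * b = Y * (Y' * e) := by
    rw [ha_def, hb_def, mul_assoc, ← mul_assoc e Y' e, ← cY'e, mul_assoc Y' e e, hee]
  have nbb : b * b = Y' * (Y' * e) := by
    rw [hb_def, mul_assoc, ← mul_assoc e Y' e, ← cY'e, mul_assoc Y' e e, hee]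
  have naab : a * (a * b) = Y * (Y * (Y' * e)) := by
    rw [nab, ha_def, mul_assoc, ← mul_assoc e Y, ← cYe, mul_assoc Y e, ← mul_assoc e Y', ← cY'e,
      mul_assoc Y' e e, hee]
  have nabb : a * (b * b) = Y * (Y' * (Y' * e)) := by
    rw [nbb, ha_def, mul_assoc, ← mul_assoc e Y', ← cY'e, mul_assoc Y' e, ← mul_assoc e Y', ← cY'e,
      mul_assoc Y' e e, hee]
  have nbbb : b * (b * b) = Y' * (Y' * (Y' * e)) := by
    rw [nbb, hb_def, mul_assoc, ← mul_assoc e Y', ← cY'e, mul_assoc Y' e, ← mul_assoc e Y', ← cY'e,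
      mul_assoc Y' e e, hee]
  have ha_nil : IsNilpotent a := isNilpotent_klrYR_mul_klrIdemR k hN i
  by_cases h1 : i r' = i r + 1
  · by_cases h2 : i r = i r' + 1
    · -- `i_r ⇄ i_{r+1}`: `b³ = a(2b² - ab) - X`
      rw [if_pos h1, if_pos h2] at hXq
      have key : b ^ 3 = a * (b * b + b * b - a * b) - X := by
        rw [pow_succ, pow_two, mul_assoc b b b, nbbb, mul_sub, mul_add, nabb, naab, hXq, hb_def]
        simp only [sub_mul, mul_sub, mul_assoc]
        rw [show Y' * (Y * (Y' * e)) = Y * (Y' * (Y' * e)) by rw [← mul_assoc, ← cYY', mul_assoc]]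
        abel
      refine IsNilpotent.of_pow (m := 3) ?_
      rw [key]
      refine Commute.isNilpotent_sub ?_ ?_ hXnil
      · exact ((hXa.symm.mul_left (((hXb.symm.mul_left hXb.symm).add_left
          (hXb.symm.mul_left hXb.symm)).sub_left (hXa.symm.mul_left hXb.symm))))
      · exact (((hba.mul_right hba).add_right (hba.mul_right hba)).sub_right
          ((Commute.refl a).mul_right hba)).isNilpotent_mul_right ha_nil
    · -- `i_r → i_{r+1}`: `b² = ab + X`
      rw [if_pos h1, if_neg h2] at hXq
      have key : b ^ 2 = a * b + X := by
        rw [pow_two, nbb, nab, hXq, hb_def]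
        simp only [sub_mul]
        abel
      refine IsNilpotent.of_pow (m := 2) ?_
      rw [key]
      exact Commute.isNilpotent_add (hXa.symm.mul_left hXb.symm) (hba.isNilpotent_mul_right ha_nil) hXnil
  · by_cases h2 : i r = i r' + 1
    · -- `i_r ← i_{r+1}`: `b² = ab - X`
      rw [if_neg h1, if_pos h2] at hXq
      have key : b ^ 2 = a * b - X := by
        rw [pow_two, nbb, nab, hXq, hb_def]
        simp only [sub_mul]
        abel
      refine IsNilpotent.of_pow (m := 2) ?_
      rw [key]
      exact Commute.isNilpotent_sub (hXa.symm.mul_left hXb.symm) (hba.isNilpotent_mul_right ha_nil) hXnil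
    · -- unrelated: `b = X`
      rw [if_neg h1, if_neg h2, one_mul] at hXq
      rw [← hXq]
      exact hXnil

/-- **Brundan–Kleshchev Lemma 2.1 (level one): the elements `y_r ∈ R^{Λ₀}_n` are nilpotent**
(arXiv:0808.2032, Lemma 2.1; cited through [HuMathas2010, §3.1]). [folklore] -/
theorem isNilpotent_klrYR (r : Fin n) : IsNilpotent (klrYR k (p := p) r) := by
  suffices H : ∀ m : ℕ, ∀ hm : m < n, IsNilpotent (klrYR k (p := p) ⟨m, hm⟩) from H r r.2
  intro m
  induction m with
  | zero => intro hm; exact ⟨1, by rw [pow_one, klrYR_eq_zero_of_val_eq_zero k rfl]⟩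
  | succ m ih =>
    intro hm
    have ih' := ih (by omega)
    set r₀ : Fin n := ⟨m, by omega⟩
    set r₁ : Fin n := ⟨m + 1, hm⟩
    have h01 : (r₁ : ℕ) = r₀ + 1 := rfl
    -- each `ȳ_{r+1} ē(𝐢)` is nilpotent
    have hi : ∀ i : Fin n → ZMod p, IsNilpotent (klrYR k r₁ * klrIdemR k i) := by
      intro i
      by_cases hc : i r₀ = i r₁
      · exact isNilpotent_klrYR_succ_mul_of_eq k h01 hc ih'
      · exact isNilpotent_klrYR_succ_mul_of_ne k h01 hc ih'
    -- uniform exponent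
    choose N hN using hi
    classical
    refine ⟨(Finset.univ.sup N) + 1, ?_⟩
    rw [← mul_one (klrYR k r₁ ^ _), ← sum_klrIdemR k, Finset.mul_sum]
    refine Finset.sum_eq_zero fun i _ => ?_
    have hle : N i ≤ Finset.univ.sup N := Finset.le_sup (Finset.mem_univ i)
    rw [← klrYR_mul_klrIdemR_pow, pow_succ]
    obtain ⟨d, hd⟩ := Nat.exists_eq_add_of_le hle
    rw [hd, pow_add, hN i, zero_mul, zero_mul]

end Nilpotent


/-! ### Brundan–Kleshchev's Hecke generators inside `R^{Λ₀}_n` (arXiv:0808.2032 (3.41)–(3.42)) -/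

section HeckeGenerators

variable (k : Type*) [Field k] (p n : ℕ) [Fact p.Prime] [CharP k p]

variable {p n}

/-- A residue `a ∈ ℤ/p` as a scalar of `k` (`char k = p`). [folklore] -/
abbrev resK (a : ZMod p) : k := ZMod.castHom (dvd_refl p) k a

/-- `c + (ȳ_r - ȳ_t) ∈ R^{Λ₀}_n`. [folklore] -/
def klrDiffUnitR (r t : Fin n) (c : k) : KLRAlgebra k p n :=
  algebraMap k (KLRAlgebra k p n) c + (klrYR k r - klrYR k t)

omit [CharP k p] in
/-- `ȳ_r - ȳ_t` is nilpotent. [folklore] -/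
theorem isNilpotent_klrYR_sub (r t : Fin n) : IsNilpotent (klrYR k (p := p) r - klrYR k t) :=
  (commute_klrYR k r t).isNilpotent_sub (isNilpotent_klrYR k r) (isNilpotent_klrYR k t)

omit [CharP k p] in
/-- `c + (ȳ_r - ȳ_t)` is a unit for `c ≠ 0`. [folklore] -/
theorem isUnit_klrDiffUnitR (r t : Fin n) {c : k} (hc : c ≠ 0) : IsUnit (klrDiffUnitR k (p := p) r t c) :=
  (isNilpotent_klrYR_sub k r t).isUnit_add_left_of_commute ((IsUnit.mk0 c hc).map (algebraMap k _))
    (Algebra.commute_algebraMap_right c _)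

omit [CharP k p] in
/-- Everything built from `ȳ`'s and scalars commutes with `z` if the `ȳ`'s do. [folklore] -/
theorem commute_klrDiffUnitR {z : KLRAlgebra k p n} (hz : ∀ t, Commute z (klrYR k t)) (r t : Fin n)
    (c : k) : Commute z (klrDiffUnitR k r t c) :=
  (Algebra.commute_algebraMap_right c z).add_right ((hz r).sub_right (hz t))

/-- **`p_r(𝐢) ∈ R^{Λ₀}_n`**: `1` if `i_r = i_{r+1}`, else `(i_r - i_{r+1} + ȳ_r - ȳ_{r+1})^{-1}`
(BK (3.22)). [folklore] -/
def klrPR (r r' : Fin n) (i : Fin n → ZMod p) : KLRAlgebra k p n :=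
  if i r = i r' then 1 else Ring.inverse (klrDiffUnitR k r r' (resK k (i r) - resK k (i r')))

/-- **`q_r(𝐢) ∈ R^{Λ₀}_n`**, BK's explicit choice (3.30) (same formula as `bkQ`). [folklore] -/
def klrQR (r r' : Fin n) (i : Fin n → ZMod p) : KLRAlgebra k p n :=
  if i r = i r' then 1 + (klrYR k r' - klrYR k r)
  else if i r' = i r + 1 then
    (if i r = i r' + 1 then -klrPR k r r' i else klrPR k r r' i * klrPR k r r' i - klrPR k r r' i)
  else (if i r = i r' + 1 then 1 else 1 - klrPR k r r' i)

/-- `p_r(𝐢)` is a unit. [folklore] -/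
theorem isUnit_klrPR (r r' : Fin n) (i : Fin n → ZMod p) : IsUnit (klrPR k r r' i) := by
  unfold klrPR
  split_ifs with h
  · exact isUnit_one
  · refine (isUnit_klrDiffUnitR k r r' (sub_ne_zero.2 fun e => h ?_)).ringInverse
    exact (ZMod.castHom (dvd_refl p) k).injective e

/-- `p_r(𝐢)` commutes with `z` if the `ȳ`'s do. [folklore] -/
theorem commute_klrPR {z : KLRAlgebra k p n} (hz : ∀ t, Commute z (klrYR k t)) (r r' : Fin n)
    (i : Fin n → ZMod p) : Commute z (klrPR k r r' i) := by
  unfold klrPR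
  split_ifs with h
  · exact Commute.one_right z
  · exact commute_ringInverse_of_commute (commute_klrDiffUnitR k hz r r' _)
      (isUnit_klrDiffUnitR k r r' (sub_ne_zero.2 fun e => h ((ZMod.castHom (dvd_refl p) k).injective e)))

/-- `q_r(𝐢)` commutes with `z` if the `ȳ`'s do. [folklore] -/
theorem commute_klrQR {z : KLRAlgebra k p n} (hz : ∀ t, Commute z (klrYR k t)) (r r' : Fin n)
    (i : Fin n → ZMod p) : Commute z (klrQR k r r' i) := by
  have hp := commute_klrPR k hz r r' i
  unfold klrQR
  split_ifs
  · exact (Commute.one_right z).add_right ((hz r').sub_right (hz r))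
  · exact hp.neg_right
  · exact (hp.mul_right hp).sub_right hp
  · exact Commute.one_right z
  · exact (Commute.one_right z).sub_right hp

/-- `ē(𝐣)` commutes with `p_r(𝐢)`, `q_r(𝐢)`. [folklore] -/
theorem commute_klrIdemR_klrQR (j : Fin n → ZMod p) (r r' : Fin n) (i : Fin n → ZMod p) :
    Commute (klrIdemR k j) (klrQR k r r' i) :=
  commute_klrQR k (fun t => (commute_klrYR_klrIdemR k t j).symm) r r' i

/-- `ē(𝐣)` commutes with `p_r(𝐢)`. [folklore] -/
theorem commute_klrIdemR_klrPR (j : Fin n → ZMod p) (r r' : Fin n) (i : Fin n → ZMod p) :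
    Commute (klrIdemR k j) (klrPR k r r' i) :=
  commute_klrPR k (fun t => (commute_klrYR_klrIdemR k t j).symm) r r' i

/-- **BK's `s_r := ∑_𝐢 (ψ_r q_r(𝐢) - p_r(𝐢)) e(𝐢) ∈ R^{Λ₀}_n`** (arXiv:0808.2032 (3.42)). [folklore] -/
def klrSR (r r' : Fin n) : KLRAlgebra k p n :=
  ∑ i : Fin n → ZMod p, (klrPsiR k r i * klrQR k r r' i - klrPR k r r' i * klrIdemR k i)

/-- **BK's `x_r := ∑_𝐢 (y_r + i_r) e(𝐢) ∈ R^{Λ₀}_n`** (arXiv:0808.2032 (3.41)). [folklore] -/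
def klrXR (r : Fin n) : KLRAlgebra k p n :=
  ∑ i : Fin n → ZMod p, (klrYR k r + algebraMap k _ (resK k (i r))) * klrIdemR k i

/-- `s_r ē(𝐢) = P_r(𝐢) q_r(𝐢) - p_r(𝐢) ē(𝐢)`. [folklore] -/
theorem klrSR_mul_klrIdemR (r r' : Fin n) (i : Fin n → ZMod p) :
    klrSR k r r' * klrIdemR k i = klrPsiR k r i * klrQR k r r' i - klrPR k r r' i * klrIdemR k i := by
  rw [klrSR, Finset.sum_mul, Finset.sum_eq_single_of_mem i (Finset.mem_univ i)]
  · rw [sub_mul, mul_assoc, ← (commute_klrIdemR_klrQR k i r r' i).eq, ← mul_assoc,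
      klrPsiR_mul_klrIdemR_self, mul_assoc, klrIdemR_mul_self]
  · intro j _ hji
    rw [sub_mul, mul_assoc, ← (commute_klrIdemR_klrQR k i r r' j).eq, ← mul_assoc, klrPsiR_mul_klrIdemR,
      if_neg hji, zero_mul, mul_assoc, klrIdemR_mul_klrIdemR, if_neg hji, mul_zero, sub_zero]

/-- `x_r ē(𝐢) = (ȳ_r + i_r) ē(𝐢)`. [folklore] -/
theorem klrXR_mul_klrIdemR (r : Fin n) (i : Fin n → ZMod p) :
    klrXR k r * klrIdemR k i = (klrYR k r + algebraMap k _ (resK k (i r))) * klrIdemR k i := by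
  rw [klrXR, Finset.sum_mul, Finset.sum_eq_single_of_mem i (Finset.mem_univ i)]
  · rw [mul_assoc, klrIdemR_mul_self]
  · intro j _ hji
    rw [mul_assoc, klrIdemR_mul_klrIdemR, if_neg hji, mul_zero]

/-- `ē(𝐢) x_r = x_r ē(𝐢)`. [folklore] -/
theorem commute_klrIdemR_klrXR (i : Fin n → ZMod p) (r : Fin n) : Commute (klrIdemR k i) (klrXR k (p := p) r) := by
  refine Commute.sum_right _ _ _ fun j _ => ?_
  refine Commute.mul_right ((commute_klrYR_klrIdemR k r i).symm.add_right
    (Algebra.commute_algebraMap_right _ _)) ?_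
  change klrIdemR k i * klrIdemR k j = klrIdemR k j * klrIdemR k i
  rw [klrIdemR_mul_klrIdemR, klrIdemR_mul_klrIdemR]
  by_cases hij : i = j
  · subst hij; rfl
  · rw [if_neg hij, if_neg (Ne.symm hij)]

omit [CharP k p] in
/-- `ē(𝐢)` commutes with `ȳ_t + c`. [folklore] -/
theorem commute_klrIdemR_klrYR_add (i : Fin n → ZMod p) (t : Fin n) (c : k) :
    Commute (klrIdemR k i) (klrYR k t + algebraMap k (KLRAlgebra k p n) c) :=
  (commute_klrYR_klrIdemR k t i).symm.add_right (Algebra.commute_algebraMap_right _ _)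

/-- `x_r x_t ē(𝐢) = (ȳ_r + i_r)(ȳ_t + i_t) ē(𝐢)`. [folklore] -/
theorem klrXR_mul_klrXR_mul_klrIdemR (r t : Fin n) (i : Fin n → ZMod p) :
    klrXR k r * klrXR k t * klrIdemR k i =
      (klrYR k r + algebraMap k _ (resK k (i r))) * (klrYR k t + algebraMap k _ (resK k (i t))) *
        klrIdemR k i := by
  rw [mul_assoc, klrXR_mul_klrIdemR, ← (commute_klrIdemR_klrYR_add k i t _).eq, ← mul_assoc,
    klrXR_mul_klrIdemR, mul_assoc, (commute_klrIdemR_klrYR_add k i t _).eq, ← mul_assoc]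

omit [CharP k p] in
/-- An identity holds in `R^{Λ₀}_n` if it holds after right multiplication by every `ē(𝐢)`.
[folklore] -/
theorem klr_eq_of_mul_klrIdemR {x y : KLRAlgebra k p n} (h : ∀ i, x * klrIdemR k i = y * klrIdemR k i) :
    x = y := by
  rw [← mul_one x, ← sum_klrIdemR k, Finset.mul_sum, ← mul_one y, ← sum_klrIdemR k, Finset.mul_sum]
  exact Finset.sum_congr rfl fun i _ => h i

/-- **The `x_r` commute** (BK Thm 3.3, relation (3.7)). [folklore] -/
theorem commute_klrXR (r t : Fin n) : Commute (klrXR k (p := p) (n := n) r) (klrXR k t) := by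
  refine klr_eq_of_mul_klrIdemR k fun i => ?_
  rw [klrXR_mul_klrXR_mul_klrIdemR, klrXR_mul_klrXR_mul_klrIdemR,
    (((commute_klrYR k r t).add_right (Algebra.commute_algebraMap_right _ _)).add_left
      ((Algebra.commute_algebraMap_left _ _).add_right (Algebra.commute_algebraMap_left _ _))).eq]

/-- `x_r` commutes with the `ȳ`'s. [folklore] -/
theorem commute_klrXR_klrYR (r t : Fin n) : Commute (klrXR k (p := p) (n := n) r) (klrYR k t) := by
  refine Commute.sum_left _ _ _ fun j _ => ?_
  exact (((commute_klrYR k r t).add_left (Algebra.commute_algebraMap_left _ _)).mul_left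
    (commute_klrYR_klrIdemR k t j).symm)

/-- `x_r P_t(𝐢) = (ȳ_r + (s_t𝐢)_r) P_t(𝐢)`. [folklore] -/
theorem klrXR_mul_klrPsiR {t t' : Fin n} (ht : (t' : ℕ) = t + 1) (r : Fin n) (i : Fin n → ZMod p) :
    klrXR k r * klrPsiR k t i =
      (klrYR k r + algebraMap k _ (resK k ((i ∘ swap t t') r))) * klrPsiR k t i := by
  rw [← klrIdemR_swap_mul_klrPsiR k ht i, ← mul_assoc, klrXR_mul_klrIdemR, mul_assoc]

/-- `p_r(𝐢) (i_r - i_{r+1} + ȳ_r - ȳ_{r+1}) = 1` for `i_r ≠ i_{r+1}`. [folklore] -/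
theorem klrPR_mul_klrDiffUnitR {r r' : Fin n} {i : Fin n → ZMod p} (hc : i r ≠ i r') :
    klrPR k r r' i * klrDiffUnitR k r r' (resK k (i r) - resK k (i r')) = 1 := by
  rw [klrPR, if_neg hc]
  exact Ring.inverse_mul_cancel _ (isUnit_klrDiffUnitR k r r'
    (sub_ne_zero.2 fun e => hc ((ZMod.castHom (dvd_refl p) k).injective e)))

/-- **The mixed relation, `ē(𝐢)`-wise: `(s_r x_{r+1} - x_r s_r) ē(𝐢) = ē(𝐢)`** (BK Thm 3.3,
proof of (3.8)). [folklore] -/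
theorem klrSR_mixed_mul_klrIdemR {r r' : Fin n} (h : (r' : ℕ) = r + 1) (i : Fin n → ZMod p) :
    (klrSR k r r' * klrXR k r' - klrXR k r * klrSR k r r') * klrIdemR k i = klrIdemR k i := by
  -- names
  set e := klrIdemR k (p := p) i with he
  set P := klrPsiR k r i with hP
  set q := klrQR k r r' i with hq
  set pp := klrPR k r r' i with hpp
  set Y := klrYR k (p := p) (n := n) r with hY
  set Y' := klrYR k (p := p) (n := n) r' with hY'
  set C := algebraMap k (KLRAlgebra k p n) (resK k (i r)) with hC
  set C' := algebraMap k (KLRAlgebra k p n) (resK k (i r')) with hC'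
  -- `ē`-wise expansions
  have h1 : klrSR k r r' * klrXR k r' * e = (P * q - pp * e) * (Y' + C') := by
    rw [mul_assoc, klrXR_mul_klrIdemR, ← (commute_klrIdemR_klrYR_add k i r' _).eq, ← mul_assoc,
      klrSR_mul_klrIdemR]
  have h2 : klrXR k r * klrSR k r r' * e = (Y + C') * (P * q) - pp * ((Y + C) * e) := by
    rw [mul_assoc, klrSR_mul_klrIdemR, mul_sub, ← mul_assoc (klrXR k r), klrXR_mul_klrPsiR k h,
      ← mul_assoc (klrXR k r), (commute_klrPR k (commute_klrXR_klrYR k r) r r' i).eq,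
      mul_assoc (klrPR k r r' i) (klrXR k r), klrXR_mul_klrIdemR]
    simp only [Function.comp_apply, swap_apply_left, mul_assoc]
    rfl
  rw [sub_mul, h1, h2]
  -- commutations
  have cqY' : q * Y' = Y' * q := (commute_klrQR k (fun t => commute_klrYR k r' t) r r' i).symm.eq
  have cqC' : q * C' = C' * q := (Algebra.commutes _ _).symm
  have ceY' : e * Y' = Y' * e := (commute_klrYR_klrIdemR k r' i).symm.eq
  have ceY : e * Y = Y * e := (commute_klrYR_klrIdemR k r i).symm.eq
  have ceC' : e * C' = C' * e := (Algebra.commutes _ _).symm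
  have cPC' : C' * P = P * C' := Algebra.commutes _ _
  have cppY : pp * Y = Y * pp := (commute_klrPR k (fun t => commute_klrYR k r t) r r' i).symm.eq
  have cppY' : pp * Y' = Y' * pp := (commute_klrPR k (fun t => commute_klrYR k r' t) r r' i).symm.eq
  have cppC : pp * C = C * pp := (Algebra.commutes _ _).symm
  have cppC' : pp * C' = C' * pp := (Algebra.commutes _ _).symm
  have cppe : pp * e = e * pp := (commute_klrIdemR_klrPR k i r r' i).symm.eq
  have hPY' := klrPsiR_mul_klrYR_succ k h i
  rw [← hP, ← hY', ← hY, ← he] at hPY'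
  -- `Y P = P Y' - δ e`
  have hYP : Y * P = P * Y' - (if i r = i r' then e else 0) := eq_sub_of_add_eq hPY'.symm
  -- reduce: the scalar `C'` terms cancel, `P`-terms cancel up to `δ e q`
  have key : (P * q - pp * e) * (Y' + C') - ((Y + C') * (P * q) - pp * ((Y + C) * e)) =
      (if i r = i r' then e else 0) * q + pp * ((C - C') + (Y - Y')) * e := by
    rw [sub_mul, mul_add, mul_add, add_mul, mul_assoc P q Y', cqY', ← mul_assoc P Y' q,
      mul_assoc P q C', cqC', ← mul_assoc P C' q, ← cPC', ← mul_assoc Y P q, hYP, mul_assoc C' P q]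
    simp only [mul_add, add_mul, mul_sub, sub_mul, mul_assoc]
    rw [ceC', ceY']
    abel
  rw [key]
  by_cases hc : i r = i r'
  · have hpp1 : pp = 1 := by rw [hpp, klrPR, if_pos hc]
    have hq1 : q = 1 + (Y' - Y) := by rw [hq, klrQR, if_pos hc]
    have hCC : C = C' := by rw [hC, hC', hc]
    rw [if_pos hc, hpp1, hq1, hCC, one_mul, sub_self, zero_add, mul_add, mul_one, mul_sub, sub_mul, ceY',
      ceY]
    abel
  · rw [if_neg hc, zero_mul, zero_add, show (C - C') + (Y - Y') =
      klrDiffUnitR k r r' (resK k (i r) - resK k (i r')) by rw [klrDiffUnitR, map_sub], hpp,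
      klrPR_mul_klrDiffUnitR k hc, one_mul]

/-- **The mixed relation `s_r x_{r+1} - x_r s_r = 1`** (BK Thm 3.3, relation (3.8)). [folklore] -/
theorem klrSR_mul_klrXR_succ_sub {r r' : Fin n} (h : (r' : ℕ) = r + 1) :
    klrSR k r r' * klrXR k r' - klrXR k r * klrSR k r r' = (1 : KLRAlgebra k p n) :=
  klr_eq_of_mul_klrIdemR k fun i => by rw [klrSR_mixed_mul_klrIdemR k h, one_mul]

omit [CharP k p] in
/-- `(c + ȳ_r - ȳ_t) - 1 = (c - 1) + ȳ_r - ȳ_t`. [folklore] -/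
theorem klrDiffUnitR_sub_one (r t : Fin n) (c : k) :
    klrDiffUnitR k (p := p) r t c - 1 = klrDiffUnitR k r t (c - 1) := by
  rw [klrDiffUnitR, klrDiffUnitR, map_sub, map_one]
  abel

omit [CharP k p] in
/-- `1 - (c + ȳ_r - ȳ_t)^{-1} = (c + ȳ_r - ȳ_t)^{-1} ((c-1) + ȳ_r - ȳ_t)` (`c ≠ 0`). [folklore] -/
theorem one_sub_ringInverse_klrDiffUnitR (r t : Fin n) {c : k} (hc : c ≠ 0) :
    1 - Ring.inverse (klrDiffUnitR k (p := p) r t c) =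
      Ring.inverse (klrDiffUnitR k r t c) * klrDiffUnitR k r t (c - 1) := by
  rw [← klrDiffUnitR_sub_one, mul_sub, mul_one, Ring.inverse_mul_cancel _ (isUnit_klrDiffUnitR k r t hc)]

omit [CharP k p] in
/-- `1 - (c + ȳ_r - ȳ_t)^{-1}` is a unit for `c ∉ {0, 1}`. [folklore] -/
theorem isUnit_one_sub_ringInverse_klrDiffUnitR (r t : Fin n) {c : k} (hc : c ≠ 0) (hc1 : c ≠ 1) :
    IsUnit (1 - Ring.inverse (klrDiffUnitR k (p := p) r t c)) := by
  rw [one_sub_ringInverse_klrDiffUnitR k r t hc]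
  exact (isUnit_klrDiffUnitR k r t hc).ringInverse.mul (isUnit_klrDiffUnitR k r t (sub_ne_zero.2 hc1))

/-- The residue difference `i_r - i_{r+1}` in `k`: nonzero iff `i_r ≠ i_{r+1}`. [folklore] -/
theorem resK_sub_ne_zero {i : Fin n → ZMod p} {r r' : Fin n} (hc : i r ≠ i r') :
    resK k (i r) - resK k (i r') ≠ 0 :=
  sub_ne_zero.2 fun e => hc ((ZMod.castHom (dvd_refl p) k).injective e)

/-- `i_r - i_{r+1} ≠ 1` in `k` unless `i_r = i_{r+1} + 1`. [folklore] -/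
theorem resK_sub_ne_one {i : Fin n → ZMod p} {r r' : Fin n} (h2 : ¬ i r = i r' + 1) :
    resK k (i r) - resK k (i r') ≠ 1 := by
  intro e
  apply h2
  apply (ZMod.castHom (dvd_refl p) k).injective
  rw [map_add, map_one, add_comm]
  exact sub_eq_iff_eq_add.1 e

/-- **`q_r(𝐢)` is a unit.** [folklore] -/
theorem isUnit_klrQR (r r' : Fin n) (i : Fin n → ZMod p) : IsUnit (klrQR k r r' i) := by
  unfold klrQR
  split_ifs with h1 h2 h3 h4
  · exact (isNilpotent_klrYR_sub k r' r).isUnit_one_add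
  · exact (isUnit_klrPR k r r' i).neg
  · have hp : klrPR k r r' i = Ring.inverse (klrDiffUnitR k r r' (resK k (i r) - resK k (i r'))) := by
      rw [klrPR, if_neg h1]
    have e : klrPR k r r' i * klrPR k r r' i - klrPR k r r' i = -(klrPR k r r' i * (1 - klrPR k r r' i)) := by
      rw [mul_sub, mul_one, neg_sub]
    rw [e, hp]
    exact ((isUnit_klrDiffUnitR k r r' (resK_sub_ne_zero k h1)).ringInverse.mul
      (isUnit_one_sub_ringInverse_klrDiffUnitR k r r' (resK_sub_ne_zero k h1) (resK_sub_ne_one k h3))).neg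
  · exact isUnit_one
  · rw [klrPR, if_neg h1]
    exact isUnit_one_sub_ringInverse_klrDiffUnitR k r r' (resK_sub_ne_zero k h1) (resK_sub_ne_one k h4)

/-- **`s_r x_t = x_t s_r` for `t ≠ r, r+1`** (BK Thm 3.3, relation (3.8), second part). [folklore] -/
theorem klrSR_mul_klrXR_of_ne {r r' t : Fin n} (h : (r' : ℕ) = r + 1) (htr : t ≠ r) (htr' : t ≠ r') :
    klrSR k r r' * klrXR k (p := p) t = klrXR k t * klrSR k r r' := by
  refine klr_eq_of_mul_klrIdemR k fun i => ?_
  rw [mul_assoc, klrXR_mul_klrIdemR, ← (commute_klrIdemR_klrYR_add k i t _).eq, ← mul_assoc,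
    klrSR_mul_klrIdemR, mul_assoc (klrXR k t), klrSR_mul_klrIdemR, mul_sub (klrXR k t),
    ← mul_assoc (klrXR k t), klrXR_mul_klrPsiR k h, ← mul_assoc (klrXR k t),
    (commute_klrPR k (commute_klrXR_klrYR k t) r r' i).eq, mul_assoc (klrPR k r r' i) (klrXR k t),
    klrXR_mul_klrIdemR]
  simp only [Function.comp_apply, swap_apply_of_ne_of_ne htr htr']
  have cq : Commute (klrQR k r r' i) (klrYR k t + algebraMap k (KLRAlgebra k p n) (resK k (i t))) :=
    ((commute_klrQR k (fun u => commute_klrYR k t u) r r' i).symm).add_right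
      (Algebra.commute_algebraMap_right _ _)
  have cp : Commute (klrPR k r r' i) (klrYR k t + algebraMap k (KLRAlgebra k p n) (resK k (i t))) :=
    ((commute_klrPR k (fun u => commute_klrYR k t u) r r' i).symm).add_right
      (Algebra.commute_algebraMap_right _ _)
  have cP : klrPsiR k r i * (klrYR k t + algebraMap k (KLRAlgebra k p n) (resK k (i t))) =
      (klrYR k t + algebraMap k _ (resK k (i t))) * klrPsiR k r i := by
    rw [mul_add, add_mul, klrPsiR_mul_klrYR_of_ne k h htr htr', (Algebra.commutes _ _).symm]
  have ce := (commute_klrIdemR_klrYR_add k i t (resK k (i t))).eq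
  rw [sub_mul, mul_assoc, cq.eq, ← mul_assoc, cP, mul_assoc, mul_assoc, ce, ← mul_assoc, ← mul_assoc,
    cp.eq, mul_assoc, mul_assoc]

/-! #### The quadratic relation `s_r² = 1` (BK Thm 3.3, (3.9)) -/

omit [Fact p.Prime] [CharP k p] in
/-- `u'θ = θv ⇒ u'^{-1}θ = θ v^{-1}` for units. [folklore] -/
theorem ringInverse_mul_of_semiconj {A : Type*} [Ring A] {θ u' v : A} (h : u' * θ = θ * v)
    (hu' : IsUnit u') (hv : IsUnit v) : Ring.inverse u' * θ = θ * Ring.inverse v := by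
  calc Ring.inverse u' * θ
      = Ring.inverse u' * θ * (v * Ring.inverse v) := by rw [Ring.mul_inverse_cancel _ hv, mul_one]
    _ = Ring.inverse u' * (u' * θ) * Ring.inverse v := by rw [h, mul_assoc, mul_assoc, mul_assoc]
    _ = θ * Ring.inverse v := by rw [← mul_assoc, Ring.inverse_mul_cancel _ hu', one_mul]

omit [CharP k p] in
/-- `(d + ȳ_r - ȳ_{r+1}) P_r(𝐢) = P_r(𝐢) (d + ȳ_{r+1} - ȳ_r)` for `i_r ≠ i_{r+1}`. [folklore] -/
theorem klrDiffUnitR_mul_klrPsiR {r r' : Fin n} (h : (r' : ℕ) = r + 1) {i : Fin n → ZMod p}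
    (hc : i r ≠ i r') (d : k) :
    klrDiffUnitR k r r' d * klrPsiR k r i = klrPsiR k r i * klrDiffUnitR k r' r d := by
  have hY'P := klrYR_succ_mul_klrPsiR k h i
  have hPY' := klrPsiR_mul_klrYR_succ k h i
  rw [if_neg hc, add_zero] at hY'P hPY'
  rw [klrDiffUnitR, klrDiffUnitR, add_mul, mul_add, Algebra.commutes, sub_mul, mul_sub, hY'P, hPY']

/-- **`p_r(s_r𝐢) P_r(𝐢) = -P_r(𝐢) p_r(𝐢)`** (`i_r ≠ i_{r+1}`; BK (3.24) `{}^{s_r}p_r(s_r𝐢) = -p_r(𝐢)`).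
[folklore] -/
theorem klrPR_swap_mul_klrPsiR {r r' : Fin n} (h : (r' : ℕ) = r + 1) {i : Fin n → ZMod p}
    (hc : i r ≠ i r') :
    klrPR k r r' (i ∘ swap r r') * klrPsiR k r i = -(klrPsiR k r i * klrPR k r r' i) := by
  have hrr' : r ≠ r' := by intro e; rw [Fin.ext_iff] at e; omega
  have hc' : (i ∘ swap r r') r ≠ (i ∘ swap r r') r' := by
    simp only [Function.comp_apply, swap_apply_left, swap_apply_right]; exact Ne.symm hc
  rw [klrPR, if_neg hc', klrPR, if_neg hc]
  simp only [Function.comp_apply, swap_apply_left, swap_apply_right]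
  have hu : IsUnit (klrDiffUnitR k (p := p) r r' (resK k (i r') - resK k (i r))) :=
    isUnit_klrDiffUnitR k r r' (resK_sub_ne_zero k (Ne.symm hc))
  have hv : IsUnit (klrDiffUnitR k (p := p) r' r (resK k (i r') - resK k (i r))) :=
    isUnit_klrDiffUnitR k r' r (resK_sub_ne_zero k (Ne.symm hc))
  rw [ringInverse_mul_of_semiconj (klrDiffUnitR_mul_klrPsiR k h hc _) hu hv,
    show klrDiffUnitR k (p := p) r' r (resK k (i r') - resK k (i r)) =
      -klrDiffUnitR k r r' (resK k (i r) - resK k (i r')) by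
        rw [klrDiffUnitR, klrDiffUnitR, map_sub, map_sub]; abel,
    ringInverse_neg (isUnit_klrDiffUnitR k r r' (resK_sub_ne_zero k hc))]
  exact (neg_mul_eq_mul_neg (klrPsiR k r i) _).symm

/-- `{}^{s_r}q_r(s_r𝐢)` in terms of `p = p_r(𝐢)` (cf. `bkQs`). [folklore] -/
def klrQsR (r r' : Fin n) (i : Fin n → ZMod p) : KLRAlgebra k p n :=
  if i r' = i r + 1 then (if i r = i r' + 1 then klrPR k r r' i else 1)
  else (if i r = i r' + 1 then klrPR k r r' i * klrPR k r r' i + klrPR k r r' i else 1 + klrPR k r r' i)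

/-- **`q_r(s_r𝐢) P_r(𝐢) = P_r(𝐢) · {}^{s_r}q_r(s_r𝐢)`** (`i_r ≠ i_{r+1}`). [folklore] -/
theorem klrQR_swap_mul_klrPsiR {r r' : Fin n} (h : (r' : ℕ) = r + 1) {i : Fin n → ZMod p}
    (hc : i r ≠ i r') :
    klrQR k r r' (i ∘ swap r r') * klrPsiR k r i = klrPsiR k r i * klrQsR k r r' i := by
  have hrr' : r ≠ r' := by intro e; rw [Fin.ext_iff] at e; omega
  have hpP := klrPR_swap_mul_klrPsiR k h hc
  set pp' := klrPR k r r' (i ∘ swap r r')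
  set pp := klrPR k r r' i
  set P := klrPsiR k r i
  have hpP' : pp' * P = P * -pp := hpP.trans (neg_mul_eq_mul_neg P pp)
  have hppP : pp' * (pp' * P) = P * (pp * pp) := by
    rw [hpP', ← mul_assoc, hpP', mul_assoc]
    exact congrArg (P * ·) (neg_mul_neg pp pp)
  unfold klrQR klrQsR
  simp only [Function.comp_apply, swap_apply_left, swap_apply_right]
  rw [if_neg (Ne.symm hc)]
  by_cases h1 : i r' = i r + 1
  · by_cases h2 : i r = i r' + 1
    · rw [if_pos h2, if_pos h1, if_pos h1, if_pos h2]
      exact (neg_mul_eq_neg_mul _ _).symm.trans (by rw [hpP, neg_neg])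
    · rw [if_neg h2, if_pos h1, if_pos h1, if_neg h2, one_mul, mul_one]
  · by_cases h2 : i r = i r' + 1
    · rw [if_pos h2, if_neg h1, if_neg h1, if_pos h2, sub_mul, mul_assoc, hppP, hpP, mul_add]
      abel
    · rw [if_neg h2, if_neg h1, if_neg h1, if_neg h2, sub_mul, one_mul, hpP, mul_add, mul_one]
      abel

/-- The double commutant `Y''` of `{ȳ_r}` in `R^{Λ₀}_n`: a commutative subalgebra containing the `ȳ_r`,
scalars, `p_r(𝐢)`, `q_r(𝐢)` and inverses of its units (cf. `yAlg` in `k[S_n]`). [folklore] -/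
def klrYAlg : Subalgebra k (KLRAlgebra k p n) :=
  Subalgebra.centralizer k (Set.centralizer (Set.range (klrYR k (p := p) (n := n))))

omit [CharP k p] in
/-- Membership in `Y''`. [folklore] -/
theorem mem_klrYAlg_iff {z : KLRAlgebra k p n} :
    z ∈ klrYAlg k (p := p) (n := n) ↔
      ∀ g ∈ Set.centralizer (Set.range (klrYR k (p := p) (n := n))), g * z = z * g :=
  Subalgebra.mem_centralizer_iff k

omit [CharP k p] in
/-- `ȳ_t ∈ Y''`. [folklore] -/
theorem klrYR_mem_klrYAlg (t : Fin n) : klrYR k t ∈ klrYAlg k (p := p) (n := n) :=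
  (mem_klrYAlg_iff k).2 fun _ hg => (hg _ ⟨t, rfl⟩).symm

omit [CharP k p] in
/-- `Y''` is closed under inverses of units. [folklore] -/
theorem ringInverse_mem_klrYAlg {u : KLRAlgebra k p n} (hu : u ∈ klrYAlg k (p := p) (n := n))
    (hunit : IsUnit u) : Ring.inverse u ∈ klrYAlg k (p := p) (n := n) :=
  (mem_klrYAlg_iff k).2 fun g hg =>
    (commute_ringInverse_of_commute (((mem_klrYAlg_iff k).1 hu g hg)) hunit).eq

omit [CharP k p] in
/-- `Y''` is commutative. [folklore] -/
instance isMulCommutative_klrYAlg : IsMulCommutative (klrYAlg k (p := p) (n := n)) :=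
  ⟨⟨fun a b => Subtype.ext (Set.centralizer_centralizer_comm_of_comm (fun x hx y hy => by
    obtain ⟨s, rfl⟩ := hx
    obtain ⟨t, rfl⟩ := hy
    exact (commute_klrYR k s t).eq) a.1 a.2 b.1 b.2)⟩⟩

omit [CharP k p] in
/-- Difference units lie in `Y''`. [folklore] -/
theorem klrDiffUnitR_mem_klrYAlg (a b : Fin n) (c : k) : klrDiffUnitR k a b c ∈ klrYAlg k (p := p) (n := n) :=
  add_mem (Subalgebra.algebraMap_mem _ c) (sub_mem (klrYR_mem_klrYAlg k a) (klrYR_mem_klrYAlg k b))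

/-- `p_r(𝐢) ∈ Y''`. [folklore] -/
theorem klrPR_mem_klrYAlg (r r' : Fin n) (i : Fin n → ZMod p) : klrPR k r r' i ∈ klrYAlg k (p := p) (n := n) := by
  unfold klrPR
  split_ifs with h
  · exact one_mem _
  · exact ringInverse_mem_klrYAlg k (klrDiffUnitR_mem_klrYAlg k r r' _)
      (isUnit_klrDiffUnitR k r r' (resK_sub_ne_zero k h))

omit [CharP k p] in
/-- `ē(𝐢)` commutes with everything in `Y''`. [folklore] -/
theorem klrIdemR_mul_of_mem_klrYAlg {z : KLRAlgebra k p n} (hz : z ∈ klrYAlg k (p := p) (n := n))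
    (i : Fin n → ZMod p) : klrIdemR k i * z = z * klrIdemR k i :=
  (mem_klrYAlg_iff k).1 hz _ (by rintro _ ⟨t, rfl⟩; exact (commute_klrYR_klrIdemR k t i).eq)

open scoped IsMulCommutative in
/-- **The scalar identity behind `s_r² = 1` for `i_r ≠ i_{r+1}`**:
`Q_{i_ri_{r+1}}(ȳ) · {}^{s_r}q_r(s_r𝐢) · q_r(𝐢) + p_r(𝐢)² = 1` (BK (3.43) with (3.29)). [folklore] -/
theorem klrQuadratic_scalar {r r' : Fin n} {i : Fin n → ZMod p} (hc : i r ≠ i r') :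
    (if i r' = i r + 1 then
        (if i r = i r' + 1 then (klrYR k r' - klrYR k r) * (klrYR k r - klrYR k r')
          else klrYR k r' - klrYR k r)
      else (if i r = i r' + 1 then klrYR k r - klrYR k r' else 1)) *
      klrQsR k r r' i * klrQR k r r' i + klrPR k r r' i * klrPR k r r' i = (1 : KLRAlgebra k p n) := by
  have hu : IsUnit (klrDiffUnitR k (p := p) r r' (resK k (i r) - resK k (i r'))) :=
    isUnit_klrDiffUnitR k r r' (resK_sub_ne_zero k hc)
  have hp : klrPR k r r' i = Ring.inverse (klrDiffUnitR k r r' (resK k (i r) - resK k (i r'))) := by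
    rw [klrPR, if_neg hc]
  -- atoms of `Y''`
  obtain ⟨a, ha⟩ : ∃ a : klrYAlg k (p := p) (n := n), (a : KLRAlgebra k p n) = klrPR k r r' i :=
    ⟨⟨_, klrPR_mem_klrYAlg k _ _ _⟩, rfl⟩
  obtain ⟨Y1, hY1⟩ : ∃ Y : klrYAlg k (p := p) (n := n), (Y : KLRAlgebra k p n) = klrYR k r :=
    ⟨⟨_, klrYR_mem_klrYAlg k _⟩, rfl⟩
  obtain ⟨Y2, hY2⟩ : ∃ Y : klrYAlg k (p := p) (n := n), (Y : KLRAlgebra k p n) = klrYR k r' :=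
    ⟨⟨_, klrYR_mem_klrYAlg k _⟩, rfl⟩
  have Ra := Ring.inverse_mul_cancel _ hu
  rw [← hp, klrDiffUnitR, ← ha, ← hY1, ← hY2] at Ra
  unfold klrQsR klrQR
  rw [if_neg hc, ← ha, ← hY1, ← hY2]
  by_cases h1 : i r' = i r + 1 <;> by_cases h2 : i r = i r' + 1
  · -- `i_r ⇄ i_{r+1}` (characteristic 2)
    have h2k : (2 : k) = 0 := by
      have e1 := congrArg (resK k) h1
      have e2 := congrArg (resK k) h2
      simp only [map_add, map_one] at e1 e2
      linear_combination -(e1 + e2)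
    have h2S : (2 : klrYAlg k (p := p) (n := n)) = 0 := by
      have := congrArg (algebraMap k (klrYAlg k (p := p) (n := n))) h2k
      rwa [map_ofNat, map_zero] at this
    rw [show resK k (i r) - resK k (i r') = 1 by
      rw [h2]; unfold resK; rw [map_add, map_one]; ring, map_one] at Ra
    simp only [if_pos h1, if_pos h2]
    have Ra' : a * (1 + (Y1 - Y2)) = 1 := by exact_mod_cast Ra
    exact_mod_cast (show (Y2 - Y1) * (Y1 - Y2) * a * -a + a * a = (1 : klrYAlg k (p := p) (n := n)) by
      linear_combination (1 - a + (Y1 - Y2) * a) * Ra' + (a ^ 2 - a) * h2S)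
  · -- `i_r → i_{r+1}`
    rw [show resK k (i r) - resK k (i r') = -1 by
      rw [h1]; unfold resK; rw [map_add, map_one]; ring, map_neg, map_one] at Ra
    simp only [if_pos h1, if_neg h2]
    have Ra' : a * (-1 + (Y1 - Y2)) = 1 := by exact_mod_cast Ra
    exact_mod_cast (show (Y2 - Y1) * 1 * (a * a - a) + a * a = (1 : klrYAlg k (p := p) (n := n)) by
      linear_combination (1 - a) * Ra')
  · -- `i_r ← i_{r+1}`
    rw [show resK k (i r) - resK k (i r') = 1 by
      rw [h2]; unfold resK; rw [map_add, map_one]; ring, map_one] at Ra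
    simp only [if_neg h1, if_pos h2]
    have Ra' : a * (1 + (Y1 - Y2)) = 1 := by exact_mod_cast Ra
    exact_mod_cast (show (Y1 - Y2) * (a * a + a) * 1 + a * a = (1 : klrYAlg k (p := p) (n := n)) by
      linear_combination (1 + a) * Ra')
  · -- unrelated
    simp only [if_neg h1, if_neg h2]
    exact_mod_cast (show 1 * (1 + a) * (1 - a) + a * a = (1 : klrYAlg k (p := p) (n := n)) by ring)

/-- `q_r(𝐢) ∈ Y''`. [folklore] -/
theorem klrQR_mem_klrYAlg (r r' : Fin n) (i : Fin n → ZMod p) : klrQR k r r' i ∈ klrYAlg k (p := p) (n := n) := by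
  have hp := klrPR_mem_klrYAlg k r r' i
  unfold klrQR
  split_ifs
  · exact add_mem (one_mem _) (sub_mem (klrYR_mem_klrYAlg k r') (klrYR_mem_klrYAlg k r))
  · exact neg_mem hp
  · exact sub_mem (mul_mem hp hp) hp
  · exact one_mem _
  · exact sub_mem (one_mem _) hp

/-- `{}^{s_r}q_r(s_r𝐢) ∈ Y''`. [folklore] -/
theorem klrQsR_mem_klrYAlg (r r' : Fin n) (i : Fin n → ZMod p) : klrQsR k r r' i ∈ klrYAlg k (p := p) (n := n) := by
  have hp := klrPR_mem_klrYAlg k r r' i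
  unfold klrQsR
  split_ifs
  · exact hp
  · exact one_mem _
  · exact add_mem (mul_mem hp hp) hp
  · exact add_mem (one_mem _) hp

/-- `s_r P_r(𝐢) = P_r(s_r𝐢) q_r(s_r𝐢) P_r(𝐢) - p_r(s_r𝐢) P_r(𝐢)`. [folklore] -/
theorem klrSR_mul_klrPsiR {r r' : Fin n} (h : (r' : ℕ) = r + 1) (i : Fin n → ZMod p) :
    klrSR k r r' * klrPsiR k r i =
      klrPsiR k r (i ∘ swap r r') * (klrQR k r r' (i ∘ swap r r') * klrPsiR k r i) -
        klrPR k r r' (i ∘ swap r r') * klrPsiR k r i := by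
  calc klrSR k r r' * klrPsiR k r i
      = klrSR k r r' * (klrIdemR k (i ∘ swap r r') * klrPsiR k r i) := by
        rw [klrIdemR_swap_mul_klrPsiR k h i]
    _ = (klrPsiR k r (i ∘ swap r r') * klrQR k r r' (i ∘ swap r r') -
          klrPR k r r' (i ∘ swap r r') * klrIdemR k (i ∘ swap r r')) * klrPsiR k r i := by
        rw [← mul_assoc, klrSR_mul_klrIdemR]
    _ = _ := by rw [sub_mul, mul_assoc, mul_assoc, klrIdemR_swap_mul_klrPsiR k h i]

/-- **The quadratic relation, `ē(𝐢)`-wise: `s_r² ē(𝐢) = ē(𝐢)`** (BK Thm 3.3, proof of (3.9): the case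
`i_r = i_{r+1}` by `ψ_r²e(𝐢) = 0` and (R5)–(R6), the case `i_r ≠ i_{r+1}` by `klrQuadratic_scalar`).
[folklore] -/
theorem klrSR_sq_mul_klrIdemR {r r' : Fin n} (h : (r' : ℕ) = r + 1) (i : Fin n → ZMod p) :
    klrSR k r r' * klrSR k r r' * klrIdemR k i = klrIdemR k i := by
  set e := klrIdemR k (p := p) i with he
  set P := klrPsiR k r i with hP
  set q := klrQR k r r' i with hq
  set pp := klrPR k r r' i with hpp
  set Y := klrYR k (p := p) (n := n) r with hY
  set Y' := klrYR k (p := p) (n := n) r' with hY'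
  have cppe : pp * e = e * pp := (commute_klrIdemR_klrPR k i r r' i).symm.eq
  -- step 1: `s² e = (s P) q - (s e) p`
  have h1 : klrSR k r r' * klrSR k r r' * e =
      (klrPsiR k r (i ∘ swap r r') * (klrQR k r r' (i ∘ swap r r') * P) -
        klrPR k r r' (i ∘ swap r r') * P) * q - (P * q - pp * e) * pp := by
    rw [mul_assoc, klrSR_mul_klrIdemR, ← hP, ← hq, ← hpp, ← he, mul_sub,
      ← mul_assoc (klrSR k r r') P q, cppe, ← mul_assoc (klrSR k r r') e pp, klrSR_mul_klrPsiR k h,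
      klrSR_mul_klrIdemR, ← hP, ← hq, ← hpp, ← he, ← cppe]
  rw [h1]
  by_cases hc : i r = i r'
  · -- `i_r = i_{r+1}`: `P' = P`, `q' = q = 1 + ȳ' - ȳ`, `p = p' = 1`, `P² = 0`
    have hsw : i ∘ swap r r' = i := comp_swap_eq_self_of_eq hc
    have hpp1 : pp = 1 := by rw [hpp, klrPR, if_pos hc]
    have hq1 : q = 1 + (Y' - Y) := by rw [hq, klrQR, if_pos hc]
    have hPP : P * P = 0 := by
      have := klrPsiR_sq k h i; rwa [hsw, if_pos hc, zero_mul] at this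
    have hPe : P * e = P := klrPsiR_mul_klrIdemR_self k r i
    have hY'P : Y' * P = P * Y + e := by
      have := klrYR_succ_mul_klrPsiR k h i; rwa [if_pos hc] at this
    have hPY' : P * Y' = Y * P + e := by
      have := klrPsiR_mul_klrYR_succ k h i; rwa [if_pos hc] at this
    have hYP : Y * P = P * Y' - e := eq_sub_of_add_eq hPY'.symm
    have hqP : q * P = P * (1 + (Y - Y')) + (e + e) := by
      rw [hq1, add_mul, one_mul, sub_mul, hY'P, hYP, mul_add, mul_one, mul_sub]
      abel
    have hPqP : P * (q * P) = P + P := by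
      rw [hqP, mul_add, ← mul_assoc, hPP, zero_mul, zero_add, mul_add, hPe]
    rw [hsw, ← hP, ← hq, ← hpp, hPqP, hpp1, one_mul, mul_one, one_mul]
    abel
  · -- `i_r ≠ i_{r+1}`
    rw [klrQR_swap_mul_klrPsiR k h hc, klrPR_swap_mul_klrPsiR k h hc, ← hP, ← hpp, ← mul_assoc,
      klrPsiR_sq k h i, if_neg hc, ← he, ← hY, ← hY']
    have hsc := klrQuadratic_scalar k (r := r) (r' := r') (i := i) hc
    rw [← hY, ← hY', ← hq, ← hpp] at hsc
    set Qi := (if i r' = i r + 1 then (if i r = i r' + 1 then (Y' - Y) * (Y - Y') else Y' - Y)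
      else (if i r = i r' + 1 then Y - Y' else 1)) with hQi
    set qs := klrQsR k r r' i with hqs
    have ceqs : e * qs = qs * e := klrIdemR_mul_of_mem_klrYAlg k (klrQsR_mem_klrYAlg k r r' i) i
    have ceq : e * q = q * e := klrIdemR_mul_of_mem_klrYAlg k (klrQR_mem_klrYAlg k r r' i) i
    have hz : ∀ t, Commute pp (klrYR k t) :=
      fun t => (commute_klrPR k (fun u => commute_klrYR k t u) r r' i).symm
    have cqpp : q * pp = pp * q := (commute_klrQR k hz r r' i).eq.symm
    calc (Qi * e * qs - -(P * pp)) * q - (P * q - pp * e) * pp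
        = Qi * (e * qs) * q + P * (pp * q) - P * (q * pp) + pp * (e * pp) := by
          simp only [mul_assoc, sub_mul, sub_neg_eq_add, add_mul]
          abel
      _ = (Qi * qs * q + pp * pp) * e := by
          rw [ceqs, cqpp, ← cppe, add_sub_cancel_right, add_mul,
            show Qi * (qs * e) * q = Qi * qs * q * e by
              rw [← mul_assoc Qi qs e, mul_assoc (Qi * qs) e q, ceq, ← mul_assoc],
            ← mul_assoc pp pp e]
      _ = e := by rw [hsc, one_mul]

/-- **The quadratic relation `s_r² = 1` in `R^{Λ₀}_n`** (BK Thm 3.3, relation (3.9)). [folklore] -/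
theorem klrSR_mul_self {r r' : Fin n} (h : (r' : ℕ) = r + 1) :
    klrSR k r r' * klrSR k r r' = (1 : KLRAlgebra k p n) :=
  klr_eq_of_mul_klrIdemR k fun i => by rw [klrSR_sq_mul_klrIdemR k h, one_mul]

/-! #### The commuting braid relation `s_r s_t = s_t s_r` (`|r - t| > 1`) -/

/-- `p_r(s_t𝐢) = p_r(𝐢)` for `t, t+1 ∉ {r, r+1}`. [folklore] -/
theorem klrPR_comp_swap_of_ne {r r' t t' : Fin n} (h1 : t ≠ r) (h2 : t ≠ r') (h3 : t' ≠ r) (h4 : t' ≠ r')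
    (i : Fin n → ZMod p) : klrPR k r r' (i ∘ swap t t') = klrPR k r r' i := by
  unfold klrPR
  simp only [Function.comp_apply, swap_apply_of_ne_of_ne h1.symm h3.symm,
    swap_apply_of_ne_of_ne h2.symm h4.symm]

/-- `q_r(s_t𝐢) = q_r(𝐢)` for `t, t+1 ∉ {r, r+1}`. [folklore] -/
theorem klrQR_comp_swap_of_ne {r r' t t' : Fin n} (h1 : t ≠ r) (h2 : t ≠ r') (h3 : t' ≠ r) (h4 : t' ≠ r')
    (i : Fin n → ZMod p) : klrQR k r r' (i ∘ swap t t') = klrQR k r r' i := by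
  unfold klrQR
  simp only [klrPR_comp_swap_of_ne k h1 h2 h3 h4, Function.comp_apply,
    swap_apply_of_ne_of_ne h1.symm h3.symm, swap_apply_of_ne_of_ne h2.symm h4.symm]

/-- `P_t(𝐢)` commutes with `z ∈ {p_r(𝐣), q_r(𝐣)}`-type elements built from `ȳ_r, ȳ_{r+1}`
(`t, t+1 ∉ {r, r+1}`): it commutes with `ȳ_r`, `ȳ_{r+1}` and scalars. [folklore] -/
theorem commute_klrPsiR_klrPR_of_far {r r' t t' : Fin n} (ht : (t' : ℕ) = t + 1)
    (h1 : t ≠ r) (h2 : t ≠ r') (h3 : t' ≠ r) (h4 : t' ≠ r') (i j : Fin n → ZMod p) :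
    Commute (klrPsiR k t i) (klrPR k r r' j) := by
  unfold klrPR
  split_ifs with hc
  · exact Commute.one_right _
  · refine commute_ringInverse_of_commute ?_ (isUnit_klrDiffUnitR k r r' (resK_sub_ne_zero k hc))
    have hy : Commute (klrPsiR k t i) (klrYR k r) := klrPsiR_mul_klrYR_of_ne k ht h1.symm h3.symm i
    have hy' : Commute (klrPsiR k t i) (klrYR k r') := klrPsiR_mul_klrYR_of_ne k ht h2.symm h4.symm i
    exact (Algebra.commute_algebraMap_right _ _).add_right (hy.sub_right hy')

/-- As `commute_klrPsiR_klrPR_of_far`, for `q_r(𝐣)`. [folklore] -/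
theorem commute_klrPsiR_klrQR_of_far {r r' t t' : Fin n} (ht : (t' : ℕ) = t + 1)
    (h1 : t ≠ r) (h2 : t ≠ r') (h3 : t' ≠ r) (h4 : t' ≠ r') (i j : Fin n → ZMod p) :
    Commute (klrPsiR k t i) (klrQR k r r' j) := by
  have hp := commute_klrPsiR_klrPR_of_far k ht h1 h2 h3 h4 i j
  have hy : Commute (klrPsiR k t i) (klrYR k r) := klrPsiR_mul_klrYR_of_ne k ht h1.symm h3.symm i
  have hy' : Commute (klrPsiR k t i) (klrYR k r') := klrPsiR_mul_klrYR_of_ne k ht h2.symm h4.symm i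
  unfold klrQR
  split_ifs
  · exact (Commute.one_right _).add_right (hy'.sub_right hy)
  · exact hp.neg_right
  · exact (hp.mul_right hp).sub_right hp
  · exact Commute.one_right _
  · exact (Commute.one_right _).sub_right hp

omit [CharP k p] in
/-- Two elements of `Y''` commute. [folklore] -/
theorem mul_comm_of_mem_klrYAlg {a b : KLRAlgebra k p n} (ha : a ∈ klrYAlg k (p := p) (n := n))
    (hb : b ∈ klrYAlg k (p := p) (n := n)) : a * b = b * a :=
  congrArg Subtype.val
    ((isMulCommutative_klrYAlg k (p := p) (n := n)).is_comm.comm (⟨a, ha⟩ : klrYAlg k (p := p) (n := n))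
      ⟨b, hb⟩)

/-- `s_r P_t(𝐢) = P_r(s_t𝐢) q_r(𝐢) P_t(𝐢) - p_r(𝐢) P_t(𝐢)` for `|r - t| > 1`. [folklore] -/
theorem klrSR_mul_klrPsiR_far {r r' t t' : Fin n} (ht : (t' : ℕ) = t + 1)
    (h1 : t ≠ r) (h2 : t ≠ r') (h3 : t' ≠ r) (h4 : t' ≠ r') (i : Fin n → ZMod p) :
    klrSR k r r' * klrPsiR k t i =
      klrPsiR k r (i ∘ swap t t') * (klrQR k r r' i * klrPsiR k t i) - klrPR k r r' i * klrPsiR k t i := by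
  calc klrSR k r r' * klrPsiR k t i
      = klrSR k r r' * (klrIdemR k (i ∘ swap t t') * klrPsiR k t i) := by
        rw [klrIdemR_swap_mul_klrPsiR k ht i]
    _ = (klrPsiR k r (i ∘ swap t t') * klrQR k r r' (i ∘ swap t t') -
          klrPR k r r' (i ∘ swap t t') * klrIdemR k (i ∘ swap t t')) * klrPsiR k t i := by
        rw [← mul_assoc, klrSR_mul_klrIdemR]
    _ = _ := by
        rw [sub_mul, mul_assoc, mul_assoc, klrIdemR_swap_mul_klrPsiR k ht i,
          klrQR_comp_swap_of_ne k h1 h2 h3 h4, klrPR_comp_swap_of_ne k h1 h2 h3 h4]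

/-- **`s_r s_t ē(𝐢)` in normal form** (`|r - t| > 1`):
`P_r(s_t𝐢)P_t(𝐢) q_r q_t - P_t q_t p_r - P_r q_r p_t + p_r p_t ē`. [folklore] -/
theorem klrSR_mul_klrSR_mul_klrIdemR_of_far {r r' t t' : Fin n}
    (ht : (t' : ℕ) = t + 1) (h1 : t ≠ r) (h2 : t ≠ r') (h3 : t' ≠ r) (h4 : t' ≠ r')
    (i : Fin n → ZMod p) :
    klrSR k r r' * klrSR k t t' * klrIdemR k i =
      klrPsiR k r (i ∘ swap t t') * klrPsiR k t i * (klrQR k r r' i * klrQR k t t' i) -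
        klrPsiR k t i * klrQR k t t' i * klrPR k r r' i - klrPsiR k r i * klrQR k r r' i * klrPR k t t' i +
        klrPR k r r' i * klrPR k t t' i * klrIdemR k i := by
  have cpe : klrPR k t t' i * klrIdemR k i = klrIdemR k i * klrPR k t t' i :=
    (commute_klrIdemR_klrPR k i t t' i).symm.eq
  have cqP : klrQR k r r' i * klrPsiR k t i = klrPsiR k t i * klrQR k r r' i :=
    (commute_klrPsiR_klrQR_of_far k ht h1 h2 h3 h4 i i).symm.eq
  have cpP : klrPR k r r' i * klrPsiR k t i = klrPsiR k t i * klrPR k r r' i :=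
    (commute_klrPsiR_klrPR_of_far k ht h1 h2 h3 h4 i i).symm.eq
  have cpq : klrPR k r r' i * klrQR k t t' i = klrQR k t t' i * klrPR k r r' i :=
    mul_comm_of_mem_klrYAlg k (klrPR_mem_klrYAlg k r r' i) (klrQR_mem_klrYAlg k t t' i)
  rw [mul_assoc, klrSR_mul_klrIdemR, mul_sub, ← mul_assoc (klrSR k r r') (klrPsiR k t i),
    klrSR_mul_klrPsiR_far k ht h1 h2 h3 h4, cpe, ← mul_assoc (klrSR k r r') (klrIdemR k i),
    klrSR_mul_klrIdemR, cqP, cpP]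
  simp only [sub_mul, mul_assoc]
  rw [cpq, ← cpe]
  abel

/-- **The commuting braid relation `s_r s_t = s_t s_r` (`|r - t| > 1`) in `R^{Λ₀}_n`** (BK Thm 3.3,
(3.10), second part). [folklore] -/
theorem klrSR_comm_of_far {r r' t t' : Fin n} (hr : (r' : ℕ) = r + 1) (ht : (t' : ℕ) = t + 1)
    (h1 : t ≠ r) (h2 : t ≠ r') (h3 : t' ≠ r) (h4 : t' ≠ r') :
    klrSR k r r' * klrSR k t t' = klrSR k t t' * klrSR k (p := p) r r' := by
  refine klr_eq_of_mul_klrIdemR k fun i => ?_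
  rw [klrSR_mul_klrSR_mul_klrIdemR_of_far k ht h1 h2 h3 h4,
    klrSR_mul_klrSR_mul_klrIdemR_of_far k hr h1.symm h3.symm h2.symm h4.symm,
    klrPsiR_comm_of_far k hr ht h1 h2 h3 h4,
    mul_comm_of_mem_klrYAlg k (klrQR_mem_klrYAlg k r r' i) (klrQR_mem_klrYAlg k t t' i),
    mul_comm_of_mem_klrYAlg k (klrPR_mem_klrYAlg k r r' i) (klrPR_mem_klrYAlg k t t' i)]
  abel

end HeckeGenerators


/-! ### Towards BK §3.5: the images of the Hecke generators under `σ` -/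

section SigmaImages

variable (k : Type*) [Field k] [DecidableEq k] (p n : ℕ) [Fact p.Prime] [CharP k p]

variable {p n}

omit [DecidableEq k] [Fact p.Prime] [CharP k p] in
/-- An algebra map sends `Ring.inverse` of a unit to `Ring.inverse`. [folklore] -/
theorem map_ringInverse_of_isUnit {A B : Type*} [Ring A] [Ring B] [Algebra k A] [Algebra k B]
    (f : A →ₐ[k] B) {u : A} (hu : IsUnit u) : f (Ring.inverse u) = Ring.inverse (f u) := by
  have h := (Ring.inverse_mul_eq_iff_eq_mul (f u) 1 (f (Ring.inverse u)) (hu.map f)).2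
    (by rw [← map_mul, Ring.mul_inverse_cancel _ hu, map_one])
  rw [mul_one] at h
  exact h.symm

/-- `σ(ē(𝐢)) = e(𝐢)`. [folklore] -/
theorem klrToGroupAlgebra_klrIdemR (i : Fin n → ZMod p) :
    klrToGroupAlgebra k p n (klrIdemR k i) = klrIdempotent k (resCast k p n i) := by
  rw [klrIdemR, klrToGroupAlgebra_mk, klrFreeLift_E]

/-- `σ(ȳ_r) = y_r`. [folklore] -/
theorem klrToGroupAlgebra_klrYR (r : Fin n) : klrToGroupAlgebra k p n (klrYR k r) = bkNilpotent k r := by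
  rw [klrYR, klrToGroupAlgebra_mk, klrFreeLift_Y]

/-- `σ(ψ_r e(𝐢)) = ψ_r e(𝐢)`. [folklore] -/
theorem klrToGroupAlgebra_klrPsiR {r r' : Fin n} (h : (r' : ℕ) = r + 1) (i : Fin n → ZMod p) :
    klrToGroupAlgebra k p n (klrPsiR k r i) = bkPsi k r r' * klrIdempotent k (resCast k p n i) := by
  rw [klrPsiR, klrToGroupAlgebra_mk, klrFreeLift_P k h]

/-- `σ(c + ȳ_r - ȳ_t) = c + y_r - y_t`. [folklore] -/
theorem klrToGroupAlgebra_klrDiffUnitR (r t : Fin n) (c : k) :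
    klrToGroupAlgebra k p n (klrDiffUnitR k r t c) = bkDiffUnit k r t c := by
  rw [klrDiffUnitR, bkDiffUnit, map_add, AlgHom.commutes, map_sub, klrToGroupAlgebra_klrYR,
    klrToGroupAlgebra_klrYR]

/-- `σ(p_r(𝐢)) = p_r(𝐢)`. [folklore] -/
theorem klrToGroupAlgebra_klrPR (r r' : Fin n) (i : Fin n → ZMod p) :
    klrToGroupAlgebra k p n (klrPR k r r' i) = bkP k r r' (resCast k p n i) := by
  unfold klrPR bkP
  by_cases hc : i r = i r'
  · rw [if_pos hc, if_pos ((resCast_apply_eq_iff k i r r').2 hc), map_one]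
  · rw [if_neg hc, if_neg (fun e => hc ((resCast_apply_eq_iff k i r r').1 e)),
      map_ringInverse_of_isUnit k _ (isUnit_klrDiffUnitR k r r' (resK_sub_ne_zero k hc)),
      klrToGroupAlgebra_klrDiffUnitR]
    rfl

/-- `σ(q_r(𝐢)) = q_r(𝐢)`. [folklore] -/
theorem klrToGroupAlgebra_klrQR (r r' : Fin n) (i : Fin n → ZMod p) :
    klrToGroupAlgebra k p n (klrQR k r r' i) = bkQ k r r' (resCast k p n i) := by
  unfold klrQR bkQ
  simp only [resCast_apply_eq_iff, resCast_succ_iff, apply_ite (klrToGroupAlgebra k p n), map_one,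
    map_add, map_sub, map_neg, map_mul, klrToGroupAlgebra_klrPR, klrToGroupAlgebra_klrYR]

/-- **`σ(s_r) = s_r`**: in `k[S_n]`, `s_r e(𝐢) = ψ_r e(𝐢) q_r(𝐢) - p_r(𝐢) e(𝐢)` (BK (3.27), (3.32)).
[folklore] -/
theorem klrToGroupAlgebra_klrSR {r r' : Fin n} (h : (r' : ℕ) = r + 1) :
    klrToGroupAlgebra k p n (klrSR k r r') = MonoidAlgebra.of k _ (swap r r') := by
  rw [klrSR, map_sum]
  rw [← mul_one (MonoidAlgebra.of k _ (swap r r')), ← sum_klrIdempotent_resCast k (p := p) (n := n),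
    Finset.mul_sum]
  refine Finset.sum_congr rfl fun i _ => ?_
  rw [map_sub, map_mul, map_mul, klrToGroupAlgebra_klrPsiR k h, klrToGroupAlgebra_klrQR,
    klrToGroupAlgebra_klrPR, klrToGroupAlgebra_klrIdemR]
  set χ := resCast k p n i
  -- `ψ e Q = φ Q⁻¹ e Q = φ e` and `φ e = (s + p) e`
  have hφ := bkPhi_mul_klrIdempotent_eq_swap_add_bkP k r r' χ
  have hψ := bkPsi_mul_klrIdempotent k r r' χ
  have ceQ : klrIdempotent k χ * bkQ k r r' χ = bkQ k r r' χ * klrIdempotent k χ :=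
    (commute_bkQ k (fun t => commute_klrIdempotent_bkNilpotent k χ t) r r' χ).eq
  rw [hψ, mul_assoc, ceQ, ← mul_assoc, mul_assoc (bkPhi k r r'),
    Ring.inverse_mul_cancel _ (isUnit_bkQ k r r' χ), mul_one, hφ, add_mul, add_sub_cancel_right]

/-- **`σ(x_r) = L_r`** (the Jucys–Murphy element): `L_r e(𝐢) = (y_r + i_r) e(𝐢)`. [folklore] -/
theorem klrToGroupAlgebra_klrXR (r : Fin n) : klrToGroupAlgebra k p n (klrXR k r) = jucysMurphy k r := by
  rw [klrXR, map_sum, ← mul_one (jucysMurphy k r), ← sum_klrIdempotent_resCast k (p := p) (n := n),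
    Finset.mul_sum]
  refine Finset.sum_congr rfl fun i _ => ?_
  rw [map_mul, map_add, klrToGroupAlgebra_klrYR, AlgHom.commutes, klrToGroupAlgebra_klrIdemR, add_mul,
    bkNilpotent_mul_klrIdempotent, Algebra.algebraMap_eq_smul_one, smul_mul_assoc, one_mul]
  show jucysMurphy k r * klrIdempotent k (resCast k p n i) - resK k (i r) • klrIdempotent k _ +
    resK k (i r) • klrIdempotent k _ = _
  rw [sub_add_cancel]

/-- **`σ : R^{Λ₀}_n → k[S_n]` is surjective** — unconditionally: its image is a subalgebra containing
the Coxeter generators `s_r = σ(s_r)`. [folklore] -/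
theorem klrToGroupAlgebra_surjective' : Function.Surjective (klrToGroupAlgebra k p n) := by
  -- every `of g` is in the range
  have hof : ∀ g : Perm (Fin n), MonoidAlgebra.of k _ g ∈ (klrToGroupAlgebra k p n).range := by
    intro g
    cases n with
    | zero => rw [Subsingleton.elim g 1, map_one]; exact Subalgebra.one_mem _
    | succ m =>
      have hg : g ∈ Submonoid.closure (Set.range fun i : Fin m => swap i.castSucc i.succ) := by
        rw [Equiv.Perm.mclosure_swap_castSucc_succ m]; exact Submonoid.mem_top g
      induction hg using Submonoid.closure_induction with
      | one => rw [map_one]; exact Subalgebra.one_mem _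
      | mul x y _ _ hx hy => rw [map_mul]; exact Subalgebra.mul_mem _ hx hy
      | mem x hx =>
        obtain ⟨i, rfl⟩ := hx
        exact ⟨klrSR k i.castSucc i.succ, klrToGroupAlgebra_klrSR k (by simp)⟩
  intro x
  induction x using MonoidAlgebra.induction_on with
  | hM g => exact hof g
  | hadd x y hx hy =>
    obtain ⟨a, rfl⟩ := hx; obtain ⟨b, rfl⟩ := hy
    exact ⟨a + b, map_add _ _ _⟩
  | hsmul c x hx =>
    obtain ⟨a, rfl⟩ := hx
    exact ⟨c • a, map_smul _ _ _⟩

end SigmaImages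


/-! ### BK §3.5, first half: the inverse map `ρ : k[S_n] → R^{Λ₀}_n` (given the braid relation) -/

section Rho

variable (k : Type*) [Field k] [DecidableEq k] (p n : ℕ) [Fact p.Prime] [CharP k p]

variable {p n}

/-- BK's `s_m ∈ R^{Λ₀}_n` as a sequence indexed by `ℕ` (`1` out of range). [folklore] -/
def klrSRseq (m : ℕ) : KLRAlgebra k p n :=
  if h : m + 1 < n then klrSR k (⟨m, by omega⟩ : Fin n) ⟨m + 1, h⟩ else 1

omit [DecidableEq k] in
/-- `klrSRseq m = s_m` in range. [folklore] -/
theorem klrSRseq_of_lt {m : ℕ} (h : m + 1 < n) :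
    klrSRseq k (p := p) m = klrSR k (⟨m, by omega⟩ : Fin n) ⟨m + 1, h⟩ := dif_pos h

omit [DecidableEq k] in
/-- `klrSRseq r = s_r` for `Fin`-indices. [folklore] -/
theorem klrSRseq_eq {r r' : Fin n} (h : (r' : ℕ) = r + 1) : klrSRseq k (p := p) (n := n) r = klrSR k r r' := by
  have hlt : (r : ℕ) + 1 < n := h ▸ r'.2
  rw [klrSRseq_of_lt k hlt]
  congr 1
  exact Fin.ext h.symm

omit [DecidableEq k] in
/-- **BK's `s_r` satisfy the Coxeter relations of type `A_{n-1}`, given the length-three braid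
relation** (BK Thm 3.3 (3.9)–(3.10): `s_r² = 1` and `s_rs_t = s_ts_r` are `klrSR_mul_self`,
`klrSR_comm_of_far`; the braid relation is taken as the hypothesis `hbraid`). [folklore] -/
theorem isCoxeterDataA_klrSRseq
    (hbraid : ∀ (r r' r'' : Fin n), ((r' : ℕ) = r + 1) → ((r'' : ℕ) = r' + 1) →
      klrSR k r r' * klrSR k r' r'' * klrSR k r r' = klrSR k r' r'' * klrSR k r r' * klrSR k (p := p) r' r'') :
    IsCoxeterDataA n (klrSRseq k (p := p) (n := n)) where
  sq m hm := by rw [klrSRseq_of_lt k hm]; exact klrSR_mul_self k rfl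
  braid m hm := by
    rw [klrSRseq_of_lt k (by omega : m + 1 < n), klrSRseq_of_lt k hm]
    exact hbraid ⟨m, by omega⟩ ⟨m + 1, by omega⟩ ⟨m + 2, hm⟩ rfl rfl
  comm m t ht hmt := by
    rw [klrSRseq_of_lt k (by omega : m + 1 < n), klrSRseq_of_lt k ht]
    refine klrSR_comm_of_far k rfl rfl ?_ ?_ ?_ ?_ <;> simp [Fin.ext_iff] <;> omega

/-- **BK's `ρ : k[S_n] → R^{Λ₀}_n`**, `s_r ↦ s_r` (arXiv:0808.2032 §3.5; through the Coxeter presentation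
of `S_n`, `permFinLift`), given the braid relation. [folklore] -/
noncomputable def klrRho
    (hbraid : ∀ (r r' r'' : Fin n), ((r' : ℕ) = r + 1) → ((r'' : ℕ) = r' + 1) →
      klrSR k r r' * klrSR k r' r'' * klrSR k r r' = klrSR k r' r'' * klrSR k r r' * klrSR k (p := p) r' r'') :
    MonoidAlgebra k (Perm (Fin n)) →ₐ[k] KLRAlgebra k p n :=
  MonoidAlgebra.lift k (KLRAlgebra k p n) (Perm (Fin n)) (permFinLift (isCoxeterDataA_klrSRseq k hbraid))

variable {k}

omit [DecidableEq k] in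
/-- `ρ` on group elements. [folklore] -/
theorem klrRho_of
    (hbraid : ∀ (r r' r'' : Fin n), ((r' : ℕ) = r + 1) → ((r'' : ℕ) = r' + 1) →
      klrSR k r r' * klrSR k r' r'' * klrSR k r r' = klrSR k r' r'' * klrSR k r r' * klrSR k (p := p) r' r'')
    (g : Perm (Fin n)) :
    klrRho k hbraid (MonoidAlgebra.of k _ g) = permFinLift (isCoxeterDataA_klrSRseq k hbraid) g :=
  MonoidAlgebra.lift_of _ _

omit [DecidableEq k] in
/-- **`ρ(s_r) = s_r`.** [folklore] -/
theorem klrRho_of_swap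
    (hbraid : ∀ (r r' r'' : Fin n), ((r' : ℕ) = r + 1) → ((r'' : ℕ) = r' + 1) →
      klrSR k r r' * klrSR k r' r'' * klrSR k r r' = klrSR k r' r'' * klrSR k r r' * klrSR k (p := p) r' r'')
    {r r' : Fin n} (h : (r' : ℕ) = r + 1) :
    klrRho k hbraid (MonoidAlgebra.of k _ (swap r r')) = klrSR k r r' := by
  rw [klrRho_of, permFinLift_swap _ h, klrSRseq_eq k h]

variable (k)

/-- **`σ ∘ ρ = id` on `k[S_n]`** (BK §3.5, Lemma 3.5, first half: `σ(ρ(s_r)) = σ(s_r) = s_r`);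
in particular `σ` is surjective and `ρ` injective. [folklore] -/
theorem klrToGroupAlgebra_comp_klrRho
    (hbraid : ∀ (r r' r'' : Fin n), ((r' : ℕ) = r + 1) → ((r'' : ℕ) = r' + 1) →
      klrSR k r r' * klrSR k r' r'' * klrSR k r r' = klrSR k r' r'' * klrSR k r r' * klrSR k (p := p) r' r'') :
    (klrToGroupAlgebra k p n).comp (klrRho k hbraid) = AlgHom.id k (MonoidAlgebra k (Perm (Fin n))) := by
  refine MonoidAlgebra.algHom_ext (fun g => ?_) (Subsingleton.elim _ _)
  rw [AlgHom.comp_apply, AlgHom.id_apply]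
  -- reduce to the Coxeter generators
  suffices H : ((klrToGroupAlgebra k p n).comp (klrRho k hbraid) : MonoidAlgebra k (Perm (Fin n)) →*
      MonoidAlgebra k (Perm (Fin n))).comp (MonoidAlgebra.of k (Perm (Fin n))) =
      MonoidAlgebra.of k (Perm (Fin n)) from DFunLike.congr_fun H g
  refine permFin_hom_ext fun m hm => ?_
  rw [MonoidHom.comp_apply, MonoidHom.coe_coe, AlgHom.comp_apply, adjSwap_of_lt hm,
    klrRho_of_swap hbraid rfl, klrToGroupAlgebra_klrSR k rfl]

/-- **`σ : R^{Λ₀}_n → k[S_n]` is surjective** (given the braid relation). [folklore] -/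
theorem klrToGroupAlgebra_surjective
    (hbraid : ∀ (r r' r'' : Fin n), ((r' : ℕ) = r + 1) → ((r'' : ℕ) = r' + 1) →
      klrSR k r r' * klrSR k r' r'' * klrSR k r r' = klrSR k r' r'' * klrSR k r r' * klrSR k (p := p) r' r'') :
    Function.Surjective (klrToGroupAlgebra k p n) := fun x =>
  ⟨klrRho k hbraid x, by
    have := DFunLike.congr_fun (klrToGroupAlgebra_comp_klrRho k hbraid) x
    rwa [AlgHom.comp_apply, AlgHom.id_apply] at this⟩

/-! #### `ρ ∘ σ = id` -/

section RhoSigma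

-- common hypothesis, spelled out in each statement (no new named `Prop`s)
variable (hbraid : ∀ (r r' r'' : Fin n), ((r' : ℕ) = r + 1) → ((r'' : ℕ) = r' + 1) →
  klrSR k r r' * klrSR k r' r'' * klrSR k r r' = klrSR k r' r'' * klrSR k r r' * klrSR k (p := p) r' r'')

omit [DecidableEq k] in
/-- `x_0 = 0` (level one). [folklore] -/
theorem klrXR_eq_zero_of_val_eq_zero {r : Fin n} (hr : (r : ℕ) = 0) : klrXR k (p := p) (n := n) r = 0 := by
  rw [klrXR]
  refine Finset.sum_eq_zero fun i _ => ?_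
  rw [klrYR_eq_zero_of_val_eq_zero k hr, zero_add]
  by_cases h0 : i r = 0
  · rw [h0, show resK k (0 : ZMod p) = 0 from map_zero _, map_zero, zero_mul]
  · rw [klrIdemR_eq_zero k hr h0, mul_zero]

omit [DecidableEq k] in
/-- **`x_{r+1} = s_r x_r s_r + s_r`** from the mixed and quadratic relations. [folklore] -/
theorem klrXR_succ {r r' : Fin n} (h : (r' : ℕ) = r + 1) :
    klrXR k (p := p) (n := n) r' = klrSR k r r' * klrXR k r * klrSR k r r' + klrSR k r r' := by
  have hmix := klrSR_mul_klrXR_succ_sub k (p := p) h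
  have hsq := klrSR_mul_self k (p := p) h
  have e1 : klrSR k r r' * klrXR k r' = klrXR k r * klrSR k r r' + 1 := sub_eq_iff_eq_add'.1 hmix
  calc klrXR k r' = klrSR k r r' * klrSR k r r' * klrXR k r' := by rw [hsq, one_mul]
    _ = klrSR k r r' * (klrXR k r * klrSR k r r' + 1) := by rw [mul_assoc, e1]
    _ = _ := by rw [mul_add, mul_one, mul_assoc]

omit [DecidableEq k] in
include hbraid in
/-- **`ρ(L_r) = x_r`** (`L_r` the Jucys–Murphy element): both satisfy `X_{r+1} = s_rX_rs_r + s_r`,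
`X_0 = 0`. [folklore] -/
theorem klrRho_jucysMurphy (r : Fin n) : klrRho k hbraid (jucysMurphy k r) = klrXR k r := by
  suffices H : ∀ m : ℕ, ∀ hm : m < n, klrRho k hbraid (jucysMurphy k ⟨m, hm⟩) = klrXR k ⟨m, hm⟩ from H r r.2
  intro m
  induction m with
  | zero =>
    intro hm
    rw [jucysMurphy_eq_zero k rfl, map_zero, klrXR_eq_zero_of_val_eq_zero k rfl]
  | succ m ih =>
    intro hm
    have h01 : (((⟨m + 1, hm⟩ : Fin n) : ℕ)) = ((⟨m, by omega⟩ : Fin n) : ℕ) + 1 := rfl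
    rw [jucysMurphy_succ k h01, map_add, map_mul, map_mul, klrRho_of_swap hbraid h01, ih (by omega),
      klrXR_succ k h01]

omit [DecidableEq k] [Fact p.Prime] [CharP k p] in
/-- Generalized eigenvectors, ring form: `v ∈ M_𝐢 ⇒ (L_r - i_r)^N v = 0` for some `N`. [folklore] -/
theorem exists_pow_mul_eq_zero_of_mem_jointEigenspace {χ : Fin n → k} {v : MonoidAlgebra k (Perm (Fin n))}
    (hv : v ∈ jointEigenspace k χ) (r : Fin n) :
    ∃ N : ℕ, (jucysMurphy k r - algebraMap k _ (χ r)) ^ N * v = 0 := by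
  obtain ⟨N, hN⟩ := (mem_jointEigenspace_iff k χ v).1 hv r
  refine ⟨N, ?_⟩
  have hop : LinearMap.mulLeft k (jucysMurphy k r) - χ r • (1 : Module.End k (MonoidAlgebra k (Perm (Fin n)))) =
      LinearMap.mulLeft k (jucysMurphy k r - algebraMap k _ (χ r)) := by
    ext w
    simp [LinearMap.mulLeft_apply, sub_mul, Algebra.algebraMap_eq_smul_one]
  rw [hop, LinearMap.pow_mulLeft, LinearMap.mulLeft_apply] at hN
  exact hN

omit [DecidableEq k] in
/-- `(x_r - i_r)^m ē(𝐣) = (j_r - i_r + ȳ_r)^m ē(𝐣)`. [folklore] -/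
theorem klrXR_sub_pow_mul_klrIdemR (r : Fin n) (i j : Fin n → ZMod p) (m : ℕ) :
    (klrXR k r - algebraMap k _ (resK k (i r))) ^ m * klrIdemR k j =
      (algebraMap k (KLRAlgebra k p n) (resK k (j r) - resK k (i r)) + klrYR k r) ^ m * klrIdemR k j := by
  set u := algebraMap k (KLRAlgebra k p n) (resK k (j r) - resK k (i r)) + klrYR k r
  have ceu : klrIdemR k j * u = u * klrIdemR k j :=
    ((Algebra.commute_algebraMap_right _ _).add_right (commute_klrYR_klrIdemR k r j).symm).eq
  have cex : klrIdemR k j * (klrXR k r - algebraMap k _ (resK k (i r))) =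
      (klrXR k r - algebraMap k _ (resK k (i r))) * klrIdemR k j :=
    ((commute_klrIdemR_klrXR k j r).sub_right (Algebra.commute_algebraMap_right _ _)).eq
  have h1 : (klrXR k r - algebraMap k _ (resK k (i r))) * klrIdemR k j = u * klrIdemR k j := by
    rw [sub_mul, klrXR_mul_klrIdemR]
    show _ = (algebraMap k (KLRAlgebra k p n) (resK k (j r) - resK k (i r)) + klrYR k r) * klrIdemR k j
    rw [map_sub, add_mul, add_mul, sub_mul]
    abel
  induction m with
  | zero => rw [pow_zero, pow_zero]
  | succ m ih =>
    rw [pow_succ, mul_assoc, h1, ← ceu, ← mul_assoc, ih, mul_assoc, ceu, ← mul_assoc, ← pow_succ]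

include hbraid in
/-- **`ρ(e(𝐢)) = ē(𝐢)`** (BK Lemma 3.4-style weight argument: `ρ(e(𝐢))` is killed by powers of the
`x_r - i_r`, which act invertibly on `ē(𝐣)R` for `𝐣 ≠ 𝐢`). [folklore] -/
theorem klrRho_klrIdempotent (i : Fin n → ZMod p) :
    klrRho k hbraid (klrIdempotent k (resCast k p n i)) = klrIdemR k i := by
  -- `ē(𝐣) ρ(e(𝐢)) = 0` for `𝐣 ≠ 𝐢`
  have hkill : ∀ i j : Fin n → ZMod p, j ≠ i →
      klrIdemR k j * klrRho k hbraid (klrIdempotent k (resCast k p n i)) = 0 := by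
    intro i j hji
    obtain ⟨r, hr⟩ := Function.ne_iff.1 hji
    obtain ⟨N, hN⟩ := exists_pow_mul_eq_zero_of_mem_jointEigenspace k
      (klrIdempotent_mem k (resCast k p n i)) r
    have hρ := congrArg (klrRho k hbraid) hN
    rw [map_mul, map_pow, map_sub, klrRho_jucysMurphy k hbraid, AlgHom.commutes, map_zero] at hρ
    -- multiply by `ē(𝐣)` on the left
    have h2 := congrArg (klrIdemR k j * ·) hρ
    simp only [mul_zero] at h2
    rw [← mul_assoc, show klrIdemR k j * (klrXR k r - algebraMap k _ (resCast k p n i r)) ^ N =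
        (klrXR k r - algebraMap k _ (resK k (i r))) ^ N * klrIdemR k j from
          (((commute_klrIdemR_klrXR k j r).sub_right (Algebra.commute_algebraMap_right _ _)).pow_right N).eq,
      klrXR_sub_pow_mul_klrIdemR, mul_assoc] at h2
    have hu : IsUnit ((algebraMap k (KLRAlgebra k p n) (resK k (j r) - resK k (i r)) + klrYR k r) ^ N) :=
      IsUnit.pow N ((isNilpotent_klrYR k (p := p) r).isUnit_add_left_of_commute
        ((IsUnit.mk0 (resK k (j r) - resK k (i r))
          (sub_ne_zero.2 fun e => hr ((ZMod.castHom (dvd_refl p) k).injective e))).map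
          (algebraMap k (KLRAlgebra k p n)))
        (Algebra.commute_algebraMap_right _ _))
    exact (hu.mul_right_eq_zero).1 h2
  -- `∑_𝐣 ρ(e(𝐣)) = 1`
  have hsum : ∑ j : Fin n → ZMod p, klrRho k hbraid (klrIdempotent k (resCast k p n j)) = 1 := by
    rw [← map_sum, sum_klrIdempotent_resCast, map_one]
  -- `ρ(e(𝐢)) = ē(𝐢) ρ(e(𝐢))`
  have hfix : ∀ i, klrRho k hbraid (klrIdempotent k (resCast k p n i)) =
      klrIdemR k i * klrRho k hbraid (klrIdempotent k (resCast k p n i)) := by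
    intro i
    conv_lhs => rw [← one_mul (klrRho k hbraid _), ← sum_klrIdemR k, Finset.sum_mul]
    rw [Finset.sum_eq_single_of_mem i (Finset.mem_univ i)]
    intro j _ hji
    exact hkill i j hji
  calc klrRho k hbraid (klrIdempotent k (resCast k p n i))
      = klrIdemR k i * klrRho k hbraid (klrIdempotent k (resCast k p n i)) := hfix i
    _ = ∑ j : Fin n → ZMod p, klrIdemR k i * klrRho k hbraid (klrIdempotent k (resCast k p n j)) := by
        rw [Finset.sum_eq_single_of_mem i (Finset.mem_univ i)]
        intro j _ hji
        rw [hfix j, ← mul_assoc, klrIdemR_mul_klrIdemR, if_neg (Ne.symm hji), zero_mul]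
    _ = klrIdemR k i := by rw [← Finset.mul_sum, hsum, mul_one]

include hbraid in
/-- **`ρ(y_r) = ȳ_r`.** [folklore] -/
theorem klrRho_bkNilpotent (r : Fin n) : klrRho k hbraid (bkNilpotent k r) = klrYR k r := by
  rw [← mul_one (bkNilpotent k r), ← sum_klrIdempotent_resCast k (p := p) (n := n), Finset.mul_sum, map_sum]
  refine (Finset.sum_congr rfl fun i _ => ?_).trans (by rw [← Finset.mul_sum, sum_klrIdemR, mul_one] :
    ∑ i : Fin n → ZMod p, klrYR k r * klrIdemR k i = klrYR k r)
  rw [bkNilpotent_mul_klrIdempotent, map_sub, map_smul, map_mul, klrRho_jucysMurphy k hbraid,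
    klrRho_klrIdempotent k hbraid, klrXR_mul_klrIdemR, add_mul, Algebra.algebraMap_eq_smul_one, smul_mul_assoc,
    one_mul]
  exact add_sub_cancel_right _ _

include hbraid in
/-- `ρ(c + y_r - y_t) = c + ȳ_r - ȳ_t`. [folklore] -/
theorem klrRho_bkDiffUnit (r t : Fin n) (c : k) : klrRho k hbraid (bkDiffUnit k r t c) = klrDiffUnitR k r t c := by
  rw [bkDiffUnit, klrDiffUnitR, map_add, AlgHom.commutes, map_sub, klrRho_bkNilpotent k hbraid,
    klrRho_bkNilpotent k hbraid]

include hbraid in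
/-- `ρ(p_r(𝐢)) = p_r(𝐢)`. [folklore] -/
theorem klrRho_bkP (r r' : Fin n) (i : Fin n → ZMod p) :
    klrRho k hbraid (bkP k r r' (resCast k p n i)) = klrPR k r r' i := by
  unfold klrPR bkP
  by_cases hc : i r = i r'
  · rw [if_pos hc, if_pos ((resCast_apply_eq_iff k i r r').2 hc), map_one]
  · rw [if_neg hc, if_neg (fun e => hc ((resCast_apply_eq_iff k i r r').1 e)),
      map_ringInverse_of_isUnit k _ (isUnit_bkDiffUnit k r r' (sub_ne_zero.2
        (fun e => hc ((resCast_apply_eq_iff k i r r').1 e)))),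
      klrRho_bkDiffUnit k hbraid]
    rfl

include hbraid in
/-- `ρ(q_r(𝐢)) = q_r(𝐢)`. [folklore] -/
theorem klrRho_bkQ (r r' : Fin n) (i : Fin n → ZMod p) :
    klrRho k hbraid (bkQ k r r' (resCast k p n i)) = klrQR k r r' i := by
  unfold klrQR bkQ
  simp only [resCast_apply_eq_iff, resCast_succ_iff, apply_ite (klrRho k hbraid), map_one, map_add, map_sub,
    map_neg, map_mul, klrRho_bkP k hbraid, klrRho_bkNilpotent k hbraid]

include hbraid in
/-- **`ρ(ψ_r e(𝐢)) = ψ_r e(𝐢)`**: `ψ_r e(𝐢) = (s_r + p_r(𝐢)) e(𝐢) q_r(𝐢)^{-1}` in `k[S_n]` and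
`(s_r + p_r(𝐢)) ē(𝐢) = P_r(𝐢) q_r(𝐢)` in `R^{Λ₀}_n`. [folklore] -/
theorem klrRho_bkPsi_mul_klrIdempotent {r r' : Fin n} (h : (r' : ℕ) = r + 1) (i : Fin n → ZMod p) :
    klrRho k hbraid (bkPsi k r r' * klrIdempotent k (resCast k p n i)) = klrPsiR k r i := by
  set χ := resCast k p n i
  have ceQ : klrIdempotent k χ * Ring.inverse (bkQ k r r' χ) = Ring.inverse (bkQ k r r' χ) * klrIdempotent k χ :=
    (commute_ringInverse_of_commute (commute_bkQ k (fun t => commute_klrIdempotent_bkNilpotent k χ t) r r' χ)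
      (isUnit_bkQ k r r' χ)).eq
  rw [bkPsi_mul_klrIdempotent, mul_assoc, ← ceQ, ← mul_assoc, bkPhi_mul_klrIdempotent_eq_swap_add_bkP,
    map_mul, map_mul, map_add, klrRho_of_swap hbraid h, klrRho_bkP k hbraid, klrRho_klrIdempotent k hbraid,
    map_ringInverse_of_isUnit k _ (isUnit_bkQ k r r' χ), klrRho_bkQ k hbraid, add_mul, klrSR_mul_klrIdemR,
    sub_add_cancel, mul_assoc, Ring.mul_inverse_cancel _ (isUnit_klrQR k r r' i), mul_one]

include hbraid in
/-- **`ρ ∘ σ = id` on `R^{Λ₀}_n`** (BK §3.5, Lemma 3.5, second half: checked on the generators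
`ē(𝐢)`, `ȳ_r`, `ψ_r e(𝐢)`). [folklore] -/
theorem klrRho_comp_klrToGroupAlgebra :
    (klrRho k hbraid).comp (klrToGroupAlgebra k p n) = AlgHom.id k (KLRAlgebra k p n) := by
  refine RingQuot.ringQuot_ext' k _ _ (FreeAlgebra.hom_ext (funext fun x => ?_))
  simp only [Function.comp_apply, AlgHom.coe_comp, AlgHom.coe_id, id_eq]
  change klrRho k hbraid (klrToGroupAlgebra k p n (klrMk k p n (FreeAlgebra.ι k x))) = klrMk k p n (FreeAlgebra.ι k x)
  rw [klrToGroupAlgebra_mk]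
  cases x with
  | idem i => exact (congrArg _ (klrFreeLift_E k i)).trans (klrRho_klrIdempotent k hbraid i)
  | y r => exact (congrArg _ (klrFreeLift_Y k r)).trans (klrRho_bkNilpotent k hbraid r)
  | psi r i =>
    change klrRho k hbraid (klrFreeLift k (klrP k r i)) = klrPsiR k r i
    by_cases hr : (r : ℕ) + 1 < n
    · have h : (((⟨(r : ℕ) + 1, hr⟩ : Fin n) : ℕ)) = r + 1 := rfl
      rw [klrFreeLift_P k h, klrRho_bkPsi_mul_klrIdempotent k hbraid h]
    · rw [klrFreeLift_P_last k (not_lt.1 hr), map_zero, klrPsiR_last k (not_lt.1 hr)]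

include hbraid in
/-- **`σ : R^{Λ₀}_n → k[S_n]` is injective** (given the braid relation). [folklore] -/
theorem klrToGroupAlgebra_injective : Function.Injective (klrToGroupAlgebra k p n) := by
  intro x y hxy
  have := DFunLike.congr_fun (klrRho_comp_klrToGroupAlgebra k hbraid)
  have hx := this x
  have hy := this y
  simp only [AlgHom.comp_apply, AlgHom.id_apply] at hx hy
  rw [← hx, ← hy, hxy]

/-- **Brundan–Kleshchev's isomorphism `R^{Λ₀}_n ≅ k[S_n]` (Main Theorem / §3.5, level one,
degenerate), given the braid relation of Thm 3.3.** [folklore] -/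
noncomputable def klrAlgEquivOfBraid : KLRAlgebra k p n ≃ₐ[k] MonoidAlgebra k (Perm (Fin n)) :=
  AlgEquiv.ofAlgHom (klrToGroupAlgebra k p n) (klrRho k hbraid) (klrToGroupAlgebra_comp_klrRho k hbraid)
    (klrRho_comp_klrToGroupAlgebra k hbraid)

end RhoSigma

end Rho


/-! ### Preparations for the braid relation of BK Thm 3.3: exchange rules through `ψ_r e(𝐢)`

Brundan–Kleshchev's rule (2.9) `f ψ_r e(𝐢) = ψ_r ({}^{s_r}f) e(𝐢) + δ_{i_ri_{r+1}} ∂_r(f) e(𝐢)` for the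
scalars `f` that actually occur (the `ȳ`'s, the difference units `c + ȳ_a - ȳ_b` and their
inverses), in the idempotented form `f P_r(𝐢) = P_r(𝐢) f' + d ē(𝐢)`. -/

section Exchange

variable (k : Type*) [Field k] (p n : ℕ) [Fact p.Prime] [CharP k p]

variable {p n}

omit [Fact p.Prime] [CharP k p] in
/-- **Inverting an exchange rule**: `uP = Pv + D` with `u, v` units gives
`u^{-1}P = Pv^{-1} - u^{-1}Dv^{-1}`. [folklore] -/
theorem ringInverse_mul_of_rule {A : Type*} [Ring A] {u v P D : A} (h : u * P = P * v + D)
    (hu : IsUnit u) (hv : IsUnit v) :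
    Ring.inverse u * P = P * Ring.inverse v - Ring.inverse u * D * Ring.inverse v := by
  have h1 : P = Ring.inverse u * P * v + Ring.inverse u * D := by
    rw [mul_assoc, ← mul_add, ← h, ← mul_assoc, Ring.inverse_mul_cancel _ hu, one_mul]
  have h2 : P * Ring.inverse v = Ring.inverse u * P + Ring.inverse u * D * Ring.inverse v := by
    conv_lhs => rw [h1]
    rw [add_mul, mul_assoc (Ring.inverse u * P), Ring.mul_inverse_cancel _ hv, mul_one]
  rw [h2]; abel

omit [Fact p.Prime] [CharP k p] in
/-- Exchange rules compose under products. [folklore] -/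
theorem rule_mul {A : Type*} [Ring A] {P f f' Df g g' Dg : A} (hf : f * P = P * f' + Df)
    (hg : g * P = P * g' + Dg) : f * g * P = P * (f' * g') + (Df * g' + f * Dg) := by
  rw [mul_assoc, hg, mul_add, ← mul_assoc, hf, add_mul, mul_assoc]
  abel

omit [Fact p.Prime] [CharP k p] in
/-- Exchange rules compose under sums. [folklore] -/
theorem rule_add {A : Type*} [Ring A] {P f f' Df g g' Dg : A} (hf : f * P = P * f' + Df)
    (hg : g * P = P * g' + Dg) : (f + g) * P = P * (f' + g') + (Df + Dg) := by
  rw [add_mul, hf, hg, mul_add]; abel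

omit [Fact p.Prime] [CharP k p] in
/-- Exchange rules compose under differences. [folklore] -/
theorem rule_sub {A : Type*} [Ring A] {P f f' Df g g' Dg : A} (hf : f * P = P * f' + Df)
    (hg : g * P = P * g' + Dg) : (f - g) * P = P * (f' - g') + (Df - Dg) := by
  rw [sub_mul, hf, hg, mul_sub]; abel

omit [Fact p.Prime] [CharP k p] in
/-- Exchange rules: negation. [folklore] -/
theorem rule_neg {A : Type*} [Ring A] {P f f' Df : A} (hf : f * P = P * f' + Df) :
    -f * P = P * (-f') + -Df := by
  rw [neg_mul, hf, mul_neg]; abel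

omit [Fact p.Prime] [CharP k p] in
/-- The trivial exchange rule of `1`. [folklore] -/
theorem rule_one {A : Type*} [Ring A] (P : A) : 1 * P = P * 1 + 0 := by rw [one_mul, mul_one, add_zero]

omit [Fact p.Prime] [CharP k p] in
/-- The trivial exchange rule of a scalar. [folklore] -/
theorem rule_algebraMap {K A : Type*} [CommSemiring K] [Ring A] [Algebra K A] (P : A) (c : K) :
    algebraMap K A c * P = P * algebraMap K A c + 0 := by rw [Algebra.commutes, add_zero]

/-- The `∂`-datum of `ȳ_t` through `P_r(𝐢)`: `δ_{i_ri_{r+1}} ∂_r(y_t) ē(𝐢)` with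
`∂_r(y_{r+1}) = 1`, `∂_r(y_r) = -1`, `∂_r(y_t) = 0` otherwise. [folklore] -/
def klrDelta (r r' : Fin n) (i : Fin n → ZMod p) (t : Fin n) : KLRAlgebra k p n :=
  if t = r' then (if i r = i r' then klrIdemR k i else 0)
  else if t = r then -(if i r = i r' then klrIdemR k i else 0) else 0

omit [CharP k p] in
/-- `klrDelta` vanishes at idempotents with `i_r ≠ i_{r+1}`. [folklore] -/
@[simp] theorem klrDelta_of_ne {r r' : Fin n} {i : Fin n → ZMod p} (hc : i r ≠ i r') (t : Fin n) :
    klrDelta k r r' i t = 0 := by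
  unfold klrDelta; simp [hc]

omit [CharP k p] in
/-- `klrDelta` at `t = r+1` (equal case). [folklore] -/
theorem klrDelta_right {r r' : Fin n} {i : Fin n → ZMod p} (hc : i r = i r') :
    klrDelta k r r' i r' = klrIdemR k i := by
  unfold klrDelta; rw [if_pos rfl, if_pos hc]

omit [CharP k p] in
/-- `klrDelta` at `t = r` (equal case). [folklore] -/
theorem klrDelta_left {r r' : Fin n} (h : (r' : ℕ) = r + 1) {i : Fin n → ZMod p} (hc : i r = i r') :
    klrDelta k r r' i r = -klrIdemR k i := by
  have hrr' : r ≠ r' := by intro e; rw [Fin.ext_iff] at e; omega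
  unfold klrDelta; rw [if_neg hrr', if_pos rfl, if_pos hc]

omit [CharP k p] in
/-- `klrDelta` at other positions. [folklore] -/
theorem klrDelta_of_ne_of_ne {r r' : Fin n} {i : Fin n → ZMod p} {t : Fin n} (ht : t ≠ r) (ht' : t ≠ r') :
    klrDelta k r r' i t = 0 := by
  unfold klrDelta; rw [if_neg ht', if_neg ht]

omit [CharP k p] in
/-- `klrDelta` commutes with every `ȳ`-scalar that commutes with `ē(𝐢)`: it is `0` or `±ē(𝐢)`. [folklore] -/
theorem klrDelta_eq_smul (r r' : Fin n) (i : Fin n → ZMod p) (t : Fin n) :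
    ∃ c : ℤ, klrDelta k r r' i t = c • klrIdemR k i := by
  unfold klrDelta
  split_ifs
  exacts [⟨1, (one_zsmul _).symm⟩, ⟨0, (zero_zsmul _).symm⟩, ⟨-1, by rw [neg_one_zsmul]⟩,
    ⟨0, by rw [neg_zero, zero_zsmul]⟩, ⟨0, (zero_zsmul _).symm⟩]

omit [CharP k p] in
/-- The exchange rule of `ȳ_t` through `P_r(𝐢)`: `ȳ_t P_r(𝐢) = P_r(𝐢) ȳ_{s_rt} + klrDelta`. [folklore] -/
theorem klrYR_mul_klrPsiR_rule {r r' : Fin n} (h : (r' : ℕ) = r + 1) (i : Fin n → ZMod p) (t : Fin n) :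
    klrYR k t * klrPsiR k r i = klrPsiR k r i * klrYR k (swap r r' t) + klrDelta k r r' i t := by
  have hrr' : r ≠ r' := by intro e; rw [Fin.ext_iff] at e; omega
  unfold klrDelta
  by_cases ht' : t = r'
  · subst ht'
    rw [if_pos rfl, swap_apply_right, klrYR_succ_mul_klrPsiR k h]
  by_cases ht : t = r
  · subst ht
    rw [if_neg ht', if_pos rfl, swap_apply_left]
    have := klrPsiR_mul_klrYR_succ k h i
    rw [this]; abel
  · rw [if_neg ht', if_neg ht, swap_apply_of_ne_of_ne ht ht', add_zero, klrPsiR_mul_klrYR_of_ne k h ht ht']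

omit [CharP k p] in
/-- **Exchange of a difference unit**:
`(c + ȳ_a - ȳ_b) P_r(𝐢) = P_r(𝐢) (c + ȳ_{s_ra} - ȳ_{s_rb}) + (Δ_a - Δ_b)`. [folklore] -/
theorem klrDiffUnitR_mul_klrPsiR_rule {r r' : Fin n} (h : (r' : ℕ) = r + 1) (i : Fin n → ZMod p)
    (a b : Fin n) (c : k) :
    klrDiffUnitR k a b c * klrPsiR k r i =
      klrPsiR k r i * klrDiffUnitR k (swap r r' a) (swap r r' b) c +
        (klrDelta k r r' i a - klrDelta k r r' i b) := by
  rw [klrDiffUnitR, klrDiffUnitR, add_mul, sub_mul, klrYR_mul_klrPsiR_rule k h i a,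
    klrYR_mul_klrPsiR_rule k h i b, Algebra.commutes, mul_add, mul_sub]
  abel

omit [CharP k p] in
/-- **Exchange of the inverse of a difference unit** (`c ≠ 0`):
`u^{-1} P_r(𝐢) = P_r(𝐢) ({}^{s_r}u)^{-1} - u^{-1} (Δ_a - Δ_b) ({}^{s_r}u)^{-1}`. [folklore] -/
theorem ringInverse_klrDiffUnitR_mul_klrPsiR_rule {r r' : Fin n} (h : (r' : ℕ) = r + 1)
    (i : Fin n → ZMod p) (a b : Fin n) {c : k} (hc : c ≠ 0) :
    Ring.inverse (klrDiffUnitR k a b c) * klrPsiR k r i =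
      klrPsiR k r i * Ring.inverse (klrDiffUnitR k (swap r r' a) (swap r r' b) c) -
        Ring.inverse (klrDiffUnitR k a b c) * (klrDelta k r r' i a - klrDelta k r r' i b) *
          Ring.inverse (klrDiffUnitR k (swap r r' a) (swap r r' b) c) :=
  ringInverse_mul_of_rule (klrDiffUnitR_mul_klrPsiR_rule k h i a b c) (isUnit_klrDiffUnitR k a b hc)
    (isUnit_klrDiffUnitR k _ _ hc)

/-- **Exchange of `p_{ss'}(𝐣)` through `P_r(𝐢)`**: `{}^{s_r}p_{ss'}(𝐣) = p_{s_rs, s_rs'}(𝐣∘s_r)`, and the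
`∂`-term `-p (Δ_s - Δ_{s'}) p'` (zero when `j_s = j_{s'}`). [folklore] -/
theorem klrPR_mul_klrPsiR_rule {r r' : Fin n} (h : (r' : ℕ) = r + 1) (i : Fin n → ZMod p)
    (s s' : Fin n) (j : Fin n → ZMod p) :
    klrPR k s s' j * klrPsiR k r i =
      klrPsiR k r i * klrPR k (swap r r' s) (swap r r' s') (j ∘ swap r r') +
        (if j s = j s' then 0 else
          -(klrPR k s s' j * (klrDelta k r r' i s - klrDelta k r r' i s') *
            klrPR k (swap r r' s) (swap r r' s') (j ∘ swap r r'))) := by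
  have hsw : ∀ t, (j ∘ swap r r') (swap r r' t) = j t := fun t => by
    simp only [Function.comp_apply, swap_apply_self]
  unfold klrPR
  rw [hsw, hsw]
  by_cases hc : j s = j s'
  · simp only [if_pos hc, one_mul, mul_one, add_zero]
  · simp only [if_neg hc]
    rw [ringInverse_klrDiffUnitR_mul_klrPsiR_rule k h i s s' (resK_sub_ne_zero k hc), sub_eq_add_neg]

/-- **Exchange of `q_{ss'}(𝐣)` through `P_r(𝐢)`, equal case `j_s = j_{s'}`**: `q = 1 + ȳ_{s'} - ȳ_s`. [folklore] -/
theorem klrQR_mul_klrPsiR_rule_of_eq {r r' : Fin n} (h : (r' : ℕ) = r + 1) (i : Fin n → ZMod p)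
    {s s' : Fin n} {j : Fin n → ZMod p} (hc : j s = j s') :
    klrQR k s s' j * klrPsiR k r i =
      klrPsiR k r i * klrQR k (swap r r' s) (swap r r' s') (j ∘ swap r r') +
        (klrDelta k r r' i s' - klrDelta k r r' i s) := by
  have hsw : ∀ t, (j ∘ swap r r') (swap r r' t) = j t := fun t => by
    simp only [Function.comp_apply, swap_apply_self]
  have hu : ∀ a b : Fin n, (1 : KLRAlgebra k p n) + (klrYR k a - klrYR k b) = klrDiffUnitR k a b 1 := by
    intro a b; rw [klrDiffUnitR, map_one]
  unfold klrQR
  rw [hsw, hsw, if_pos hc, if_pos hc, hu, hu]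
  exact klrDiffUnitR_mul_klrPsiR_rule k h i s' s 1

/-- **Exchange of `q_{ss'}(𝐣)` through `P_r(𝐢)`, case `j_s ⇄ j_{s'}`** (`q = -p`). [folklore] -/
theorem klrQR_mul_klrPsiR_rule_of_fw_bw {r r' : Fin n} (h : (r' : ℕ) = r + 1) (i : Fin n → ZMod p)
    {s s' : Fin n} {j : Fin n → ZMod p} (hc : j s ≠ j s') (h1 : j s' = j s + 1) (h2 : j s = j s' + 1) :
    klrQR k s s' j * klrPsiR k r i =
      klrPsiR k r i * klrQR k (swap r r' s) (swap r r' s') (j ∘ swap r r') +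
        klrPR k s s' j * (klrDelta k r r' i s - klrDelta k r r' i s') *
          klrPR k (swap r r' s) (swap r r' s') (j ∘ swap r r') := by
  have hsw : ∀ t, (j ∘ swap r r') (swap r r' t) = j t := fun t => by
    simp only [Function.comp_apply, swap_apply_self]
  have hp := klrPR_mul_klrPsiR_rule k h i s s' j
  rw [if_neg hc] at hp
  unfold klrQR
  rw [hsw, hsw, if_neg hc, if_pos h1, if_pos h2, if_neg hc, if_pos h1, if_pos h2]
  refine (rule_neg hp).trans ?_
  rw [neg_neg]

/-- **Exchange of `q_{ss'}(𝐣)` through `P_r(𝐢)`, case `j_s → j_{s'}` only** (`q = p² - p`). [folklore] -/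
theorem klrQR_mul_klrPsiR_rule_of_fw {r r' : Fin n} (h : (r' : ℕ) = r + 1) (i : Fin n → ZMod p)
    {s s' : Fin n} {j : Fin n → ZMod p} (hc : j s ≠ j s') (h1 : j s' = j s + 1) (h2 : j s ≠ j s' + 1) :
    klrQR k s s' j * klrPsiR k r i =
      klrPsiR k r i * klrQR k (swap r r' s) (swap r r' s') (j ∘ swap r r') +
        (-(klrPR k s s' j * (klrDelta k r r' i s - klrDelta k r r' i s') *
              klrPR k (swap r r' s) (swap r r' s') (j ∘ swap r r')) *
            klrPR k (swap r r' s) (swap r r' s') (j ∘ swap r r') +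
          klrPR k s s' j * -(klrPR k s s' j * (klrDelta k r r' i s - klrDelta k r r' i s') *
              klrPR k (swap r r' s) (swap r r' s') (j ∘ swap r r')) -
          -(klrPR k s s' j * (klrDelta k r r' i s - klrDelta k r r' i s') *
              klrPR k (swap r r' s) (swap r r' s') (j ∘ swap r r'))) := by
  have hsw : ∀ t, (j ∘ swap r r') (swap r r' t) = j t := fun t => by
    simp only [Function.comp_apply, swap_apply_self]
  have hp := klrPR_mul_klrPsiR_rule k h i s s' j
  rw [if_neg hc] at hp
  unfold klrQR
  rw [hsw, hsw, if_neg hc, if_pos h1, if_neg h2, if_neg hc, if_pos h1, if_neg h2]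
  exact rule_sub (rule_mul hp hp) hp

/-- **Exchange of `q_{ss'}(𝐣)` through `P_r(𝐢)`, case `j_s ← j_{s'}` only** (`q = 1`). [folklore] -/
theorem klrQR_mul_klrPsiR_rule_of_bw {r r' : Fin n} (i : Fin n → ZMod p)
    {s s' : Fin n} {j : Fin n → ZMod p} (hc : j s ≠ j s') (h1 : j s' ≠ j s + 1) (h2 : j s = j s' + 1) :
    klrQR k s s' j * klrPsiR k r i =
      klrPsiR k r i * klrQR k (swap r r' s) (swap r r' s') (j ∘ swap r r') + 0 := by
  have hsw : ∀ t, (j ∘ swap r r') (swap r r' t) = j t := fun t => by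
    simp only [Function.comp_apply, swap_apply_self]
  unfold klrQR
  rw [hsw, hsw, if_neg hc, if_neg h1, if_pos h2, if_neg hc, if_neg h1, if_pos h2]
  exact rule_one (klrPsiR k r i)

/-- **Exchange of `q_{ss'}(𝐣)` through `P_r(𝐢)`, unrelated case** (`q = 1 - p`). [folklore] -/
theorem klrQR_mul_klrPsiR_rule_of_ne {r r' : Fin n} (h : (r' : ℕ) = r + 1) (i : Fin n → ZMod p)
    {s s' : Fin n} {j : Fin n → ZMod p} (hc : j s ≠ j s') (h1 : j s' ≠ j s + 1) (h2 : j s ≠ j s' + 1) :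
    klrQR k s s' j * klrPsiR k r i =
      klrPsiR k r i * klrQR k (swap r r' s) (swap r r' s') (j ∘ swap r r') +
        (0 - -(klrPR k s s' j * (klrDelta k r r' i s - klrDelta k r r' i s') *
              klrPR k (swap r r' s) (swap r r' s') (j ∘ swap r r'))) := by
  have hsw : ∀ t, (j ∘ swap r r') (swap r r' t) = j t := fun t => by
    simp only [Function.comp_apply, swap_apply_self]
  have hp := klrPR_mul_klrPsiR_rule k h i s s' j
  rw [if_neg hc] at hp
  unfold klrQR
  rw [hsw, hsw, if_neg hc, if_neg h1, if_neg h2, if_neg hc, if_neg h1, if_neg h2]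
  exact rule_sub (rule_one _) hp

end Exchange


/-! ### BK Thm 3.3, the braid relation `s_rs_{r+1}s_r = s_{r+1}s_rs_{r+1}` in `R^{Λ₀}_n`:
common tools and the case of three distinct residues -/

section BraidTools

variable (k : Type*) [Field k] (p n : ℕ) [Fact p.Prime] [CharP k p]

variable {p n}

omit [Fact p.Prime] in
/-- `(𝐢 ∘ s) ∘ s = 𝐢` for a transposition `s`. [folklore] -/
@[simp] theorem comp_swap_comp_swap (i : Fin n → ZMod p) (a b : Fin n) :
    (i ∘ swap a b) ∘ swap a b = i := by
  funext t; simp only [Function.comp_apply, swap_apply_self]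

/-- The quadratic scalar `Q_r(𝐢)` of (R4): `P_r(s_r𝐢) P_r(𝐢) = Q_r(𝐢) ē(𝐢)`. [folklore] -/
def klrQQ (r r' : Fin n) (i : Fin n → ZMod p) : KLRAlgebra k p n :=
  if i r = i r' then 0
  else if i r' = i r + 1 then
    (if i r = i r' + 1 then (klrYR k r' - klrYR k r) * (klrYR k r - klrYR k r') else klrYR k r' - klrYR k r)
  else (if i r = i r' + 1 then klrYR k r - klrYR k r' else 1)

omit [CharP k p] in
/-- (R4) with the named scalar. [folklore] -/
theorem klrPsiR_sq' {r r' : Fin n} (h : (r' : ℕ) = r + 1) (i : Fin n → ZMod p) :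
    klrPsiR k r (i ∘ swap r r') * klrPsiR k r i = klrQQ k r r' i * klrIdemR k i := by
  rw [klrPsiR_sq k h]; rfl

omit [CharP k p] in
/-- `Q_r(𝐢) ∈ Y''`. [folklore] -/
theorem klrQQ_mem_klrYAlg (r r' : Fin n) (i : Fin n → ZMod p) : klrQQ k r r' i ∈ klrYAlg k (p := p) (n := n) := by
  unfold klrQQ
  have h1 := klrYR_mem_klrYAlg k (p := p) (n := n) r
  have h2 := klrYR_mem_klrYAlg k (p := p) (n := n) r'
  split_ifs
  exacts [zero_mem _, mul_mem (sub_mem h2 h1) (sub_mem h1 h2), sub_mem h2 h1, sub_mem h1 h2, one_mem _]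

/-- The quadratic identity with the named scalar: `Q_r(𝐢) {}^{s_r}q_r q_r + p_r² = 1` (`i_r ≠ i_{r+1}`). [folklore] -/
theorem klrQuadratic_scalar' {r r' : Fin n} {i : Fin n → ZMod p} (hc : i r ≠ i r') :
    klrQQ k r r' i * klrQsR k r r' i * klrQR k r r' i + klrPR k r r' i * klrPR k r r' i = 1 := by
  rw [← klrQuadratic_scalar k hc, klrQQ, if_neg hc]

/-- `p_{r'r}(𝐢) = -p_{rr'}(𝐢)` (`i_r ≠ i_{r'}`). [folklore] -/
theorem klrPR_rev {r r' : Fin n} {i : Fin n → ZMod p} (hc : i r ≠ i r') : klrPR k r' r i = -klrPR k r r' i := by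
  unfold klrPR
  rw [if_neg (Ne.symm hc), if_neg hc]
  have hu : klrDiffUnitR k r' r (resK k (i r') - resK k (i r)) =
      -klrDiffUnitR k (p := p) (n := n) r r' (resK k (i r) - resK k (i r')) := by
    rw [klrDiffUnitR, klrDiffUnitR, map_sub, map_sub]; abel
  rw [hu, ringInverse_neg (isUnit_klrDiffUnitR k r r' (resK_sub_ne_zero k hc))]

/-- `q_{r'r}(𝐢) = {}^{s_r}q_r(s_r𝐢)` (`= klrQsR`; `i_r ≠ i_{r'}`). [folklore] -/
theorem klrQR_rev_eq_klrQsR {r r' : Fin n} {i : Fin n → ZMod p} (hc : i r ≠ i r') :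
    klrQR k r' r i = klrQsR k r r' i := by
  unfold klrQR klrQsR
  rw [if_neg (Ne.symm hc), klrPR_rev k hc]
  by_cases h1 : i r' = i r + 1 <;> by_cases h2 : i r = i r' + 1
  · simp only [if_pos h1, if_pos h2]; exact neg_neg _
  · simp only [if_pos h1, if_neg h2]
  · simp only [if_neg h1, if_pos h2]
    rw [neg_mul_neg (klrPR k r r' i) (klrPR k r r' i)]
    exact sub_neg_eq_add (klrPR k r r' i * klrPR k r r' i) (klrPR k r r' i)
  · simp only [if_neg h1, if_neg h2]
    exact sub_neg_eq_add (1 : KLRAlgebra k p n) (klrPR k r r' i)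

/-- `Δ`-free exchange of `p` (`i_r ≠ i_{r+1}`). [folklore] -/
theorem klrPR_mul_klrPsiR_of_ne {r r' : Fin n} (h : (r' : ℕ) = r + 1) {i : Fin n → ZMod p} (hc : i r ≠ i r')
    (s s' : Fin n) (j : Fin n → ZMod p) :
    klrPR k s s' j * klrPsiR k r i = klrPsiR k r i * klrPR k (swap r r' s) (swap r r' s') (j ∘ swap r r') := by
  have := klrPR_mul_klrPsiR_rule k h i s s' j
  simp only [klrDelta_of_ne k hc, sub_zero, mul_zero, zero_mul, neg_zero, ite_self, add_zero] at this
  exact this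

/-- `Δ`-free exchange of `q` (`i_r ≠ i_{r+1}`). [folklore] -/
theorem klrQR_mul_klrPsiR_of_ne {r r' : Fin n} (h : (r' : ℕ) = r + 1) {i : Fin n → ZMod p} (hc : i r ≠ i r')
    (s s' : Fin n) (j : Fin n → ZMod p) :
    klrQR k s s' j * klrPsiR k r i = klrPsiR k r i * klrQR k (swap r r' s) (swap r r' s') (j ∘ swap r r') := by
  have hsw : ∀ t, (j ∘ swap r r') (swap r r' t) = j t := fun t => by
    simp only [Function.comp_apply, swap_apply_self]
  have hp := klrPR_mul_klrPsiR_of_ne k h hc s s' j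
  have hu := klrDiffUnitR_mul_klrPsiR_rule k h i s' s 1
  simp only [klrDelta_of_ne k hc, sub_zero, add_zero] at hu
  rw [klrDiffUnitR, klrDiffUnitR, map_one] at hu
  unfold klrQR
  rw [hsw, hsw]
  split_ifs
  · exact hu
  · exact (neg_mul _ _).trans ((congrArg Neg.neg hp).trans (mul_neg _ _).symm)
  · rw [sub_mul, mul_assoc, hp, ← mul_assoc, hp, mul_sub, mul_assoc]
  · rw [one_mul, mul_one]
  · rw [sub_mul, one_mul, hp, mul_sub, mul_one]

/-- `s_r w = P_r(𝐭)(q_r(𝐭) w) - p_r(𝐭) w` whenever `ē(𝐭) w = w`. [folklore] -/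
theorem klrSR_mul_of_top {r r' : Fin n} (t : Fin n → ZMod p) {w : KLRAlgebra k p n}
    (hw : klrIdemR k t * w = w) :
    klrSR k r r' * w = klrPsiR k r t * (klrQR k r r' t * w) - klrPR k r r' t * w := by
  calc klrSR k r r' * w = klrSR k r r' * (klrIdemR k t * w) := by rw [hw]
    _ = (klrPsiR k r t * klrQR k r r' t - klrPR k r r' t * klrIdemR k t) * w := by
        rw [← mul_assoc, klrSR_mul_klrIdemR]
    _ = _ := by rw [sub_mul, mul_assoc, mul_assoc, hw]

end BraidTools

section BraidDistinct

variable (k : Type*) [Field k] (p n : ℕ) [Fact p.Prime] [CharP k p]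

variable {p n}

/-- `s_r ē(𝐢) = P_r(𝐢) q_r(𝐢) - ē(𝐢) p_r(𝐢)` (idempotent first). [folklore] -/
theorem klrSR_mul_klrIdemR' (r r' : Fin n) (i : Fin n → ZMod p) :
    klrSR k r r' * klrIdemR k i = klrPsiR k r i * klrQR k r r' i - klrIdemR k i * klrPR k r r' i := by
  rw [klrSR_mul_klrIdemR, klrIdemR_mul_of_mem_klrYAlg k (klrPR_mem_klrYAlg k r r' i) i]

/-- `s_r P_r(𝐢) = ē(𝐢) Q_r(𝐢) {}^{s_r}q_r - P_r(𝐢) p_{r+1,r}(𝐢)` (`i_r ≠ i_{r+1}`). [folklore] -/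
theorem klrSR_mul_klrPsiR_same {r r' : Fin n} (h : (r' : ℕ) = r + 1) {i : Fin n → ZMod p} (hab : i r ≠ i r') :
    klrSR k r r' * klrPsiR k r i =
      klrIdemR k i * klrQQ k r r' i * klrQsR k r r' i - klrPsiR k r i * klrPR k r' r i := by
  rw [klrSR_mul_of_top k (i ∘ swap r r') (klrIdemR_swap_mul_klrPsiR k h i),
    klrQR_swap_mul_klrPsiR k h hab, ← mul_assoc, klrPsiR_sq' k h, klrPR_mul_klrPsiR_of_ne k h hab,
    ← klrIdemR_mul_of_mem_klrYAlg k (klrQQ_mem_klrYAlg k r r' i) i]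
  simp only [swap_apply_left, swap_apply_right, comp_swap_comp_swap]

/-- `s_r P_{r+1}(𝐢) = P_r(s_{r+1}𝐢) P_{r+1}(𝐢) q_{r,r+2}(𝐢) - P_{r+1}(𝐢) p_{r,r+2}(𝐢)` (`i_{r+1} ≠ i_{r+2}`). [folklore] -/
theorem klrSR_mul_klrPsiR_next {r r' r'' : Fin n} (h : (r' : ℕ) = r + 1) (h' : (r'' : ℕ) = r' + 1)
    {i : Fin n → ZMod p} (hbc : i r' ≠ i r'') :
    klrSR k r r' * klrPsiR k r' i =
      klrPsiR k r (i ∘ swap r' r'') * klrPsiR k r' i * klrQR k r r'' i - klrPsiR k r' i * klrPR k r r'' i := by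
  have h1 : r ≠ r' := by intro e; rw [Fin.ext_iff] at e; omega
  have h2 : r ≠ r'' := by intro e; rw [Fin.ext_iff] at e; omega
  rw [klrSR_mul_of_top k (i ∘ swap r' r'') (klrIdemR_swap_mul_klrPsiR k h' i),
    klrQR_mul_klrPsiR_of_ne k h' hbc, ← mul_assoc, klrPR_mul_klrPsiR_of_ne k h' hbc]
  simp only [swap_apply_left, swap_apply_of_ne_of_ne h1 h2, comp_swap_comp_swap]

/-- `s_{r+1} P_r(𝐢) = P_{r+1}(s_r𝐢) P_r(𝐢) q_{r,r+2}(𝐢) - P_r(𝐢) p_{r,r+2}(𝐢)` (`i_r ≠ i_{r+1}`). [folklore] -/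
theorem klrSR_next_mul_klrPsiR {r r' r'' : Fin n} (h : (r' : ℕ) = r + 1) (h' : (r'' : ℕ) = r' + 1)
    {i : Fin n → ZMod p} (hab : i r ≠ i r') :
    klrSR k r' r'' * klrPsiR k r i =
      klrPsiR k r' (i ∘ swap r r') * klrPsiR k r i * klrQR k r r'' i - klrPsiR k r i * klrPR k r r'' i := by
  have h1 : r'' ≠ r := by intro e; rw [Fin.ext_iff] at e; omega
  have h2 : r'' ≠ r' := by intro e; rw [Fin.ext_iff] at e; omega
  rw [klrSR_mul_of_top k (i ∘ swap r r') (klrIdemR_swap_mul_klrPsiR k h i),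
    klrQR_mul_klrPsiR_of_ne k h hab, ← mul_assoc, klrPR_mul_klrPsiR_of_ne k h hab]
  simp only [swap_apply_right, swap_apply_of_ne_of_ne h1 h2, comp_swap_comp_swap]

/-- `s_r (P_{r+1}(s_r𝐢) P_r(𝐢)) = P_rP_{r+1}P_r(𝐢) q_{r+1}(𝐢) - P_{r+1}(s_r𝐢)P_r(𝐢) p_{r+1}(𝐢)`
(`i_r ≠ i_{r+1}`, `i_r ≠ i_{r+2}`). [folklore] -/
theorem klrSR_mul_klrPsiR_two_one {r r' r'' : Fin n} (h : (r' : ℕ) = r + 1) (h' : (r'' : ℕ) = r' + 1)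
    {i : Fin n → ZMod p} (hab : i r ≠ i r') (hac : i r ≠ i r'') :
    klrSR k r r' * (klrPsiR k r' (i ∘ swap r r') * klrPsiR k r i) =
      klrPsiR k r ((i ∘ swap r r') ∘ swap r' r'') * klrPsiR k r' (i ∘ swap r r') * klrPsiR k r i *
          klrQR k r' r'' i -
        klrPsiR k r' (i ∘ swap r r') * klrPsiR k r i * klrPR k r' r'' i := by
  have h1 : r ≠ r' := by intro e; rw [Fin.ext_iff] at e; omega
  have h2 : r ≠ r'' := by intro e; rw [Fin.ext_iff] at e; omega
  have h3 : r'' ≠ r' := by intro e; rw [Fin.ext_iff] at e; omega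
  have hac' : (i ∘ swap r r') r' ≠ (i ∘ swap r r') r'' := by
    simp only [Function.comp_apply, swap_apply_right, swap_apply_of_ne_of_ne h2.symm h3]; exact hac
  have htop : klrIdemR k ((i ∘ swap r r') ∘ swap r' r'') * (klrPsiR k r' (i ∘ swap r r') * klrPsiR k r i) =
      klrPsiR k r' (i ∘ swap r r') * klrPsiR k r i := by
    rw [← mul_assoc, klrIdemR_swap_mul_klrPsiR k h']
  rw [klrSR_mul_of_top k _ htop]
  rw [← mul_assoc (klrQR k r r' _), klrQR_mul_klrPsiR_of_ne k h' hac', mul_assoc, klrQR_mul_klrPsiR_of_ne k h hab,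
    ← mul_assoc (klrPR k r r' _), klrPR_mul_klrPsiR_of_ne k h' hac', mul_assoc (klrPsiR k r' _),
    klrPR_mul_klrPsiR_of_ne k h hab]
  simp only [swap_apply_left, swap_apply_of_ne_of_ne h1 h2, swap_apply_of_ne_of_ne h2.symm h3,
    comp_swap_comp_swap, mul_assoc]

/-- `s_{r+1} (P_r(s_{r+1}𝐢) P_{r+1}(𝐢)) = P_rP_{r+1}P_r(𝐢) q_r(𝐢) - P_r(s_{r+1}𝐢)P_{r+1}(𝐢) p_r(𝐢)`
(`i_{r+1} ≠ i_{r+2}`, `i_r ≠ i_{r+2}`; the braid relation (R7) has no correction term here). [folklore] -/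
theorem klrSR_next_mul_klrPsiR_one_two {r r' r'' : Fin n} (h : (r' : ℕ) = r + 1) (h' : (r'' : ℕ) = r' + 1)
    {i : Fin n → ZMod p} (hbc : i r' ≠ i r'') (hac : i r ≠ i r'') :
    klrSR k r' r'' * (klrPsiR k r (i ∘ swap r' r'') * klrPsiR k r' i) =
      klrPsiR k r ((i ∘ swap r r') ∘ swap r' r'') * klrPsiR k r' (i ∘ swap r r') * klrPsiR k r i *
          klrQR k r r' i -
        klrPsiR k r (i ∘ swap r' r'') * klrPsiR k r' i * klrPR k r r' i := by
  have h1 : r ≠ r' := by intro e; rw [Fin.ext_iff] at e; omega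
  have h2 : r ≠ r'' := by intro e; rw [Fin.ext_iff] at e; omega
  have h3 : r'' ≠ r' := by intro e; rw [Fin.ext_iff] at e; omega
  have hac' : (i ∘ swap r' r'') r ≠ (i ∘ swap r' r'') r' := by
    simp only [Function.comp_apply, swap_apply_left, swap_apply_of_ne_of_ne h1 h2]; exact hac
  have htop : klrIdemR k ((i ∘ swap r' r'') ∘ swap r r') * (klrPsiR k r (i ∘ swap r' r'') * klrPsiR k r' i) =
      klrPsiR k r (i ∘ swap r' r'') * klrPsiR k r' i := by
    rw [← mul_assoc, klrIdemR_swap_mul_klrPsiR k h]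
  rw [klrSR_mul_of_top k _ htop]
  rw [← mul_assoc (klrQR k r' r'' _), klrQR_mul_klrPsiR_of_ne k h hac', mul_assoc, klrQR_mul_klrPsiR_of_ne k h' hbc,
    ← mul_assoc (klrPR k r' r'' _), klrPR_mul_klrPsiR_of_ne k h hac', mul_assoc (klrPsiR k r _),
    klrPR_mul_klrPsiR_of_ne k h' hbc]
  simp only [swap_apply_right, swap_apply_of_ne_of_ne h2.symm h3, swap_apply_of_ne_of_ne h1 h2,
    comp_swap_comp_swap]
  -- the braid relation (R7) without correction
  have hbr := klrPsiR_braid k h h' i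
  rw [if_neg (fun hh => hac hh.1), zero_mul, add_zero] at hbr
  simp only [← mul_assoc]
  rw [← hbr]

/-- **Normal form of `s_rs_{r+1}s_r ē(𝐢)` for three distinct residues** (words `P_rP_{r+1}P_r`, `P_{r+1}P_r`,
`P_rP_{r+1}`, `P_r`, `P_{r+1}`, `ē` with `Y''`-coefficients on the right). [folklore] -/
theorem klrSR_triple_lhs_of_distinct {r r' r'' : Fin n} (h : (r' : ℕ) = r + 1) (h' : (r'' : ℕ) = r' + 1)
    {i : Fin n → ZMod p} (hab : i r ≠ i r') (hbc : i r' ≠ i r'') (hac : i r ≠ i r'') :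
    klrSR k r r' * (klrSR k r' r'' * (klrSR k r r' * klrIdemR k i)) =
      (klrPsiR k r ((i ∘ swap r r') ∘ swap r' r'') * klrPsiR k r' (i ∘ swap r r') * klrPsiR k r i *
          klrQR k r' r'' i -
        klrPsiR k r' (i ∘ swap r r') * klrPsiR k r i * klrPR k r' r'' i) * (klrQR k r r'' i * klrQR k r r' i) -
      (klrIdemR k i * klrQQ k r r' i * klrQsR k r r' i - klrPsiR k r i * klrPR k r' r i) *
        (klrPR k r r'' i * klrQR k r r' i) -
      (klrPsiR k r (i ∘ swap r' r'') * klrPsiR k r' i * klrQR k r r'' i - klrPsiR k r' i * klrPR k r r'' i) *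
        (klrQR k r' r'' i * klrPR k r r' i) +
      (klrPsiR k r i * klrQR k r r' i - klrIdemR k i * klrPR k r r' i) * (klrPR k r' r'' i * klrPR k r r' i) := by
  have cep : ∀ (a b : Fin n), klrIdemR k i * klrPR k a b i = klrPR k a b i * klrIdemR k i :=
    fun a b => klrIdemR_mul_of_mem_klrYAlg k (klrPR_mem_klrYAlg k a b i) i
  rw [klrSR_mul_klrIdemR']
  have A2 : klrSR k r' r'' * (klrPsiR k r i * klrQR k r r' i - klrIdemR k i * klrPR k r r' i) =
      klrPsiR k r' (i ∘ swap r r') * klrPsiR k r i * (klrQR k r r'' i * klrQR k r r' i) -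
        klrPsiR k r i * (klrPR k r r'' i * klrQR k r r' i) -
        klrPsiR k r' i * (klrQR k r' r'' i * klrPR k r r' i) +
        klrIdemR k i * (klrPR k r' r'' i * klrPR k r r' i) := by
    rw [mul_sub, ← mul_assoc, klrSR_next_mul_klrPsiR k h h' hab, ← mul_assoc, klrSR_mul_klrIdemR']
    simp only [sub_mul, mul_assoc]
    abel
  rw [A2, mul_add, mul_sub, mul_sub, ← mul_assoc, klrSR_mul_klrPsiR_two_one k h h' hab hac,
    ← mul_assoc (klrSR k r r') (klrPsiR k r i), klrSR_mul_klrPsiR_same k h hab,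
    ← mul_assoc (klrSR k r r') (klrPsiR k r' i), klrSR_mul_klrPsiR_next k h h' hbc,
    ← mul_assoc (klrSR k r r') (klrIdemR k i), klrSR_mul_klrIdemR']

/-- **Normal form of `s_{r+1}s_rs_{r+1} ē(𝐢)` for three distinct residues.** [folklore] -/
theorem klrSR_triple_rhs_of_distinct {r r' r'' : Fin n} (h : (r' : ℕ) = r + 1) (h' : (r'' : ℕ) = r' + 1)
    {i : Fin n → ZMod p} (hab : i r ≠ i r') (hbc : i r' ≠ i r'') (hac : i r ≠ i r'') :
    klrSR k r' r'' * (klrSR k r r' * (klrSR k r' r'' * klrIdemR k i)) =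
      (klrPsiR k r ((i ∘ swap r r') ∘ swap r' r'') * klrPsiR k r' (i ∘ swap r r') * klrPsiR k r i *
          klrQR k r r' i -
        klrPsiR k r (i ∘ swap r' r'') * klrPsiR k r' i * klrPR k r r' i) * (klrQR k r r'' i * klrQR k r' r'' i) -
      (klrIdemR k i * klrQQ k r' r'' i * klrQsR k r' r'' i - klrPsiR k r' i * klrPR k r'' r' i) *
        (klrPR k r r'' i * klrQR k r' r'' i) -
      (klrPsiR k r' (i ∘ swap r r') * klrPsiR k r i * klrQR k r r'' i - klrPsiR k r i * klrPR k r r'' i) *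
        (klrQR k r r' i * klrPR k r' r'' i) +
      (klrPsiR k r' i * klrQR k r' r'' i - klrIdemR k i * klrPR k r' r'' i) * (klrPR k r r' i * klrPR k r' r'' i) := by
  rw [klrSR_mul_klrIdemR']
  have B2 : klrSR k r r' * (klrPsiR k r' i * klrQR k r' r'' i - klrIdemR k i * klrPR k r' r'' i) =
      klrPsiR k r (i ∘ swap r' r'') * klrPsiR k r' i * (klrQR k r r'' i * klrQR k r' r'' i) -
        klrPsiR k r' i * (klrPR k r r'' i * klrQR k r' r'' i) -
        klrPsiR k r i * (klrQR k r r' i * klrPR k r' r'' i) +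
        klrIdemR k i * (klrPR k r r' i * klrPR k r' r'' i) := by
    rw [mul_sub, ← mul_assoc, klrSR_mul_klrPsiR_next k h h' hbc, ← mul_assoc, klrSR_mul_klrIdemR']
    simp only [sub_mul, mul_assoc]
    abel
  rw [B2, mul_add, mul_sub, mul_sub, ← mul_assoc, klrSR_next_mul_klrPsiR_one_two k h h' hbc hac,
    ← mul_assoc (klrSR k r' r'') (klrPsiR k r' i), klrSR_mul_klrPsiR_same k h' hbc,
    ← mul_assoc (klrSR k r' r'') (klrPsiR k r i), klrSR_next_mul_klrPsiR k h h' hab,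
    ← mul_assoc (klrSR k r' r'') (klrIdemR k i), klrSR_mul_klrIdemR']

open scoped IsMulCommutative in
/-- **The partial-fraction identity behind the braid relation**: `p_{r,r+1} p_{r+1,r+2} =
p_{r,r+2}(p_{r,r+1} + p_{r+1,r+2})` for three distinct residues (`1/p_{r,r+1} + 1/p_{r+1,r+2} = 1/p_{r,r+2}`). [folklore] -/
theorem klrPR_partialFraction {r r' r'' : Fin n} {i : Fin n → ZMod p} (hab : i r ≠ i r') (hbc : i r' ≠ i r'')
    (hac : i r ≠ i r'') :
    klrPR k r r' i * klrPR k r' r'' i = klrPR k r r'' i * (klrPR k r r' i + klrPR k r' r'' i) := by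
  have hu1 := isUnit_klrDiffUnitR k (p := p) r r' (resK_sub_ne_zero k hab)
  have hu2 := isUnit_klrDiffUnitR k (p := p) r' r'' (resK_sub_ne_zero k hbc)
  have hu3 := isUnit_klrDiffUnitR k (p := p) r r'' (resK_sub_ne_zero k hac)
  have hE : klrDiffUnitR k (p := p) r r'' (resK k (i r) - resK k (i r'')) =
      klrDiffUnitR k r r' (resK k (i r) - resK k (i r')) + klrDiffUnitR k r' r'' (resK k (i r') - resK k (i r'')) := by
    simp only [klrDiffUnitR, map_sub]; abel
  obtain ⟨p1, hp1⟩ : ∃ x : klrYAlg k (p := p) (n := n), (x : KLRAlgebra k p n) = klrPR k r r' i :=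
    ⟨⟨_, klrPR_mem_klrYAlg k _ _ _⟩, rfl⟩
  obtain ⟨p2, hp2⟩ : ∃ x : klrYAlg k (p := p) (n := n), (x : KLRAlgebra k p n) = klrPR k r' r'' i :=
    ⟨⟨_, klrPR_mem_klrYAlg k _ _ _⟩, rfl⟩
  obtain ⟨p3, hp3⟩ : ∃ x : klrYAlg k (p := p) (n := n), (x : KLRAlgebra k p n) = klrPR k r r'' i :=
    ⟨⟨_, klrPR_mem_klrYAlg k _ _ _⟩, rfl⟩
  obtain ⟨u1, hu1'⟩ : ∃ x : klrYAlg k (p := p) (n := n), (x : KLRAlgebra k p n) =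
      klrDiffUnitR k r r' (resK k (i r) - resK k (i r')) := ⟨⟨_, klrDiffUnitR_mem_klrYAlg k _ _ _⟩, rfl⟩
  obtain ⟨u2, hu2'⟩ : ∃ x : klrYAlg k (p := p) (n := n), (x : KLRAlgebra k p n) =
      klrDiffUnitR k r' r'' (resK k (i r') - resK k (i r'')) := ⟨⟨_, klrDiffUnitR_mem_klrYAlg k _ _ _⟩, rfl⟩
  obtain ⟨u3, hu3'⟩ : ∃ x : klrYAlg k (p := p) (n := n), (x : KLRAlgebra k p n) =
      klrDiffUnitR k r r'' (resK k (i r) - resK k (i r'')) := ⟨⟨_, klrDiffUnitR_mem_klrYAlg k _ _ _⟩, rfl⟩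
  have R1 := Ring.inverse_mul_cancel _ hu1
  have R2 := Ring.inverse_mul_cancel _ hu2
  have R3 := Ring.inverse_mul_cancel _ hu3
  rw [← show klrPR k r r' i = Ring.inverse _ from if_neg hab] at R1
  rw [← show klrPR k r' r'' i = Ring.inverse _ from if_neg hbc] at R2
  rw [← show klrPR k r r'' i = Ring.inverse _ from if_neg hac] at R3
  rw [← hp1, ← hu1'] at R1
  rw [← hp2, ← hu2'] at R2
  rw [← hp3, ← hu3'] at R3
  rw [← hu1', ← hu2', ← hu3'] at hE
  have R1' : p1 * u1 = 1 := by exact_mod_cast R1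
  have R2' : p2 * u2 = 1 := by exact_mod_cast R2
  have R3' : p3 * u3 = 1 := by exact_mod_cast R3
  have hE' : u3 = u1 + u2 := by exact_mod_cast hE
  rw [← hp1, ← hp2, ← hp3]
  exact_mod_cast (show p1 * p2 = p3 * (p1 + p2) by
    linear_combination (-(p1 * p2)) * R3' + (p1 * p2 * p3) * hE' + (p3 * p2) * R1' + (p3 * p1) * R2')

open scoped IsMulCommutative in
/-- **BK Thm 3.3, braid relation on `ē(𝐢)`, case of three distinct residues `i_r, i_{r+1}, i_{r+2}`.** [folklore] -/
theorem klrSR_braid_mul_klrIdemR_of_distinct {r r' r'' : Fin n} (h : (r' : ℕ) = r + 1)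
    (h' : (r'' : ℕ) = r' + 1) {i : Fin n → ZMod p} (hab : i r ≠ i r') (hbc : i r' ≠ i r'') (hac : i r ≠ i r'') :
    klrSR k r r' * (klrSR k r' r'' * (klrSR k r r' * klrIdemR k i)) =
      klrSR k r' r'' * (klrSR k r r' * (klrSR k r' r'' * klrIdemR k i)) := by
  rw [klrSR_triple_lhs_of_distinct k h h' hab hbc hac, klrSR_triple_rhs_of_distinct k h h' hab hbc hac]
  have hI := klrPR_partialFraction k hab hbc hac
  have hQa := klrQuadratic_scalar' k (r := r) (r' := r') hab
  have hQb := klrQuadratic_scalar' k (r := r') (r' := r'') hbc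
  have h21 := klrPR_rev k (r := r) (r' := r') hab
  have h32 := klrPR_rev k (r := r') (r' := r'') hbc
  obtain ⟨p1, hp1⟩ : ∃ x : klrYAlg k (p := p) (n := n), (x : KLRAlgebra k p n) = klrPR k r r' i :=
    ⟨⟨_, klrPR_mem_klrYAlg k _ _ _⟩, rfl⟩
  obtain ⟨p2, hp2⟩ : ∃ x : klrYAlg k (p := p) (n := n), (x : KLRAlgebra k p n) = klrPR k r' r'' i :=
    ⟨⟨_, klrPR_mem_klrYAlg k _ _ _⟩, rfl⟩
  obtain ⟨p3, hp3⟩ : ∃ x : klrYAlg k (p := p) (n := n), (x : KLRAlgebra k p n) = klrPR k r r'' i :=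
    ⟨⟨_, klrPR_mem_klrYAlg k _ _ _⟩, rfl⟩
  obtain ⟨p21, hp21⟩ : ∃ x : klrYAlg k (p := p) (n := n), (x : KLRAlgebra k p n) = klrPR k r' r i :=
    ⟨⟨_, klrPR_mem_klrYAlg k _ _ _⟩, rfl⟩
  obtain ⟨p32, hp32⟩ : ∃ x : klrYAlg k (p := p) (n := n), (x : KLRAlgebra k p n) = klrPR k r'' r' i :=
    ⟨⟨_, klrPR_mem_klrYAlg k _ _ _⟩, rfl⟩
  obtain ⟨q1, hq1⟩ : ∃ x : klrYAlg k (p := p) (n := n), (x : KLRAlgebra k p n) = klrQR k r r' i :=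
    ⟨⟨_, klrQR_mem_klrYAlg k _ _ _⟩, rfl⟩
  obtain ⟨q2, hq2⟩ : ∃ x : klrYAlg k (p := p) (n := n), (x : KLRAlgebra k p n) = klrQR k r' r'' i :=
    ⟨⟨_, klrQR_mem_klrYAlg k _ _ _⟩, rfl⟩
  obtain ⟨q3, hq3⟩ : ∃ x : klrYAlg k (p := p) (n := n), (x : KLRAlgebra k p n) = klrQR k r r'' i :=
    ⟨⟨_, klrQR_mem_klrYAlg k _ _ _⟩, rfl⟩
  obtain ⟨Q1, hQ1⟩ : ∃ x : klrYAlg k (p := p) (n := n), (x : KLRAlgebra k p n) = klrQQ k r r' i :=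
    ⟨⟨_, klrQQ_mem_klrYAlg k _ _ _⟩, rfl⟩
  obtain ⟨Q2, hQ2⟩ : ∃ x : klrYAlg k (p := p) (n := n), (x : KLRAlgebra k p n) = klrQQ k r' r'' i :=
    ⟨⟨_, klrQQ_mem_klrYAlg k _ _ _⟩, rfl⟩
  obtain ⟨s1, hs1⟩ : ∃ x : klrYAlg k (p := p) (n := n), (x : KLRAlgebra k p n) = klrQsR k r r' i :=
    ⟨⟨_, klrQsR_mem_klrYAlg k _ _ _⟩, rfl⟩
  obtain ⟨s2, hs2⟩ : ∃ x : klrYAlg k (p := p) (n := n), (x : KLRAlgebra k p n) = klrQsR k r' r'' i :=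
    ⟨⟨_, klrQsR_mem_klrYAlg k _ _ _⟩, rfl⟩
  rw [← hp1, ← hp2, ← hp3] at hI
  rw [← hQ1, ← hs1, ← hq1, ← hp1] at hQa
  rw [← hQ2, ← hs2, ← hq2, ← hp2] at hQb
  rw [← hp1, ← hp21] at h21
  rw [← hp2, ← hp32] at h32
  have hI' : p1 * p2 = p3 * (p1 + p2) := by exact_mod_cast hI
  have hQa' : Q1 * s1 * q1 + p1 * p1 = 1 := by exact_mod_cast hQa
  have hQb' : Q2 * s2 * q2 + p2 * p2 = 1 := by exact_mod_cast hQb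
  have h21' : p21 = -p1 := by exact_mod_cast h21
  have h32' : p32 = -p2 := by exact_mod_cast h32
  -- name the words
  set W121 := klrPsiR k r ((i ∘ swap r r') ∘ swap r' r'') * klrPsiR k r' (i ∘ swap r r') * klrPsiR k r i
  set W21 := klrPsiR k r' (i ∘ swap r r') * klrPsiR k r i
  set W12 := klrPsiR k r (i ∘ swap r' r'') * klrPsiR k r' i
  set P1 := klrPsiR k r i
  set P2 := klrPsiR k r' i
  set E := klrIdemR k i
  rw [← hp1, ← hp2, ← hp3, ← hp21, ← hp32, ← hq1, ← hq2, ← hq3, ← hQ1, ← hQ2, ← hs1, ← hs2]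
  -- reduce to coefficient identities in `Y''`
  have key : ∀ (a121 b121 a21 b21 a12 b12 a1 b1 a2 b2 a0 b0 : klrYAlg k (p := p) (n := n)),
      a121 = b121 → a21 = b21 → a12 = b12 → a1 = b1 → a2 = b2 → a0 = b0 →
      W121 * a121 + W21 * a21 + W12 * a12 + P1 * a1 + P2 * a2 + E * a0 =
        W121 * b121 + W21 * b21 + W12 * b12 + P1 * b1 + P2 * b2 + E * b0 := by
    intros; subst_vars; rfl
  have eL : (W121 * (q2 : KLRAlgebra k p n) - W21 * (p2 : KLRAlgebra k p n)) * ((q3 : KLRAlgebra k p n) * q1) -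
      (E * (Q1 : KLRAlgebra k p n) * s1 - P1 * (p21 : KLRAlgebra k p n)) * ((p3 : KLRAlgebra k p n) * q1) -
      (W12 * (q3 : KLRAlgebra k p n) - P2 * (p3 : KLRAlgebra k p n)) * ((q2 : KLRAlgebra k p n) * p1) +
      (P1 * (q1 : KLRAlgebra k p n) - E * (p1 : KLRAlgebra k p n)) * ((p2 : KLRAlgebra k p n) * p1) =
      W121 * ((q2 * (q3 * q1) : klrYAlg k (p := p) (n := n)) : KLRAlgebra k p n) +
        W21 * ((0 - p2 * (q3 * q1) : klrYAlg k (p := p) (n := n)) : KLRAlgebra k p n) +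
        W12 * ((0 - q3 * (q2 * p1) : klrYAlg k (p := p) (n := n)) : KLRAlgebra k p n) +
        P1 * ((p21 * (p3 * q1) + q1 * (p2 * p1) : klrYAlg k (p := p) (n := n)) : KLRAlgebra k p n) +
        P2 * ((p3 * (q2 * p1) : klrYAlg k (p := p) (n := n)) : KLRAlgebra k p n) +
        E * ((0 - Q1 * s1 * (p3 * q1) - p1 * (p2 * p1) : klrYAlg k (p := p) (n := n)) : KLRAlgebra k p n) := by
    push_cast
    simp only [sub_mul, mul_assoc, mul_add, mul_sub, mul_zero]
    abel
  have eR : (W121 * (q1 : KLRAlgebra k p n) - W12 * (p1 : KLRAlgebra k p n)) * ((q3 : KLRAlgebra k p n) * q2) -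
      (E * (Q2 : KLRAlgebra k p n) * s2 - P2 * (p32 : KLRAlgebra k p n)) * ((p3 : KLRAlgebra k p n) * q2) -
      (W21 * (q3 : KLRAlgebra k p n) - P1 * (p3 : KLRAlgebra k p n)) * ((q1 : KLRAlgebra k p n) * p2) +
      (P2 * (q2 : KLRAlgebra k p n) - E * (p2 : KLRAlgebra k p n)) * ((p1 : KLRAlgebra k p n) * p2) =
      W121 * ((q1 * (q3 * q2) : klrYAlg k (p := p) (n := n)) : KLRAlgebra k p n) +
        W21 * ((0 - q3 * (q1 * p2) : klrYAlg k (p := p) (n := n)) : KLRAlgebra k p n) +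
        W12 * ((0 - p1 * (q3 * q2) : klrYAlg k (p := p) (n := n)) : KLRAlgebra k p n) +
        P1 * ((p3 * (q1 * p2) : klrYAlg k (p := p) (n := n)) : KLRAlgebra k p n) +
        P2 * ((p32 * (p3 * q2) + q2 * (p1 * p2) : klrYAlg k (p := p) (n := n)) : KLRAlgebra k p n) +
        E * ((0 - Q2 * s2 * (p3 * q2) - p2 * (p1 * p2) : klrYAlg k (p := p) (n := n)) : KLRAlgebra k p n) := by
    push_cast
    simp only [sub_mul, mul_assoc, mul_add, mul_sub, mul_zero]
    abel
  rw [eL, eR]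
  apply key
  · ring
  · ring
  · ring
  · rw [h21']; linear_combination q1 * hI'
  · rw [h32']; linear_combination (-q2) * hI'
  · linear_combination (-p3) * hQa' + p3 * hQb' + (p2 - p1) * hI'

end BraidDistinct


/-! ### BK Thm 3.3, braid relation: the case `i_r = i_{r+1} = i_{r+2}` -/

section BraidEqual

variable (k : Type*) [Field k] (p n : ℕ) [Fact p.Prime] [CharP k p]

variable {p n}

omit [Fact p.Prime] [CharP k p] in
/-- `x + (0 - y) = x - y`. [folklore] -/
theorem add_zero_sub' {A : Type*} [Ring A] (x y : A) : x + (0 - y) = x - y := by abel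

/-- `p_{ab}(𝐢) = 1` when `i_a = i_b`. [folklore] -/
theorem klrPR_of_eq {a b : Fin n} {i : Fin n → ZMod p} (hc : i a = i b) : klrPR k a b i = 1 := if_pos hc

omit [CharP k p] in
/-- `P_r(𝐢)² = 0` (`i_r = i_{r+1}`). [folklore] -/
theorem klrPsiR_mul_self_of_eq {r r' : Fin n} (h : (r' : ℕ) = r + 1) {i : Fin n → ZMod p} (hab : i r = i r') : klrPsiR k r i * klrPsiR k r i = 0 := by
  have := klrPsiR_sq' k h i
  rwa [comp_swap_eq_self_of_eq hab, klrQQ, if_pos hab, zero_mul] at this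

omit [CharP k p] in
/-- `ē(𝐢) P_r(𝐢) = P_r(𝐢)` (`i_r = i_{r+1}`). [folklore] -/
theorem klrIdemR_mul_klrPsiR_of_eq {r r' : Fin n} (h : (r' : ℕ) = r + 1) {i : Fin n → ZMod p} (hab : i r = i r') : klrIdemR k i * klrPsiR k r i = klrPsiR k r i := by
  have := klrIdemR_swap_mul_klrPsiR k h i
  rwa [comp_swap_eq_self_of_eq hab] at this

/-- `q_{r,r+1} P_r = P_r q_{r+1,r} + (ē + ē)` (all on `ē(𝐢)`, `i_r = i_{r+1}`). [folklore] -/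
theorem klrQR_mul_klrPsiR_self_of_eq {r r' : Fin n} (h : (r' : ℕ) = r + 1) {i : Fin n → ZMod p} (hab : i r = i r') :
    klrQR k r r' i * klrPsiR k r i = klrPsiR k r i * klrQR k r' r i + (klrIdemR k i + klrIdemR k i) := by
  have := klrQR_mul_klrPsiR_rule_of_eq k h i (s := r) (s' := r') (j := i) hab
  rw [comp_swap_eq_self_of_eq hab, swap_apply_left, swap_apply_right, klrDelta_right k hab,
    klrDelta_left k h hab] at this
  rw [this, sub_neg_eq_add (klrIdemR k i) (klrIdemR k i)]

/-- `q_{r,r+1} P_{r+1} = P_{r+1} q_{r,r+2} - ē`. [folklore] -/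
theorem klrQR_mul_klrPsiR_next_of_eq {r r' r'' : Fin n} (h : (r' : ℕ) = r + 1) (h' : (r'' : ℕ) = r' + 1) {i : Fin n → ZMod p}
    (hab : i r = i r') (hbc : i r' = i r'') :
    klrQR k r r' i * klrPsiR k r' i = klrPsiR k r' i * klrQR k r r'' i - klrIdemR k i := by
  have h1 : r ≠ r' := by intro e; rw [Fin.ext_iff] at e; omega
  have h2 : r ≠ r'' := by intro e; rw [Fin.ext_iff] at e; omega
  have := klrQR_mul_klrPsiR_rule_of_eq k h' i (s := r) (s' := r') (j := i) hab
  rw [comp_swap_eq_self_of_eq hbc, swap_apply_left, swap_apply_of_ne_of_ne h1 h2, klrDelta_left k h' hbc,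
    klrDelta_of_ne_of_ne k h1 h2] at this
  rw [this, sub_zero]
  exact (sub_eq_add_neg _ _).symm

/-- `q_{r+1,r+2} P_r = P_r q_{r,r+2} - ē`. [folklore] -/
theorem klrQR_next_mul_klrPsiR_of_eq {r r' r'' : Fin n} (h : (r' : ℕ) = r + 1) (h' : (r'' : ℕ) = r' + 1) {i : Fin n → ZMod p}
    (hab : i r = i r') (hbc : i r' = i r'') :
    klrQR k r' r'' i * klrPsiR k r i = klrPsiR k r i * klrQR k r r'' i - klrIdemR k i := by
  have h1 : r'' ≠ r := by intro e; rw [Fin.ext_iff] at e; omega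
  have h2 : r'' ≠ r' := by intro e; rw [Fin.ext_iff] at e; omega
  have := klrQR_mul_klrPsiR_rule_of_eq k h i (s := r') (s' := r'') (j := i) hbc
  rw [comp_swap_eq_self_of_eq hab, swap_apply_right, swap_apply_of_ne_of_ne h1 h2, klrDelta_right k hab,
    klrDelta_of_ne_of_ne k h1 h2] at this
  rw [this, add_zero_sub']

/-- `q_{r+1,r+2} P_{r+1} = P_{r+1} q_{r+2,r+1} + (ē + ē)`. [folklore] -/
theorem klrQR_next_mul_klrPsiR_next_of_eq {r' r'' : Fin n} (h' : (r'' : ℕ) = r' + 1) {i : Fin n → ZMod p}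
    (hbc : i r' = i r'') :
    klrQR k r' r'' i * klrPsiR k r' i = klrPsiR k r' i * klrQR k r'' r' i + (klrIdemR k i + klrIdemR k i) :=
  klrQR_mul_klrPsiR_self_of_eq k h' hbc

/-- `q_{r,r+2} P_r = P_r q_{r+1,r+2} + ē`. [folklore] -/
theorem klrQR_far_mul_klrPsiR_of_eq {r r' r'' : Fin n} (h : (r' : ℕ) = r + 1) (h' : (r'' : ℕ) = r' + 1) {i : Fin n → ZMod p}
    (hab : i r = i r') (hbc : i r' = i r'') :
    klrQR k r r'' i * klrPsiR k r i = klrPsiR k r i * klrQR k r' r'' i + klrIdemR k i := by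
  have h1 : r'' ≠ r := by intro e; rw [Fin.ext_iff] at e; omega
  have h2 : r'' ≠ r' := by intro e; rw [Fin.ext_iff] at e; omega
  have := klrQR_mul_klrPsiR_rule_of_eq k h i (s := r) (s' := r'') (j := i) (hab.trans hbc)
  rw [comp_swap_eq_self_of_eq hab, swap_apply_left, swap_apply_of_ne_of_ne h1 h2, klrDelta_left k h hab,
    klrDelta_of_ne_of_ne k h1 h2] at this
  rw [this, sub_neg_eq_add (0 : KLRAlgebra k p n) (klrIdemR k i), zero_add]

/-- `q_{r,r+2} P_{r+1} = P_{r+1} q_{r,r+1} + ē`. [folklore] -/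
theorem klrQR_far_mul_klrPsiR_next_of_eq {r r' r'' : Fin n} (h : (r' : ℕ) = r + 1) (h' : (r'' : ℕ) = r' + 1) {i : Fin n → ZMod p}
    (hab : i r = i r') (hbc : i r' = i r'') :
    klrQR k r r'' i * klrPsiR k r' i = klrPsiR k r' i * klrQR k r r' i + klrIdemR k i := by
  have h1 : r ≠ r' := by intro e; rw [Fin.ext_iff] at e; omega
  have h2 : r ≠ r'' := by intro e; rw [Fin.ext_iff] at e; omega
  have := klrQR_mul_klrPsiR_rule_of_eq k h' i (s := r) (s' := r'') (j := i) (hab.trans hbc)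
  rw [comp_swap_eq_self_of_eq hbc, swap_apply_right, swap_apply_of_ne_of_ne h1 h2, klrDelta_right k hbc,
    klrDelta_of_ne_of_ne k h1 h2] at this
  rw [this, sub_zero]

omit [CharP k p] in
/-- (R7) without correction in the all-equal case: `P_rP_{r+1}P_r = P_{r+1}P_rP_{r+1}` on `ē(𝐢)`. [folklore] -/
theorem klrPsiR_braid_of_eq_eq {r r' r'' : Fin n} (h : (r' : ℕ) = r + 1) (h' : (r'' : ℕ) = r' + 1) {i : Fin n → ZMod p}
    (hab : i r = i r') (hbc : i r' = i r'') :
    klrPsiR k r i * klrPsiR k r' i * klrPsiR k r i = klrPsiR k r' i * klrPsiR k r i * klrPsiR k r' i := by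
  have := klrPsiR_braid k h h' i
  rwa [comp_swap_eq_self_of_eq hab, comp_swap_eq_self_of_eq hbc, comp_swap_eq_self_of_eq hab,
    if_neg (fun hh => hh.2 hab), zero_mul, add_zero] at this

/-- `s_r` applied to a word with top `ē(𝐢)` in the all-equal case: `s_r w = P_r (q_r w) - w`. [folklore] -/
theorem klrSR_mul_of_top_eq {r : Fin n} (r' : Fin n) {i : Fin n → ZMod p} (hab : i r = i r') {w : KLRAlgebra k p n} (hw : klrIdemR k i * w = w) :
    klrSR k r r' * w = klrPsiR k r i * (klrQR k r r' i * w) - w := by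
  rw [klrSR_mul_of_top k i hw, klrPR_of_eq k hab, one_mul]

/-- `s_{r+1}` applied to a word with top `ē(𝐢)` in the all-equal case. [folklore] -/
theorem klrSR_next_mul_of_top_eq {r' : Fin n} (r'' : Fin n) {i : Fin n → ZMod p} (hbc : i r' = i r'') {w : KLRAlgebra k p n} (hw : klrIdemR k i * w = w) :
    klrSR k r' r'' * w = klrPsiR k r' i * (klrQR k r' r'' i * w) - w := by
  rw [klrSR_mul_of_top k i hw, klrPR_of_eq k hbc, one_mul]

/-- **Normal form of `s_rs_{r+1}s_r ē(𝐢)`, all-equal case.** [folklore] -/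
theorem klrSR_triple_lhs_of_eq_eq {r r' r'' : Fin n} (h : (r' : ℕ) = r + 1) (h' : (r'' : ℕ) = r' + 1) {i : Fin n → ZMod p}
    (hab : i r = i r') (hbc : i r' = i r'') :
    klrSR k r r' * (klrSR k r' r'' * (klrSR k r r' * klrIdemR k i)) =
      (klrPsiR k r i * klrPsiR k r' i * klrPsiR k r i * klrQR k r' r'' i + klrPsiR k r i * klrPsiR k r' i -
          klrPsiR k r' i * klrPsiR k r i) * (klrQR k r r'' i * klrQR k r r' i) -
      (klrPsiR k r i * klrPsiR k r' i * klrQR k r r'' i - klrPsiR k r i - klrPsiR k r' i) * klrQR k r r' i -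
      klrPsiR k r i * klrQR k r r' i -
      (klrPsiR k r i * klrPsiR k r' i * klrQR k r r'' i - klrPsiR k r i - klrPsiR k r' i) * klrQR k r' r'' i +
      (klrPsiR k r i * klrQR k r r' i - klrIdemR k i) := by
  -- tools
  have E1 : klrIdemR k i * klrPsiR k r i = klrPsiR k r i := klrIdemR_mul_klrPsiR_of_eq k h hab
  have E2 : klrIdemR k i * klrPsiR k r' i = klrPsiR k r' i := klrIdemR_mul_klrPsiR_of_eq k h' hbc
  have EE := klrIdemR_mul_self k (p := p) i
  have ceq : ∀ a b : Fin n, klrQR k a b i * klrIdemR k i = klrIdemR k i * klrQR k a b i :=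
    fun a b => (klrIdemR_mul_of_mem_klrYAlg k (klrQR_mem_klrYAlg k a b i) i).symm
  have P1E := klrPsiR_mul_klrIdemR_self k (p := p) r i
  have P2E := klrPsiR_mul_klrIdemR_self k (p := p) r' i
  have Z1 := klrPsiR_mul_self_of_eq k h hab
  have A1 : klrSR k r r' * klrIdemR k i = klrPsiR k r i * klrQR k r r' i - klrIdemR k i := by
    rw [klrSR_mul_klrIdemR', klrPR_of_eq k hab, mul_one]
  rw [A1]
  -- `s_{r+1} P_r = P_{r+1}P_r q_{r,r+2} - P_{r+1} - P_r`
  have SP1 : klrSR k r' r'' * klrPsiR k r i =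
      klrPsiR k r' i * klrPsiR k r i * klrQR k r r'' i - klrPsiR k r' i - klrPsiR k r i := by
    rw [klrSR_next_mul_of_top_eq k r'' hbc E1, klrQR_next_mul_klrPsiR_of_eq k h h' hab hbc, mul_sub, P2E,
      mul_assoc]
  have A2 : klrSR k r' r'' * (klrPsiR k r i * klrQR k r r' i - klrIdemR k i) =
      klrPsiR k r' i * klrPsiR k r i * (klrQR k r r'' i * klrQR k r r' i) - klrPsiR k r' i * klrQR k r r' i -
        klrPsiR k r i * klrQR k r r' i - klrPsiR k r' i * klrQR k r' r'' i + klrIdemR k i := by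
    rw [mul_sub, ← mul_assoc, SP1, klrSR_next_mul_of_top_eq k r'' hbc EE, ceq, ← mul_assoc (klrPsiR k r' i), P2E]
    simp only [sub_mul, mul_assoc]
    abel
  rw [A2]
  -- `s_r` on each word
  have SW21 : klrSR k r r' * (klrPsiR k r' i * klrPsiR k r i) =
      klrPsiR k r i * klrPsiR k r' i * klrPsiR k r i * klrQR k r' r'' i + klrPsiR k r i * klrPsiR k r' i -
        klrPsiR k r' i * klrPsiR k r i := by
    have htop : klrIdemR k i * (klrPsiR k r' i * klrPsiR k r i) = klrPsiR k r' i * klrPsiR k r i := by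
      rw [← mul_assoc, E2]
    rw [klrSR_mul_of_top_eq k r' hab htop, ← mul_assoc (klrQR k r r' i), klrQR_mul_klrPsiR_next_of_eq k h h' hab hbc,
      sub_mul, E1, mul_assoc, klrQR_far_mul_klrPsiR_of_eq k h h' hab hbc, mul_add, P2E, mul_sub, mul_add,
      ← mul_assoc, ← mul_assoc, Z1]
    abel
  have SP2 : klrSR k r r' * klrPsiR k r' i =
      klrPsiR k r i * klrPsiR k r' i * klrQR k r r'' i - klrPsiR k r i - klrPsiR k r' i := by
    rw [klrSR_mul_of_top_eq k r' hab E2, klrQR_mul_klrPsiR_next_of_eq k h h' hab hbc, mul_sub, P1E, mul_assoc]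
  have SP1' : klrSR k r r' * klrPsiR k r i = klrPsiR k r i := by
    rw [klrSR_mul_of_top_eq k r' hab E1, klrQR_mul_klrPsiR_self_of_eq k h hab, mul_add, ← mul_assoc, Z1,
      zero_mul, zero_add, mul_add, P1E]
    abel
  rw [mul_add, mul_sub, mul_sub, mul_sub, ← mul_assoc, SW21, ← mul_assoc (klrSR k r r') (klrPsiR k r' i), SP2,
    ← mul_assoc (klrSR k r r') (klrPsiR k r i), SP1', ← mul_assoc (klrSR k r r') (klrPsiR k r' i), SP2, A1]

/-- **Normal form of `s_{r+1}s_rs_{r+1} ē(𝐢)`, all-equal case.** [folklore] -/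
theorem klrSR_triple_rhs_of_eq_eq {r r' r'' : Fin n} (h : (r' : ℕ) = r + 1) (h' : (r'' : ℕ) = r' + 1) {i : Fin n → ZMod p}
    (hab : i r = i r') (hbc : i r' = i r'') :
    klrSR k r' r'' * (klrSR k r r' * (klrSR k r' r'' * klrIdemR k i)) =
      (klrPsiR k r i * klrPsiR k r' i * klrPsiR k r i * klrQR k r r' i + klrPsiR k r' i * klrPsiR k r i -
          klrPsiR k r i * klrPsiR k r' i) * (klrQR k r r'' i * klrQR k r' r'' i) -
      (klrPsiR k r' i * klrPsiR k r i * klrQR k r r'' i - klrPsiR k r' i - klrPsiR k r i) * klrQR k r' r'' i -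
      klrPsiR k r' i * klrQR k r' r'' i -
      (klrPsiR k r' i * klrPsiR k r i * klrQR k r r'' i - klrPsiR k r' i - klrPsiR k r i) * klrQR k r r' i +
      (klrPsiR k r' i * klrQR k r' r'' i - klrIdemR k i) := by
  have E1 : klrIdemR k i * klrPsiR k r i = klrPsiR k r i := klrIdemR_mul_klrPsiR_of_eq k h hab
  have E2 : klrIdemR k i * klrPsiR k r' i = klrPsiR k r' i := klrIdemR_mul_klrPsiR_of_eq k h' hbc
  have EE := klrIdemR_mul_self k (p := p) i
  have ceq : ∀ a b : Fin n, klrQR k a b i * klrIdemR k i = klrIdemR k i * klrQR k a b i :=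
    fun a b => (klrIdemR_mul_of_mem_klrYAlg k (klrQR_mem_klrYAlg k a b i) i).symm
  have P1E := klrPsiR_mul_klrIdemR_self k (p := p) r i
  have P2E := klrPsiR_mul_klrIdemR_self k (p := p) r' i
  have Z2 := klrPsiR_mul_self_of_eq k h' hbc
  have B1 : klrSR k r' r'' * klrIdemR k i = klrPsiR k r' i * klrQR k r' r'' i - klrIdemR k i := by
    rw [klrSR_mul_klrIdemR', klrPR_of_eq k hbc, mul_one]
  rw [B1]
  have SP2 : klrSR k r r' * klrPsiR k r' i =
      klrPsiR k r i * klrPsiR k r' i * klrQR k r r'' i - klrPsiR k r i - klrPsiR k r' i := by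
    rw [klrSR_mul_of_top_eq k r' hab E2, klrQR_mul_klrPsiR_next_of_eq k h h' hab hbc, mul_sub, P1E, mul_assoc]
  have B2 : klrSR k r r' * (klrPsiR k r' i * klrQR k r' r'' i - klrIdemR k i) =
      klrPsiR k r i * klrPsiR k r' i * (klrQR k r r'' i * klrQR k r' r'' i) - klrPsiR k r i * klrQR k r' r'' i -
        klrPsiR k r' i * klrQR k r' r'' i - klrPsiR k r i * klrQR k r r' i + klrIdemR k i := by
    rw [mul_sub, ← mul_assoc, SP2, klrSR_mul_of_top_eq k r' hab EE, ceq, ← mul_assoc (klrPsiR k r i), P1E]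
    simp only [sub_mul, mul_assoc]
    abel
  rw [B2]
  have SW12 : klrSR k r' r'' * (klrPsiR k r i * klrPsiR k r' i) =
      klrPsiR k r i * klrPsiR k r' i * klrPsiR k r i * klrQR k r r' i + klrPsiR k r' i * klrPsiR k r i -
        klrPsiR k r i * klrPsiR k r' i := by
    have htop : klrIdemR k i * (klrPsiR k r i * klrPsiR k r' i) = klrPsiR k r i * klrPsiR k r' i := by
      rw [← mul_assoc, E1]
    rw [klrSR_next_mul_of_top_eq k r'' hbc htop, ← mul_assoc (klrQR k r' r'' i),
      klrQR_next_mul_klrPsiR_of_eq k h h' hab hbc, sub_mul, E2, mul_assoc,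
      klrQR_far_mul_klrPsiR_next_of_eq k h h' hab hbc, mul_add, P1E, mul_sub, mul_add, ← mul_assoc, ← mul_assoc,
      Z2, ← klrPsiR_braid_of_eq_eq k h h' hab hbc]
    abel
  have SP1 : klrSR k r' r'' * klrPsiR k r i =
      klrPsiR k r' i * klrPsiR k r i * klrQR k r r'' i - klrPsiR k r' i - klrPsiR k r i := by
    rw [klrSR_next_mul_of_top_eq k r'' hbc E1, klrQR_next_mul_klrPsiR_of_eq k h h' hab hbc, mul_sub, P2E,
      mul_assoc]
  have SP2' : klrSR k r' r'' * klrPsiR k r' i = klrPsiR k r' i := by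
    rw [klrSR_next_mul_of_top_eq k r'' hbc E2, klrQR_next_mul_klrPsiR_next_of_eq k h' hbc, mul_add,
      ← mul_assoc, Z2, zero_mul, zero_add, mul_add, P2E]
    abel
  rw [mul_add, mul_sub, mul_sub, mul_sub, ← mul_assoc, SW12, ← mul_assoc (klrSR k r' r'') (klrPsiR k r i), SP1,
    ← mul_assoc (klrSR k r' r'') (klrPsiR k r' i), SP2', ← mul_assoc (klrSR k r' r'') (klrPsiR k r i), SP1, B1]

open scoped IsMulCommutative in
/-- **BK Thm 3.3, braid relation on `ē(𝐢)`, case `i_r = i_{r+1} = i_{r+2}`.** [folklore] -/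
theorem klrSR_braid_mul_klrIdemR_of_eq_eq {r r' r'' : Fin n} (h : (r' : ℕ) = r + 1) (h' : (r'' : ℕ) = r' + 1) {i : Fin n → ZMod p}
    (hab : i r = i r') (hbc : i r' = i r'') :
    klrSR k r r' * (klrSR k r' r'' * (klrSR k r r' * klrIdemR k i)) =
      klrSR k r' r'' * (klrSR k r r' * (klrSR k r' r'' * klrIdemR k i)) := by
  rw [klrSR_triple_lhs_of_eq_eq k h h' hab hbc, klrSR_triple_rhs_of_eq_eq k h h' hab hbc]
  obtain ⟨q1, hq1⟩ : ∃ x : klrYAlg k (p := p) (n := n), (x : KLRAlgebra k p n) = klrQR k r r' i :=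
    ⟨⟨_, klrQR_mem_klrYAlg k _ _ _⟩, rfl⟩
  obtain ⟨q2, hq2⟩ : ∃ x : klrYAlg k (p := p) (n := n), (x : KLRAlgebra k p n) = klrQR k r' r'' i :=
    ⟨⟨_, klrQR_mem_klrYAlg k _ _ _⟩, rfl⟩
  obtain ⟨q3, hq3⟩ : ∃ x : klrYAlg k (p := p) (n := n), (x : KLRAlgebra k p n) = klrQR k r r'' i :=
    ⟨⟨_, klrQR_mem_klrYAlg k _ _ _⟩, rfl⟩
  set W121 := klrPsiR k r i * klrPsiR k r' i * klrPsiR k r i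
  set W21 := klrPsiR k r' i * klrPsiR k r i
  set W12 := klrPsiR k r i * klrPsiR k r' i
  set P1 := klrPsiR k r i
  set P2 := klrPsiR k r' i
  set E := klrIdemR k i
  rw [← hq1, ← hq2, ← hq3]
  have key : ∀ (a121 b121 a21 b21 a12 b12 a1 b1 a2 b2 : klrYAlg k (p := p) (n := n)),
      a121 = b121 → a21 = b21 → a12 = b12 → a1 = b1 → a2 = b2 →
      W121 * a121 + W21 * a21 + W12 * a12 + P1 * a1 + P2 * a2 - E =
        W121 * b121 + W21 * b21 + W12 * b12 + P1 * b1 + P2 * b2 - E := by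
    intros; subst_vars; rfl
  have eL : (W121 * (q2 : KLRAlgebra k p n) + W12 - W21) * ((q3 : KLRAlgebra k p n) * q1) -
      (W12 * (q3 : KLRAlgebra k p n) - P1 - P2) * q1 - P1 * q1 - (W12 * (q3 : KLRAlgebra k p n) - P1 - P2) * q2 +
      (P1 * q1 - E) =
      W121 * ((q2 * (q3 * q1) : klrYAlg k (p := p) (n := n)) : KLRAlgebra k p n) +
        W21 * ((0 - q3 * q1 : klrYAlg k (p := p) (n := n)) : KLRAlgebra k p n) +
        W12 * ((q3 * q1 - q3 * q1 - q3 * q2 : klrYAlg k (p := p) (n := n)) : KLRAlgebra k p n) +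
        P1 * ((q1 - q1 + q2 + q1 : klrYAlg k (p := p) (n := n)) : KLRAlgebra k p n) +
        P2 * ((q1 + q2 : klrYAlg k (p := p) (n := n)) : KLRAlgebra k p n) - E := by
    push_cast
    simp only [sub_mul, add_mul, mul_assoc, mul_add, mul_sub, mul_zero]
    abel
  have eR : (W121 * (q1 : KLRAlgebra k p n) + W21 - W12) * ((q3 : KLRAlgebra k p n) * q2) -
      (W21 * (q3 : KLRAlgebra k p n) - P2 - P1) * q2 - P2 * q2 - (W21 * (q3 : KLRAlgebra k p n) - P2 - P1) * q1 +
      (P2 * q2 - E) =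
      W121 * ((q1 * (q3 * q2) : klrYAlg k (p := p) (n := n)) : KLRAlgebra k p n) +
        W21 * ((q3 * q2 - q3 * q2 - q3 * q1 : klrYAlg k (p := p) (n := n)) : KLRAlgebra k p n) +
        W12 * ((0 - q3 * q2 : klrYAlg k (p := p) (n := n)) : KLRAlgebra k p n) +
        P1 * ((q2 + q1 : klrYAlg k (p := p) (n := n)) : KLRAlgebra k p n) +
        P2 * ((q2 - q2 + q1 + q2 : klrYAlg k (p := p) (n := n)) : KLRAlgebra k p n) - E := by
    push_cast
    simp only [sub_mul, add_mul, mul_assoc, mul_add, mul_sub, mul_zero]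
    abel
  rw [eL, eR]
  apply key <;> ring

end BraidEqual

end Literature.RepresentationTheory.FiniteGroups
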